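import Mathlib
import Literature.NumberTheory.LFunctions.Zhang2022.Section10TruncationBridges
import Literature.NumberTheory.LFunctions.Zhang2022.Section10RangeToolkit
import Literature.NumberTheory.LFunctions.Zhang2022.Section8FrontEnd810
import Literature.NumberTheory.LFunctions.Zhang2022.Section8XiZeroTailMean
import Literature.NumberTheory.LFunctions.Zhang2022.Section8AbelProfiles
import Literature.NumberTheory.LFunctions.Zhang2022.Section8ShiftPerturbation
import Literature.NumberTheory.LFunctions.Zhang2022.Section10Lemma101
import Literature.NumberTheory.LFunctions.Zhang2022.SkeletonLemma84Rel
import HarnessLib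

/-!
# Zhang (2022) §10c: the middle and top ranges of `S_j(𝐚₁₄,𝐚₂₂)` — DAG nodes Z22:§10.u049 (ii) and
# Z22:§10.u050 (i) (`Typed.Sec10C.Mid1422Eval`, `Typed.Sec10C.Top1422Eval`) as EDGES from Lemma 10.1
# and the relative Lemma 8.4

Topic `Literature/NumberTheory/LFunctions/Zhang2022` (Landau–Siegel audit tree; verdict-neutral).
Y. Zhang, *Discrete mean estimates and the Landau–Siegel zero*, arXiv:2211.02515v1 (2022)
[Zhang2022LandauSiegel] — **an unrefereed manuscript under adjudication**; this theorem-only file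
(campaign siegel-zhang, seat L3-t4, grant L3 LEDGER #14 (3)) asserts nothing about Theorems 1–2 and
introduces no definition and no `Prop` fact. It proves the two range claims of the evaluation of
`S_j(𝐚₁₄,𝐚₂₂)` [Z22 p. 59 tex L3028 and p. 60 tex L3040, first lines]:

> "the sum over `P^{0.496} ≤ dr < P^{0.498}` is equal to `(500L′(1,χ)²/log²P) Σ_{P^{0.496}≤n<P^{0.498}}
> |χ(n)|λ₀ⱼ(n)φ(n)⁻¹(−1 − β_j log(P^{−0.496}n))(ι₃𝔤_{j6}(P^{0.498}/n)/0.498 + ι₄𝔤_{j7}(P^{0.5}/n)/0.5)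
> + o(α)`" and "the sum over `P^{0.498} ≤ dr < P^{0.5}` is equal to `(500L′(1,χ)²/log²P)(ι₄/0.5)
> Σ_{P^{0.498}≤n<P^{0.5}} |χ(n)|λ₀ⱼ(n)φ(n)⁻¹(1 − β_j log(P^{0.5}/n))𝔤_{j7}(P^{0.5}/n) + o(α)`"

(typed by L3-t8 as `Typed.Sec10C.Mid1422Eval c′` / `Typed.Sec10C.Top1422Eval c′`) as the EDGE THEOREMS

* `Typed.Sec10C.mid1422Eval_of_rel : Skeleton.Lemma101 c′ → Skeleton.Lemma84Rel c′ → Mid1422Eval c′`,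
* `Typed.Sec10C.top1422Eval_of_rel : Skeleton.Lemma101 c′ → Skeleton.Lemma84Rel c′ → Top1422Eval c′`,

with the corollaries `…_of : Lemma101 c′ → Lemma84 c′ → …` (the printed absolute Lemma 8.4 implies the
relative one, `Skeleton.lemma84Rel_of_lemma84`) and `…_of_lemma84Rel : 0 ≤ c′ → Lemma84Rel c′ → …`
(Lemma 10.1 is the tree's theorem `Skeleton.lemma101_holds` for `c′ ≥ 0`, sz-d45). The net antecedent is
thus the single cone leaf "Lemma 8.4 in its relative form" (`Skeleton.Lemma84Rel`, rows G-adj1-1 /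
G-d55-3 of the gap ledger: the manuscript's Appendix-A argument delivers the error
`O(𝓛⁻⁶∏_{q∣dr}(1 − q⁻¹)⁻²)`, not the printed absolute `O(𝓛⁻⁶)`); the `T`-windows, where Lemma 8.4 does
not apply, are handled by the tree's unconditional THEOREM `XiZeroMajorant.xiZeroTailMean`.

## The printed argument ("in a way similar to the proof of (10.16)"), made quantitative

Write `n = dr`. After re-indexing `S1422On` by `n` and its squarefree divisors `r`
(`Skeleton.sum_box_ite_eq_sum_divisors`, Part R) the summand is `a(n)φ(r)⁻¹·M(n)·N(n/r, r)` with
`a(n) = |χ(n)|λ₀ⱼ(n)/n`, `M(n) = Σ_m … = 𝔳₁ⱼ(nP^{0.004}/(Dt₀))` (L3-t8's bridge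
`Typed.Sec10C.mSum14_eq_frakv1_yShift`) and `N(d,r) = Σ_n χ(n)(ι₃ϰ̄₃ + ι₄ϰ̄₂)(drn)ξ₀ⱼ(n;d,r)/n`.

* **M-layer (Lemma 10.1, Part M).** On `[P^{0.496}, P^{0.5})` the shifted argument `y* = nP^{0.004}/(Dt₀)`
  runs through all six sub-ranges of Lemma 10.1, whence the crude `|M(n)| ≤ (C₁ + 28000e^{9/2})𝓛⁻⁷`
  (using `T^{−c} ≤ 𝓛⁻⁷`); on the main sub-ranges `P^{0.496}Dt₀ < n < P^{0.498}/T` resp.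
  `P^{0.498}Dt₀ < n < P^{0.5}T⁻¹¹` the second resp. third clause of Lemma 10.1 gives
  `|M(n) − M₀(n)| ≤ (C₁ + 2000e^{9/2}·4π·520)𝓛⁻¹⁵` with the printed profiles
  `M₀(n) = (500L′/log P)(−1 − β_j log(P^{−0.496}n))` resp. `(500L′/log P)(1 − β_j log(P^{0.5}/n))`
  (the shift `β_j log(Dt₀) ≪ α𝓛 = π𝓛⁻⁸` is absorbed).
* **N-layer (Lemma 8.4, Parts N, NB).** `ϰ̄₂(drn)`, `ϰ̄₃(drn)` are the Lemma-8.4 kernels at `y = P₂/(dr)`,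
  `P₃/(dr)` (`(y/n)^{−β_μ}log(y/n)/log P_μ`), so `N = ι₃(log P₃)⁻¹S₈₄(6,P₃/dr) + ι₄(log P₂)⁻¹S₈₄(7,P₂/dr)`;
  in the top range `dr ≥ P₃` the first part is an empty sum. The relative Lemma 8.4 gives the main
  approximation `L′(1,χ)Π(d,r)·G(n)` with error `≤ R·C₂𝓛⁻⁶(dr/φ(dr))²`, `R = |ι₃|/log P₃ + |ι₄|/log P₂ ≤ 9𝓛⁻⁹`;
  in the windows (`y ≤ T`) the absolute logarithmic mean of `ξ₀ⱼ` bounds `|N| ≤ R(584e^{9/2}𝓛² + C₂𝓛⁻⁶ +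
  C₃𝓛(1 + log T)³log T)(dr/φ(dr))²`.
* **Assembly (Part A, `range_assembly_bound₃`).** Summing `Σ_{r∣n, μ²(r)=1} φ(r)⁻¹Π(n/r,r) = n/φ(n)`
  ((8.10), the tree's theorem `Section8FrontEnd810.eq810_holds`) collapses the main term to
  `Σ_n a(n)(n/φ(n))·M₀(n)L′(1,χ)G(n)`; all errors are weighted by `Σ‖a(n)‖(n/φ(n))³ ≤ e^{256}(3 + log(v/u))`
  (`Skeleton.sum_ratio_pow_div_le`, Part W): `≤ e^{256}𝓛⁹` over a whole range, `≤ 537e^{256}𝓛^{1.1}` over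
  the windows (log-lengths `log(Dt₀) ≤ 520𝓛` and `log T = 𝓛^{1.1}`, `11𝓛^{1.1}`).
* **G-layer (Part G).** Replacing `(log P₂)⁻¹𝔤_{j7}(P₂/n)` by the printed `𝔤_{j7}(P^{0.5}/n)/(0.5 log P)`
  (`P₂ = P^{1/2}T⁻¹⁰`) costs `≤ 10⁵𝓛^{1.1}𝓛⁻¹⁸` by the Lipschitz bound `|𝔤′| ≤ 449α/u` of
  `Section8AbelProfiles`; `(log P₃)⁻¹ = (0.498 log P)⁻¹` exactly. The collapsed main term then IS
  `midSum1422` / `topSum1422` (Parts F/F′, `mid_mainterm_eq`, `top_mainterm_eq`).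
* **Bookkeeping (`mid_numeric_bound`).** Every error monomial is `≤ K(C₁,C₂,C₃)·τ⁵𝓛⁻¹⁵` with
  `τ = 𝓛^{1.1}` (`τ¹⁰ = 𝓛¹¹`), and `Kτ⁵𝓛⁻¹⁵ ≤ εα = επ𝓛⁻⁹` as soon as `𝓛 ≥ K²/(ε²π²)`; the other
  thresholds are `𝓛 ≥ 4` (`T¹⁰ ≤ P^{0.002}`), `𝓛 ≥ 5|c′|π` (`5|c′|α𝓛 ≤ 1`) and `𝓛 ≥ (7/c)^{10}`
  (`T^{−c} ≤ 𝓛⁻⁷`), all of the form `D ≥ ⌈e^x⌉`.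

All helper statements live in the sub-namespace `Typed.Sec10C.Ranges1422`; the seven edge theorems in
`Typed.Sec10C`. WHAT THIS FILE IS NOT: a proof of Lemma 8.4, of (10.17), of Proposition 2.4, or any
claim about Theorems 1–2 / Landau–Siegel zeros; the companion integral forms `Mid1422Int`/`Top1422Int`
(u049 (iii), u050 (ii)) and the low range `Low1422Small` (u049 (i), L3-t8's `Section10cLowRange`) are
other seats' nodes.

## References

* [Zhang2022LandauSiegel] Y. Zhang, *Discrete mean estimates and the Landau–Siegel zero*,
  arXiv:2211.02515v1, §10 pp. 59–60 (the evaluation of `S_j(𝐚₁₄,𝐚₂₂)`, tex L3028/L3040),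
  Lemma 10.1 p. 53, §8 Lemma 8.4 p. 46, (8.10)–(8.11) pp. 47–48.
-/

noncomputable section

open Complex Real ComplexConjugate Finset
open Literature.NumberTheory.LFunctions.Zhang2022.Skeleton
open Literature.NumberTheory.LFunctions.Zhang2022.Typed.Sec10B (yShift)

namespace Literature.NumberTheory.LFunctions.Zhang2022.Typed.Sec10C

namespace Ranges1422

/-! ## Part P. Parameter facts for `𝓛 ≥ 3` -/

section Params

variable {D : ℕ}

/-- Helper for the §10c range evaluations. [cite: Zhang2022LandauSiegel, §10 pp. 59–60] -/
private theorem log_bigP_eq (D : ℕ) : Real.log (bigP D) = ell D ^ 9 := by rw [bigP, Real.log_exp]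

/-- Helper for the §10c range evaluations. [cite: Zhang2022LandauSiegel, §10 pp. 59–60] -/
private theorem bigP_pos (D : ℕ) : 0 < bigP D := Real.exp_pos _

/-- Helper for the §10c range evaluations. [cite: Zhang2022LandauSiegel, §10 pp. 59–60] -/
private theorem log_bigP_rpow (D : ℕ) (a : ℝ) : Real.log (bigP D ^ a) = a * ell D ^ 9 := by
  rw [Real.log_rpow (bigP_pos D), log_bigP_eq]

/-- Helper for the §10c range evaluations. [cite: Zhang2022LandauSiegel, §10 pp. 59–60] -/
theorem bigP_rpow_pos (D : ℕ) (a : ℝ) : 0 < bigP D ^ a := Real.rpow_pos_of_pos (bigP_pos D) a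

/-- Helper for the §10c range evaluations. [cite: Zhang2022LandauSiegel, §10 pp. 59–60] -/
theorem bigT_pos (D : ℕ) : 0 < bigT D := Real.exp_pos _

/-- Helper for the §10c range evaluations. [cite: Zhang2022LandauSiegel, §10 pp. 59–60] -/
private theorem one_le_bigT (D : ℕ) : 1 ≤ bigT D :=
  Real.one_le_exp (Real.rpow_nonneg (by rw [ell]; exact Real.log_natCast_nonneg D) _)

/-- Helper for the §10c range evaluations. [cite: Zhang2022LandauSiegel, §10 pp. 59–60] -/
private theorem log_bigT_eq (D : ℕ) : Real.log (bigT D) = ell D ^ (1.1 : ℝ) := by rw [bigT, Real.log_exp]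

/-- `3 ≤ 𝓛` forces `3 ≤ D` (indeed `D ≥ 21`). [cite: Zhang2022LandauSiegel, §10 pp. 59–60] -/
theorem three_le_of_ell (h : 3 ≤ ell D) : 3 ≤ D := by
  by_contra hD
  rw [not_le] at hD
  have : ell D < 3 := by
    rw [ell]
    interval_cases D
    · simp
    · simp
    · have := Real.log_two_lt_d9; push_cast; linarith
  linarith

/-- Helper for the §10c range evaluations. [cite: Zhang2022LandauSiegel, §10 pp. 59–60] -/
theorem D_pos_of_ell (h : 3 ≤ ell D) : (0 : ℝ) < D := by
  have := three_le_of_ell h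
  exact_mod_cast (by omega : 0 < D)

/-- Helper for the §10c range evaluations. [cite: Zhang2022LandauSiegel, §10 pp. 59–60] -/
theorem t0_ge_one (h : 3 ≤ ell D) : 1 ≤ t0 D := by
  rw [t0]; exact one_le_pow₀ (by linarith)

/-- Helper for the §10c range evaluations. [cite: Zhang2022LandauSiegel, §10 pp. 59–60] -/
theorem Dt0_ge_one (h : 3 ≤ ell D) : 1 ≤ (D : ℝ) * t0 D := by
  have h3 : (3 : ℝ) ≤ D := by exact_mod_cast three_le_of_ell h
  nlinarith [t0_ge_one h]

/-- Helper for the §10c range evaluations. [cite: Zhang2022LandauSiegel, §10 pp. 59–60] -/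
theorem Dt0_pos (h : 3 ≤ ell D) : 0 < (D : ℝ) * t0 D := lt_of_lt_of_le one_pos (Dt0_ge_one h)

/-- `log(Dt₀) = 𝓛 + 519 log 𝓛 ≤ 520𝓛`. [cite: Zhang2022LandauSiegel, §10 pp. 59–60] -/
theorem log_Dt0_le (h : 3 ≤ ell D) : Real.log ((D : ℝ) * t0 D) ≤ 520 * ell D := by
  have hD := D_pos_of_ell h
  have hℓ : 0 < ell D := by linarith
  rw [Real.log_mul hD.ne' (by rw [t0]; positivity), t0, Real.log_pow, ← ell]
  have : Real.log (ell D) ≤ ell D := (Real.log_le_sub_one_of_pos hℓ).trans (by linarith)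
  push_cast
  nlinarith

/-- Helper for the §10c range evaluations. [cite: Zhang2022LandauSiegel, §10 pp. 59–60] -/
theorem log_Dt0_nonneg (h : 3 ≤ ell D) : 0 ≤ Real.log ((D : ℝ) * t0 D) := Real.log_nonneg (Dt0_ge_one h)

/-- `Dt₀ ≤ P^{0.5}` (from t8's `P^{0.5}·Dt₀ ≤ P/T² ≤ P`).
[cite: Zhang2022LandauSiegel, §10 pp. 59–60] -/
theorem Dt0_le_rpow_half (h : 3 ≤ ell D) : (D : ℝ) * t0 D ≤ bigP D ^ (0.5 : ℝ) := by
  have h1 := Sec10B.rpow50_mul_le_nsuppBound h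
  have hT1 : 1 ≤ bigT D ^ 2 := one_le_pow₀ (one_le_bigT D)
  have h2 : bigP D / bigT D ^ 2 ≤ bigP D := div_le_self (bigP_pos D).le hT1
  have h3 : bigP D = bigP D ^ (0.5 : ℝ) * bigP D ^ (0.5 : ℝ) := by
    rw [← Real.rpow_add (bigP_pos D)]; norm_num
  have hhalf := bigP_rpow_pos D 0.5
  nlinarith [h1.trans h2]

/-- `|L′(1,χ)| ≤ 4e^{9/2}𝓛²` for `χ` primitive and `𝓛 ≥ 3`.
[cite: Zhang2022LandauSiegel, §10 pp. 59–60] -/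
theorem norm_deriv_L_one_le [NeZero D] (χ : DirichletCharacter ℂ D) (h : 3 ≤ ell D)
    (hp : χ.IsPrimitive) : ‖deriv χ.LFunction 1‖ ≤ 4 * Real.exp (9 / 2) * ell D ^ 2 := by
  have hlog : 3 ≤ Real.log D := by simpa only [ell] using h
  have hw : ‖(1 : ℂ) - 1‖ ≤ 1 / Real.log D := by
    rw [sub_self, norm_zero]; exact div_nonneg zero_le_one (by linarith)
  have := Lemma31.norm_deriv_LFunction_le_near_one χ hlog hp hw
  have hℓ' : Real.log (D : ℝ) = ell D := rfl
  rw [hℓ'] at this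
  have hℓ1 : 1 ≤ ell D := by linarith
  refine this.trans ?_
  have he : 0 < Real.exp (9 / 2 : ℝ) := Real.exp_pos _
  have : (1 + ell D) * ell D ≤ 2 * ell D ^ 2 := by nlinarith
  calc 2 * rexp (9 / 2) * (1 + ell D) * ell D = 2 * rexp (9 / 2) * ((1 + ell D) * ell D) := by ring
    _ ≤ 2 * rexp (9 / 2) * (2 * ell D ^ 2) := by gcongr
    _ = 4 * rexp (9 / 2) * ell D ^ 2 := by ring

/-- `α = π/𝓛⁹ > 0`, `α𝓛⁹ = π`. [cite: Zhang2022LandauSiegel, §10 pp. 59–60] -/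
theorem alpha_facts (h : 3 ≤ ell D) :
    0 < alpha D ∧ alpha D = π / ell D ^ 9 ∧ alpha D * ell D ^ 9 = π := by
  have hD := three_le_of_ell h
  exact ⟨Section8ShiftPerturbation.alpha_pos' hD, Section8ShiftPerturbation.alpha_eq_div _,
    Section8ShiftPerturbation.alpha_mul_ell_pow_nine hD⟩

/-- For `1 ≤ x ≤ P`: `0 ≤ log x ≤ 𝓛⁹`. [cite: Zhang2022LandauSiegel, §10 pp. 59–60] -/
theorem log_le_of_le_bigP {x : ℝ} (h1 : 1 ≤ x) (h2 : x ≤ bigP D) :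
    0 ≤ Real.log x ∧ Real.log x ≤ ell D ^ 9 := by
  refine ⟨Real.log_nonneg h1, ?_⟩
  rw [← log_bigP_eq]
  exact Real.log_le_log (by linarith) h2

end Params

/-! ## Part M. The `m`-sum `𝔳₁ⱼ(y*)` from Lemma 10.1 -/

section MLayer

variable (c' : ℝ) {D : ℕ} [NeZero D] (χ : DirichletCharacter ℂ D)

/-- The size of the main terms of (10.3)/(10.4): `‖500L′/log P · w‖ ≤ 2000e^{9/2}𝓛⁻⁷‖w‖`.
[cite: Zhang2022LandauSiegel, §10 pp. 59–60] -/
theorem norm_main101_le (h : 3 ≤ ell D) (hp : χ.IsPrimitive) (w : ℂ) :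
    ‖500 * deriv χ.LFunction 1 / (Real.log (bigP D) : ℂ) * w‖ ≤
      2000 * Real.exp (9 / 2) * (ell D ^ 7)⁻¹ * ‖w‖ := by
  have hℓ : 0 < ell D := by linarith
  have hL := norm_deriv_L_one_le χ h hp
  rw [norm_mul, norm_div, norm_mul, Complex.norm_real, Real.norm_eq_abs, log_bigP_eq,
    abs_of_pos (by positivity)]
  have h500 : ‖(500 : ℂ)‖ = 500 := by norm_num
  rw [h500]
  have h72 : (ell D ^ 7)⁻¹ * ell D ^ 9 = ell D ^ 2 := by
    rw [show ell D ^ 9 = ell D ^ 7 * ell D ^ 2 by ring, ← mul_assoc, inv_mul_cancel₀ (by positivity),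
      one_mul]
  have key : 500 * ‖deriv χ.LFunction 1‖ / ell D ^ 9 ≤ 2000 * Real.exp (9 / 2) * (ell D ^ 7)⁻¹ := by
    rw [div_le_iff₀ (by positivity), mul_assoc, h72]
    nlinarith
  exact mul_le_mul_of_nonneg_right key (norm_nonneg _)

omit [NeZero D] in
/-- `‖±1 − β_j L‖ ≤ 14` when `‖β_j‖ ≤ 4α`, `|L| ≤ 𝓛⁹` (`α𝓛⁹ = π`).
[cite: Zhang2022LandauSiegel, §10 pp. 59–60] -/
theorem norm_one_sub_betaJ_mul_le (h : 3 ≤ ell D) (hc5 : 5 * |c'| * alpha D * ell D ≤ 1) (j : ℕ)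
    (u : ℂ) (hu : ‖u‖ ≤ 1) {L : ℝ} (hL : |L| ≤ ell D ^ 9) :
    ‖u - betaJ c' D j * (L : ℂ)‖ ≤ 14 := by
  obtain ⟨hα, -, hαℓ⟩ := alpha_facts h
  have hβ := Section8AbelProfiles.norm_betaJ_le c' hα.le (by linarith) hc5 j
  calc ‖u - betaJ c' D j * (L : ℂ)‖ ≤ ‖u‖ + ‖betaJ c' D j * (L : ℂ)‖ := norm_sub_le _ _
    _ = ‖u‖ + ‖betaJ c' D j‖ * |L| := by rw [norm_mul, Complex.norm_real, Real.norm_eq_abs]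
    _ ≤ 1 + 4 * alpha D * ell D ^ 9 := by gcongr
    _ ≤ 14 := by rw [mul_assoc, hαℓ]; nlinarith [Real.pi_lt_d2]

/-- **Crude size of `𝔳₁ⱼ(y*)` on `P^{0.496} ≤ n < P^{0.5}`** (all six sub-ranges of Lemma 10.1):
`‖𝔳₁ⱼ(y*(n))‖ ≤ (C + 28000e^{9/2})𝓛⁻⁷`, given `T^{−c} ≤ 𝓛⁻⁷`.
[cite: Zhang2022LandauSiegel, §10 pp. 59–60] -/
theorem norm_frakv1_yShift_le (h : 3 ≤ ell D) (hp : χ.IsPrimitive)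
    (hc5 : 5 * |c'| * alpha D * ell D ≤ 1) {c C : ℝ} (hC : 0 ≤ C)
    (hTc : bigT D ^ (-c) ≤ (ell D ^ 7)⁻¹)
    (h101 : ∀ j ∈ ({1, 2, 3} : Finset ℕ), ∀ y : ℝ,
      (1 ≤ y → y ≤ bigP D ^ (0.5 : ℝ) / bigT D → ‖frakv1 c' χ j y‖ ≤ C * bigT D ^ (-c)) ∧
      (bigP D ^ (0.5 : ℝ) < y → y ≤ bigP D ^ (0.502 : ℝ) / bigT D →
        ‖frakv1 c' χ j y - 500 * deriv χ.LFunction 1 / Real.log (bigP D) *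
          (-1 - betaJ c' D j * (Real.log (y / bigP D ^ (0.5 : ℝ)) : ℂ))‖ ≤ C * (ell D ^ 15)⁻¹) ∧
      (bigP D ^ (0.502 : ℝ) < y → y ≤ bigP D ^ (0.504 : ℝ) / bigT D →
        ‖frakv1 c' χ j y - 500 * deriv χ.LFunction 1 / Real.log (bigP D) *
          (1 - betaJ c' D j * (Real.log (bigP D ^ (0.504 : ℝ) / y) : ℂ))‖ ≤ C * (ell D ^ 15)⁻¹) ∧
      ((bigP D ^ (0.5 : ℝ) / bigT D < y ∧ y ≤ bigP D ^ (0.5 : ℝ)) ∨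
          (bigP D ^ (0.502 : ℝ) / bigT D < y ∧ y ≤ bigP D ^ (0.502 : ℝ)) ∨
          (bigP D ^ (0.504 : ℝ) / bigT D < y ∧ y < bigP D ^ (0.504 : ℝ)) →
        ‖frakv1 c' χ j y‖ ≤ C * (ell D ^ 7)⁻¹))
    {j : ℕ} (hj : j ∈ ({1, 2, 3} : Finset ℕ)) {n : ℕ} (hlo : bigP D ^ (0.496 : ℝ) ≤ n)
    (hhi : (n : ℝ) < bigP D ^ (0.5 : ℝ)) :
    ‖frakv1 c' χ j (yShift D n)‖ ≤ (C + 28000 * Real.exp (9 / 2)) * (ell D ^ 7)⁻¹ := by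
  have hℓ : 0 < ell D := by linarith
  have hℓ1 : 1 ≤ ell D := by linarith
  have hP := bigP_pos D
  have hDt := Dt0_pos h
  have hDt1 := Dt0_ge_one h
  have hT1 := one_le_bigT D
  set ys := yShift D n with hys
  have hys_def : ys = (n : ℝ) * bigP D ^ (0.004 : ℝ) / ((D : ℝ) * t0 D) := rfl
  -- `1 ≤ ys < P^{0.504}`
  have e500 : bigP D ^ (0.496 : ℝ) * bigP D ^ (0.004 : ℝ) = bigP D ^ (0.5 : ℝ) := by
    rw [← Real.rpow_add hP]; norm_num
  have e504 : bigP D ^ (0.5 : ℝ) * bigP D ^ (0.004 : ℝ) = bigP D ^ (0.504 : ℝ) := by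
    rw [← Real.rpow_add hP]; norm_num
  have h004 := bigP_rpow_pos D 0.004
  have hys1 : 1 ≤ ys := by
    rw [hys_def, le_div_iff₀ hDt, one_mul]
    calc (D : ℝ) * t0 D ≤ bigP D ^ (0.5 : ℝ) := Dt0_le_rpow_half h
      _ = bigP D ^ (0.496 : ℝ) * bigP D ^ (0.004 : ℝ) := e500.symm
      _ ≤ n * bigP D ^ (0.004 : ℝ) := by gcongr
  have hys504 : ys < bigP D ^ (0.504 : ℝ) := by
    rw [hys_def, div_lt_iff₀ hDt]
    calc (n : ℝ) * bigP D ^ (0.004 : ℝ) < bigP D ^ (0.5 : ℝ) * bigP D ^ (0.004 : ℝ) := by gcongr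
      _ = bigP D ^ (0.504 : ℝ) := e504
      _ ≤ bigP D ^ (0.504 : ℝ) * ((D : ℝ) * t0 D) := le_mul_of_one_le_right (bigP_rpow_pos D _).le hDt1
  obtain ⟨h1, h2, h3, h4⟩ := h101 j hj ys
  have hℓ7 : 0 < (ell D ^ 7)⁻¹ := by positivity
  have hK : C * (ell D ^ 7)⁻¹ ≤ (C + 28000 * Real.exp (9 / 2)) * (ell D ^ 7)⁻¹ := by
    gcongr; nlinarith [Real.exp_pos (9 / 2 : ℝ)]
  have h15_7 : (ell D ^ 15)⁻¹ ≤ (ell D ^ 7)⁻¹ := by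
    rw [inv_le_inv₀ (by positivity) (by positivity)]
    exact pow_le_pow_right₀ hℓ1 (by norm_num)
  -- main-term sizes
  have main_ii : bigP D ^ (0.5 : ℝ) < ys →
      ‖500 * deriv χ.LFunction 1 / (Real.log (bigP D) : ℂ) *
        (-1 - betaJ c' D j * (Real.log (ys / bigP D ^ (0.5 : ℝ)) : ℂ))‖ ≤
        28000 * Real.exp (9 / 2) * (ell D ^ 7)⁻¹ := by
    intro hlt
    have hx1 : 1 ≤ ys / bigP D ^ (0.5 : ℝ) := by rw [le_div_iff₀ (bigP_rpow_pos D _)]; linarith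
    have hxP : ys / bigP D ^ (0.5 : ℝ) ≤ bigP D := by
      rw [div_le_iff₀ (bigP_rpow_pos D _)]
      have : bigP D ^ (0.504 : ℝ) ≤ bigP D * bigP D ^ (0.5 : ℝ) := by
        rw [show bigP D * bigP D ^ (0.5 : ℝ) = bigP D ^ (1.5 : ℝ) by
          rw [← Real.rpow_one_add' hP.le (by norm_num)]; norm_num]
        exact Real.rpow_le_rpow_of_exponent_le (by
          have := Real.one_le_exp (show (0:ℝ) ≤ ell D ^ 9 by positivity); rwa [bigP]) (by norm_num)
      linarith
    obtain ⟨hl0, hl⟩ := log_le_of_le_bigP hx1 hxP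
    have hw := norm_one_sub_betaJ_mul_le c' h hc5 j (-1) (by simp) (abs_le.mpr ⟨by linarith, hl⟩)
    calc _ ≤ 2000 * Real.exp (9 / 2) * (ell D ^ 7)⁻¹ * ‖(-1 : ℂ) - betaJ c' D j *
          (Real.log (ys / bigP D ^ (0.5 : ℝ)) : ℂ)‖ := norm_main101_le χ h hp _
      _ ≤ 2000 * Real.exp (9 / 2) * (ell D ^ 7)⁻¹ * 14 := by gcongr
      _ = 28000 * Real.exp (9 / 2) * (ell D ^ 7)⁻¹ := by ring
  have main_iii : bigP D ^ (0.502 : ℝ) < ys →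
      ‖500 * deriv χ.LFunction 1 / (Real.log (bigP D) : ℂ) *
        (1 - betaJ c' D j * (Real.log (bigP D ^ (0.504 : ℝ) / ys) : ℂ))‖ ≤
        28000 * Real.exp (9 / 2) * (ell D ^ 7)⁻¹ := by
    intro hlt
    have hys0 : 0 < ys := by linarith
    have hx1 : 1 ≤ bigP D ^ (0.504 : ℝ) / ys := by rw [le_div_iff₀ hys0]; linarith
    have hxP : bigP D ^ (0.504 : ℝ) / ys ≤ bigP D := by
      rw [div_le_iff₀ hys0]
      have h502 := bigP_rpow_pos D 0.502
      have : bigP D ^ (0.504 : ℝ) ≤ bigP D * bigP D ^ (0.502 : ℝ) := by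
        rw [show bigP D * bigP D ^ (0.502 : ℝ) = bigP D ^ (1.502 : ℝ) by
          rw [← Real.rpow_one_add' hP.le (by norm_num)]; norm_num]
        exact Real.rpow_le_rpow_of_exponent_le (by
          have := Real.one_le_exp (show (0:ℝ) ≤ ell D ^ 9 by positivity); rwa [bigP]) (by norm_num)
      nlinarith
    obtain ⟨hl0, hl⟩ := log_le_of_le_bigP hx1 hxP
    have hw := norm_one_sub_betaJ_mul_le c' h hc5 j 1 (by simp) (abs_le.mpr ⟨by linarith, hl⟩)
    calc _ ≤ 2000 * Real.exp (9 / 2) * (ell D ^ 7)⁻¹ * ‖(1 : ℂ) - betaJ c' D j *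
          (Real.log (bigP D ^ (0.504 : ℝ) / ys) : ℂ)‖ := norm_main101_le χ h hp _
      _ ≤ 2000 * Real.exp (9 / 2) * (ell D ^ 7)⁻¹ * 14 := by gcongr
      _ = 28000 * Real.exp (9 / 2) * (ell D ^ 7)⁻¹ := by ring
  -- the six sub-ranges
  by_cases hA : ys ≤ bigP D ^ (0.5 : ℝ) / bigT D
  · calc ‖frakv1 c' χ j ys‖ ≤ C * bigT D ^ (-c) := h1 hys1 hA
      _ ≤ C * (ell D ^ 7)⁻¹ := by gcongr
      _ ≤ _ := hK
  rw [not_le] at hA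
  by_cases hB : ys ≤ bigP D ^ (0.5 : ℝ)
  · exact (h4 (Or.inl ⟨hA, hB⟩)).trans hK
  rw [not_le] at hB
  by_cases hC1 : ys ≤ bigP D ^ (0.502 : ℝ) / bigT D
  · have e := h2 hB hC1
    have := norm_le_norm_add_norm_sub' (frakv1 c' χ j ys)
      (500 * deriv χ.LFunction 1 / (Real.log (bigP D) : ℂ) *
        (-1 - betaJ c' D j * (Real.log (ys / bigP D ^ (0.5 : ℝ)) : ℂ)))
    calc ‖frakv1 c' χ j ys‖ ≤ 28000 * Real.exp (9 / 2) * (ell D ^ 7)⁻¹ + C * (ell D ^ 15)⁻¹ := by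
          linarith [main_ii hB]
      _ ≤ 28000 * Real.exp (9 / 2) * (ell D ^ 7)⁻¹ + C * (ell D ^ 7)⁻¹ := by gcongr
      _ = (C + 28000 * Real.exp (9 / 2)) * (ell D ^ 7)⁻¹ := by ring
  rw [not_le] at hC1
  by_cases hD1 : ys ≤ bigP D ^ (0.502 : ℝ)
  · exact (h4 (Or.inr (Or.inl ⟨hC1, hD1⟩))).trans hK
  rw [not_le] at hD1
  by_cases hE : ys ≤ bigP D ^ (0.504 : ℝ) / bigT D
  · have e := h3 hD1 hE
    have := norm_le_norm_add_norm_sub' (frakv1 c' χ j ys)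
      (500 * deriv χ.LFunction 1 / (Real.log (bigP D) : ℂ) *
        (1 - betaJ c' D j * (Real.log (bigP D ^ (0.504 : ℝ) / ys) : ℂ)))
    calc ‖frakv1 c' χ j ys‖ ≤ 28000 * Real.exp (9 / 2) * (ell D ^ 7)⁻¹ + C * (ell D ^ 15)⁻¹ := by
          linarith [main_iii hD1]
      _ ≤ 28000 * Real.exp (9 / 2) * (ell D ^ 7)⁻¹ + C * (ell D ^ 7)⁻¹ := by gcongr
      _ = (C + 28000 * Real.exp (9 / 2)) * (ell D ^ 7)⁻¹ := by ring
  rw [not_le] at hE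
  exact (h4 (Or.inr (Or.inr ⟨hE, hys504⟩))).trans hK

/-- Moving the logarithm inside the main term of (10.3)/(10.4) by `δ` costs
`≤ 2000e^{9/2}𝓛⁻⁷·4α·|δ|`. [cite: Zhang2022LandauSiegel, §10 pp. 59–60] -/
theorem norm_main101_shift_le (h : 3 ≤ ell D) (hp : χ.IsPrimitive)
    (hc5 : 5 * |c'| * alpha D * ell D ≤ 1) (j : ℕ) (u : ℂ) (L₁ L₂ : ℝ) :
    ‖500 * deriv χ.LFunction 1 / (Real.log (bigP D) : ℂ) * (u - betaJ c' D j * (L₁ : ℂ)) -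
        500 * deriv χ.LFunction 1 / (Real.log (bigP D) : ℂ) * (u - betaJ c' D j * (L₂ : ℂ))‖ ≤
      2000 * Real.exp (9 / 2) * (ell D ^ 7)⁻¹ * (4 * alpha D) * |L₁ - L₂| := by
  obtain ⟨hα, -, -⟩ := alpha_facts h
  have hβ := Section8AbelProfiles.norm_betaJ_le c' hα.le (by linarith) hc5 j
  have e : 500 * deriv χ.LFunction 1 / (Real.log (bigP D) : ℂ) * (u - betaJ c' D j * (L₁ : ℂ)) -
      500 * deriv χ.LFunction 1 / (Real.log (bigP D) : ℂ) * (u - betaJ c' D j * (L₂ : ℂ)) =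
      500 * deriv χ.LFunction 1 / (Real.log (bigP D) : ℂ) * (betaJ c' D j * ((L₂ - L₁ : ℝ) : ℂ)) := by
    push_cast; ring
  rw [e]
  refine (norm_main101_le χ h hp _).trans ?_
  rw [norm_mul, Complex.norm_real, Real.norm_eq_abs, abs_sub_comm]
  have h0 : 0 ≤ 2000 * Real.exp (9 / 2) * (ell D ^ 7)⁻¹ := by
    have : 0 < ell D := by linarith
    positivity
  calc 2000 * Real.exp (9 / 2) * (ell D ^ 7)⁻¹ * (‖betaJ c' D j‖ * |L₁ - L₂|)
      ≤ 2000 * Real.exp (9 / 2) * (ell D ^ 7)⁻¹ * (4 * alpha D * |L₁ - L₂|) := by gcongr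
    _ = 2000 * Real.exp (9 / 2) * (ell D ^ 7)⁻¹ * (4 * alpha D) * |L₁ - L₂| := by ring

/-- **Main mid range of Lemma 10.1 for the shifted sum** (clause (10.3) at `y* ∈ (P^{0.5}, P^{0.502}/T]`):
for `P^{0.496}Dt₀ < n < P^{0.498}/T`,
`‖𝔳₁ⱼ(y*(n)) − (500L′/log P)(−1 − β_j log(P^{−0.496}n))‖ ≤ (C + 2000e^{9/2}·4π·520)𝓛⁻¹⁵`
(the extra `β_j log(Dt₀)` is absorbed). [cite: Zhang2022LandauSiegel, §10 pp. 59–60] -/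
theorem norm_frakv1_yShift_sub_mid (h : 3 ≤ ell D) (hp : χ.IsPrimitive)
    (hc5 : 5 * |c'| * alpha D * ell D ≤ 1) {c C : ℝ}
    (h101 : ∀ j ∈ ({1, 2, 3} : Finset ℕ), ∀ y : ℝ,
      (1 ≤ y → y ≤ bigP D ^ (0.5 : ℝ) / bigT D → ‖frakv1 c' χ j y‖ ≤ C * bigT D ^ (-c)) ∧
      (bigP D ^ (0.5 : ℝ) < y → y ≤ bigP D ^ (0.502 : ℝ) / bigT D →
        ‖frakv1 c' χ j y - 500 * deriv χ.LFunction 1 / Real.log (bigP D) *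
          (-1 - betaJ c' D j * (Real.log (y / bigP D ^ (0.5 : ℝ)) : ℂ))‖ ≤ C * (ell D ^ 15)⁻¹) ∧
      (bigP D ^ (0.502 : ℝ) < y → y ≤ bigP D ^ (0.504 : ℝ) / bigT D →
        ‖frakv1 c' χ j y - 500 * deriv χ.LFunction 1 / Real.log (bigP D) *
          (1 - betaJ c' D j * (Real.log (bigP D ^ (0.504 : ℝ) / y) : ℂ))‖ ≤ C * (ell D ^ 15)⁻¹) ∧
      ((bigP D ^ (0.5 : ℝ) / bigT D < y ∧ y ≤ bigP D ^ (0.5 : ℝ)) ∨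
          (bigP D ^ (0.502 : ℝ) / bigT D < y ∧ y ≤ bigP D ^ (0.502 : ℝ)) ∨
          (bigP D ^ (0.504 : ℝ) / bigT D < y ∧ y < bigP D ^ (0.504 : ℝ)) →
        ‖frakv1 c' χ j y‖ ≤ C * (ell D ^ 7)⁻¹))
    {j : ℕ} (hj : j ∈ ({1, 2, 3} : Finset ℕ)) {n : ℕ}
    (hlo : bigP D ^ (0.496 : ℝ) * ((D : ℝ) * t0 D) < n) (hhi : (n : ℝ) < bigP D ^ (0.498 : ℝ) / bigT D) :
    ‖frakv1 c' χ j (yShift D n) - 500 * deriv χ.LFunction 1 / (Real.log (bigP D) : ℂ) *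
        (-1 - betaJ c' D j * (Real.log (bigP D ^ (-0.496 : ℝ) * n) : ℂ))‖ ≤
      (C + 2000 * Real.exp (9 / 2) * (4 * π) * 520) * (ell D ^ 15)⁻¹ := by
  have hℓ : 0 < ell D := by linarith
  have hP := bigP_pos D
  have hDt := Dt0_pos h
  have hDt1 := Dt0_ge_one h
  have hT := bigT_pos D
  obtain ⟨hα, hαeq, hαℓ⟩ := alpha_facts h
  set ys := yShift D n with hys
  have hys_def : ys = (n : ℝ) * bigP D ^ (0.004 : ℝ) / ((D : ℝ) * t0 D) := rfl
  have e500 : bigP D ^ (0.496 : ℝ) * bigP D ^ (0.004 : ℝ) = bigP D ^ (0.5 : ℝ) := by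
    rw [← Real.rpow_add hP]; norm_num
  have e502 : bigP D ^ (0.498 : ℝ) * bigP D ^ (0.004 : ℝ) = bigP D ^ (0.502 : ℝ) := by
    rw [← Real.rpow_add hP]; norm_num
  have e496 : bigP D ^ (0.004 : ℝ) / bigP D ^ (0.5 : ℝ) = bigP D ^ (-0.496 : ℝ) := by
    rw [← Real.rpow_sub hP]; norm_num
  have h004 := bigP_rpow_pos D 0.004
  have hn0 : (0 : ℝ) < n := lt_trans (by positivity) hlo
  have hlo' : bigP D ^ (0.5 : ℝ) < ys := by
    rw [hys_def, lt_div_iff₀ hDt]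
    calc bigP D ^ (0.5 : ℝ) * ((D : ℝ) * t0 D)
        = bigP D ^ (0.496 : ℝ) * ((D : ℝ) * t0 D) * bigP D ^ (0.004 : ℝ) := by rw [← e500]; ring
      _ < n * bigP D ^ (0.004 : ℝ) := by gcongr
  have hhi' : ys ≤ bigP D ^ (0.502 : ℝ) / bigT D := by
    rw [hys_def, div_le_iff₀ hDt]
    have h1 : (n : ℝ) * bigP D ^ (0.004 : ℝ) ≤ bigP D ^ (0.502 : ℝ) / bigT D := by
      rw [le_div_iff₀ hT]
      have := (lt_div_iff₀ hT).mp hhi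
      nlinarith
    exact h1.trans (le_mul_of_one_le_right (by positivity) hDt1)
  obtain ⟨-, h2, -, -⟩ := h101 j hj ys
  have step := h2 hlo' hhi'
  -- the logarithms
  have hlog : Real.log (ys / bigP D ^ (0.5 : ℝ)) =
      Real.log (bigP D ^ (-0.496 : ℝ) * n) - Real.log ((D : ℝ) * t0 D) := by
    have : ys / bigP D ^ (0.5 : ℝ) = bigP D ^ (-0.496 : ℝ) * n / ((D : ℝ) * t0 D) := by
      rw [hys_def, ← e496]; field_simp
    rw [this, Real.log_div (by positivity) hDt.ne']
  have hshift := norm_main101_shift_le c' χ h hp hc5 j (-1) (Real.log (ys / bigP D ^ (0.5 : ℝ)))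
    (Real.log (bigP D ^ (-0.496 : ℝ) * n))
  rw [hlog, show Real.log (bigP D ^ (-0.496 : ℝ) * n) - Real.log ((D : ℝ) * t0 D) -
      Real.log (bigP D ^ (-0.496 : ℝ) * n) = -Real.log ((D : ℝ) * t0 D) by ring, abs_neg,
    abs_of_nonneg (log_Dt0_nonneg h)] at hshift
  rw [hlog] at step
  have htot := norm_sub_le_norm_sub_add_norm_sub (frakv1 c' χ j ys)
    (500 * deriv χ.LFunction 1 / (Real.log (bigP D) : ℂ) *
      (-1 - betaJ c' D j * ((Real.log (bigP D ^ (-0.496 : ℝ) * n) - Real.log ((D : ℝ) * t0 D) : ℝ) : ℂ)))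
    (500 * deriv χ.LFunction 1 / (Real.log (bigP D) : ℂ) *
      (-1 - betaJ c' D j * (Real.log (bigP D ^ (-0.496 : ℝ) * n) : ℂ)))
  have hDtlog := log_Dt0_le h
  have hbound : 2000 * Real.exp (9 / 2) * (ell D ^ 7)⁻¹ * (4 * alpha D) * Real.log ((D : ℝ) * t0 D) ≤
      2000 * Real.exp (9 / 2) * (4 * π) * 520 * (ell D ^ 15)⁻¹ := by
    rw [hαeq]
    have e15 : (ell D ^ 7)⁻¹ * (ell D ^ 9)⁻¹ * ell D = (ell D ^ 15)⁻¹ := by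
      rw [← mul_inv, ← pow_add, show (7 + 9 : ℕ) = 15 + 1 from rfl, pow_succ, mul_inv, mul_assoc,
        inv_mul_cancel₀ hℓ.ne', mul_one]
    have e1 : 2000 * rexp (9 / 2) * (ell D ^ 7)⁻¹ * (4 * (π / ell D ^ 9)) * Real.log (↑D * t0 D) =
        2000 * rexp (9 / 2) * (4 * π) * ((ell D ^ 7)⁻¹ * (ell D ^ 9)⁻¹ * Real.log (↑D * t0 D)) := by
      rw [div_eq_mul_inv]; ring
    rw [e1, ← e15]
    have h0 : 0 ≤ 2000 * rexp (9 / 2) * (4 * π) := by positivity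
    have h79 : 0 ≤ (ell D ^ 7)⁻¹ * (ell D ^ 9)⁻¹ := by positivity
    calc 2000 * rexp (9 / 2) * (4 * π) * ((ell D ^ 7)⁻¹ * (ell D ^ 9)⁻¹ * Real.log (↑D * t0 D))
        ≤ 2000 * rexp (9 / 2) * (4 * π) * ((ell D ^ 7)⁻¹ * (ell D ^ 9)⁻¹ * (520 * ell D)) := by
          gcongr
      _ = 2000 * rexp (9 / 2) * (4 * π) * 520 * ((ell D ^ 7)⁻¹ * (ell D ^ 9)⁻¹ * ell D) := by ring
  calc _ ≤ C * (ell D ^ 15)⁻¹ + 2000 * Real.exp (9 / 2) * (4 * π) * 520 * (ell D ^ 15)⁻¹ := by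
        linarith
    _ = (C + 2000 * Real.exp (9 / 2) * (4 * π) * 520) * (ell D ^ 15)⁻¹ := by ring

/-- **Main top range of Lemma 10.1 for the shifted sum** (clause (10.4) at `y* ∈ (P^{0.502}, P^{0.504}/T]`):
for `P^{0.498}Dt₀ < n < P^{0.5}/T^{11}`,
`‖𝔳₁ⱼ(y*(n)) − (500L′/log P)(1 − β_j log(P^{0.5}/n))‖ ≤ (C + 2000e^{9/2}·4π·520)𝓛⁻¹⁵`.
[cite: Zhang2022LandauSiegel, §10 pp. 59–60] -/
theorem norm_frakv1_yShift_sub_top (h : 3 ≤ ell D) (hp : χ.IsPrimitive)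
    (hc5 : 5 * |c'| * alpha D * ell D ≤ 1) {c C : ℝ}
    (h101 : ∀ j ∈ ({1, 2, 3} : Finset ℕ), ∀ y : ℝ,
      (1 ≤ y → y ≤ bigP D ^ (0.5 : ℝ) / bigT D → ‖frakv1 c' χ j y‖ ≤ C * bigT D ^ (-c)) ∧
      (bigP D ^ (0.5 : ℝ) < y → y ≤ bigP D ^ (0.502 : ℝ) / bigT D →
        ‖frakv1 c' χ j y - 500 * deriv χ.LFunction 1 / Real.log (bigP D) *
          (-1 - betaJ c' D j * (Real.log (y / bigP D ^ (0.5 : ℝ)) : ℂ))‖ ≤ C * (ell D ^ 15)⁻¹) ∧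
      (bigP D ^ (0.502 : ℝ) < y → y ≤ bigP D ^ (0.504 : ℝ) / bigT D →
        ‖frakv1 c' χ j y - 500 * deriv χ.LFunction 1 / Real.log (bigP D) *
          (1 - betaJ c' D j * (Real.log (bigP D ^ (0.504 : ℝ) / y) : ℂ))‖ ≤ C * (ell D ^ 15)⁻¹) ∧
      ((bigP D ^ (0.5 : ℝ) / bigT D < y ∧ y ≤ bigP D ^ (0.5 : ℝ)) ∨
          (bigP D ^ (0.502 : ℝ) / bigT D < y ∧ y ≤ bigP D ^ (0.502 : ℝ)) ∨
          (bigP D ^ (0.504 : ℝ) / bigT D < y ∧ y < bigP D ^ (0.504 : ℝ)) →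
        ‖frakv1 c' χ j y‖ ≤ C * (ell D ^ 7)⁻¹))
    {j : ℕ} (hj : j ∈ ({1, 2, 3} : Finset ℕ)) {n : ℕ}
    (hlo : bigP D ^ (0.498 : ℝ) * ((D : ℝ) * t0 D) < n)
    (hhi : (n : ℝ) < bigP D ^ (0.5 : ℝ) / bigT D ^ 11) :
    ‖frakv1 c' χ j (yShift D n) - 500 * deriv χ.LFunction 1 / (Real.log (bigP D) : ℂ) *
        (1 - betaJ c' D j * (Real.log (bigP D ^ (0.5 : ℝ) / n) : ℂ))‖ ≤
      (C + 2000 * Real.exp (9 / 2) * (4 * π) * 520) * (ell D ^ 15)⁻¹ := by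
  have hℓ : 0 < ell D := by linarith
  have hP := bigP_pos D
  have hDt := Dt0_pos h
  have hDt1 := Dt0_ge_one h
  have hT := bigT_pos D
  have hT1 := one_le_bigT D
  obtain ⟨hα, hαeq, hαℓ⟩ := alpha_facts h
  set ys := yShift D n with hys
  have hys_def : ys = (n : ℝ) * bigP D ^ (0.004 : ℝ) / ((D : ℝ) * t0 D) := rfl
  have e502 : bigP D ^ (0.498 : ℝ) * bigP D ^ (0.004 : ℝ) = bigP D ^ (0.502 : ℝ) := by
    rw [← Real.rpow_add hP]; norm_num
  have e504 : bigP D ^ (0.5 : ℝ) * bigP D ^ (0.004 : ℝ) = bigP D ^ (0.504 : ℝ) := by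
    rw [← Real.rpow_add hP]; norm_num
  have h004 := bigP_rpow_pos D 0.004
  have hn0 : (0 : ℝ) < n := lt_trans (by positivity) hlo
  have hlo' : bigP D ^ (0.502 : ℝ) < ys := by
    rw [hys_def, lt_div_iff₀ hDt]
    calc bigP D ^ (0.502 : ℝ) * ((D : ℝ) * t0 D)
        = bigP D ^ (0.498 : ℝ) * ((D : ℝ) * t0 D) * bigP D ^ (0.004 : ℝ) := by rw [← e502]; ring
      _ < n * bigP D ^ (0.004 : ℝ) := by gcongr
  have hT11 : bigT D ≤ bigT D ^ 11 := by
    calc bigT D = bigT D ^ 1 := (pow_one _).symm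
      _ ≤ bigT D ^ 11 := pow_le_pow_right₀ hT1 (by norm_num)
  have hhi' : ys ≤ bigP D ^ (0.504 : ℝ) / bigT D := by
    rw [hys_def, div_le_iff₀ hDt]
    have h1 : (n : ℝ) * bigP D ^ (0.004 : ℝ) ≤ bigP D ^ (0.504 : ℝ) / bigT D := by
      rw [le_div_iff₀ hT]
      have h11pos : 0 < bigT D ^ 11 := by positivity
      have := (lt_div_iff₀ h11pos).mp hhi
      have h2 : (n : ℝ) * bigT D ≤ n * bigT D ^ 11 := by gcongr
      nlinarith
    exact h1.trans (le_mul_of_one_le_right (by positivity) hDt1)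
  obtain ⟨-, -, h3, -⟩ := h101 j hj ys
  have step := h3 hlo' hhi'
  have hys0 : 0 < ys := lt_trans (bigP_rpow_pos D _) hlo'
  have hlog : Real.log (bigP D ^ (0.504 : ℝ) / ys) =
      Real.log (bigP D ^ (0.5 : ℝ) / n) + Real.log ((D : ℝ) * t0 D) := by
    have : bigP D ^ (0.504 : ℝ) / ys = bigP D ^ (0.5 : ℝ) / n * ((D : ℝ) * t0 D) := by
      rw [hys_def, ← e504]; field_simp
    rw [this, Real.log_mul (by positivity) hDt.ne']
  have hshift := norm_main101_shift_le c' χ h hp hc5 j 1 (Real.log (bigP D ^ (0.504 : ℝ) / ys))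
    (Real.log (bigP D ^ (0.5 : ℝ) / n))
  rw [hlog, show Real.log (bigP D ^ (0.5 : ℝ) / n) + Real.log ((D : ℝ) * t0 D) -
      Real.log (bigP D ^ (0.5 : ℝ) / n) = Real.log ((D : ℝ) * t0 D) by ring,
    abs_of_nonneg (log_Dt0_nonneg h)] at hshift
  rw [hlog] at step
  have htot := norm_sub_le_norm_sub_add_norm_sub (frakv1 c' χ j ys)
    (500 * deriv χ.LFunction 1 / (Real.log (bigP D) : ℂ) *
      (1 - betaJ c' D j * ((Real.log (bigP D ^ (0.5 : ℝ) / n) + Real.log ((D : ℝ) * t0 D) : ℝ) : ℂ)))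
    (500 * deriv χ.LFunction 1 / (Real.log (bigP D) : ℂ) *
      (1 - betaJ c' D j * (Real.log (bigP D ^ (0.5 : ℝ) / n) : ℂ)))
  have hDtlog := log_Dt0_le h
  have hbound : 2000 * Real.exp (9 / 2) * (ell D ^ 7)⁻¹ * (4 * alpha D) * Real.log ((D : ℝ) * t0 D) ≤
      2000 * Real.exp (9 / 2) * (4 * π) * 520 * (ell D ^ 15)⁻¹ := by
    rw [hαeq]
    have e15 : (ell D ^ 7)⁻¹ * (ell D ^ 9)⁻¹ * ell D = (ell D ^ 15)⁻¹ := by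
      rw [← mul_inv, ← pow_add, show (7 + 9 : ℕ) = 15 + 1 from rfl, pow_succ, mul_inv, mul_assoc,
        inv_mul_cancel₀ hℓ.ne', mul_one]
    have e1 : 2000 * rexp (9 / 2) * (ell D ^ 7)⁻¹ * (4 * (π / ell D ^ 9)) * Real.log (↑D * t0 D) =
        2000 * rexp (9 / 2) * (4 * π) * ((ell D ^ 7)⁻¹ * (ell D ^ 9)⁻¹ * Real.log (↑D * t0 D)) := by
      rw [div_eq_mul_inv]; ring
    rw [e1, ← e15]
    have h0 : 0 ≤ 2000 * rexp (9 / 2) * (4 * π) := by positivity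
    have h79 : 0 ≤ (ell D ^ 7)⁻¹ * (ell D ^ 9)⁻¹ := by positivity
    calc 2000 * rexp (9 / 2) * (4 * π) * ((ell D ^ 7)⁻¹ * (ell D ^ 9)⁻¹ * Real.log (↑D * t0 D))
        ≤ 2000 * rexp (9 / 2) * (4 * π) * ((ell D ^ 7)⁻¹ * (ell D ^ 9)⁻¹ * (520 * ell D)) := by
          gcongr
      _ = 2000 * rexp (9 / 2) * (4 * π) * 520 * ((ell D ^ 7)⁻¹ * (ell D ^ 9)⁻¹ * ell D) := by ring
  calc _ ≤ C * (ell D ^ 15)⁻¹ + 2000 * Real.exp (9 / 2) * (4 * π) * 520 * (ell D ^ 15)⁻¹ := by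
        linarith
    _ = (C + 2000 * Real.exp (9 / 2) * (4 * π) * 520) * (ell D ^ 15)⁻¹ := by ring

end MLayer


/-! ## Part N1. The `n`-sum against the Lemma 8.4 sums -/

section NIdentity

variable (c' : ℝ) {D : ℕ} (χ : DirichletCharacter ℂ D)

/-- For `x ≥ 0` real and `β` purely imaginary: `conj ((x : ℂ) ^ β) = (x : ℂ) ^ (−β)`.
[cite: Zhang2022LandauSiegel, §10 pp. 59–60] -/
theorem conj_ofReal_cpow_of_re_eq_zero {x : ℝ} (hx : 0 ≤ x) {β : ℂ} (hβ : β.re = 0) :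
    conj ((x : ℂ) ^ β) = (x : ℂ) ^ (-β) := by
  have harg : (x : ℂ).arg ≠ π := by
    rw [Complex.arg_ofReal_of_nonneg hx]; exact Real.pi_pos.ne
  have h := Complex.cpow_conj (x : ℂ) β harg
  rw [Complex.conj_ofReal] at h
  have hc : conj β = -β := by
    apply Complex.ext <;> simp [hβ]
  rw [← h, hc]

/-- The generic truncated weight of (8.6): `ϰ(m) = (1 − log m/log Q)(Q/m)^β` for `m < Q`, else `0`;
for `m = d r n` with `y = Q/(dr)`: `conj ϰ(drn) = (log Q)⁻¹ · log(y/n) · (y/n)^{−β}` when `n < y`.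
[cite: Zhang2022LandauSiegel, §10 pp. 59–60] -/
theorem conj_vkGeneric_eq {Q : ℝ} (hQ : 1 < Q) {β : ℂ} (hβ : β.re = 0) {d r n : ℕ} (hd : 1 ≤ d)
    (hr : 1 ≤ r) (hn : 1 ≤ n) :
    conj (((1 - Real.log ((d * r * n : ℕ) : ℝ) / Real.log Q : ℝ) : ℂ) *
        (((Q / ((d * r * n : ℕ) : ℝ) : ℝ) : ℂ) ^ β)) =
      (Real.log Q : ℂ)⁻¹ * ((Real.log (Q / ((d * r : ℕ) : ℝ) / n) : ℝ) : ℂ) *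
        (((Q / ((d * r : ℕ) : ℝ) / n : ℝ) : ℂ) ^ (-β)) := by
  have hm0 : (0 : ℝ) < ((d * r * n : ℕ) : ℝ) := by
    have : 0 < d * r * n := Nat.mul_pos (Nat.mul_pos hd hr) hn
    exact_mod_cast this
  have hQ0 : 0 < Q := by linarith
  have hlogQ : Real.log Q ≠ 0 := (Real.log_pos hQ).ne'
  have hquot : Q / ((d * r : ℕ) : ℝ) / n = Q / ((d * r * n : ℕ) : ℝ) := by
    push_cast; rw [div_div]
  rw [map_mul, Complex.conj_ofReal, conj_ofReal_cpow_of_re_eq_zero (div_pos hQ0 hm0).le hβ, hquot]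
  congr 1
  have : 1 - Real.log ((d * r * n : ℕ) : ℝ) / Real.log Q =
      (Real.log Q)⁻¹ * Real.log (Q / ((d * r * n : ℕ) : ℝ)) := by
    rw [Real.log_div hQ0.ne' hm0.ne']
    field_simp
  rw [this]; push_cast; ring


/-- `β_μ` for `μ = 6` is `β₆`, for `μ = 7` is `β₇`. [cite: Zhang2022LandauSiegel, §10 pp. 59–60] -/
theorem betaMu_six_eq : betaMu D 6 = beta6 D := by simp [betaMu]

/-- Helper for the §10c range evaluations. [cite: Zhang2022LandauSiegel, §10 pp. 59–60] -/
theorem betaMu_seven_eq : betaMu D 7 = beta7 D := by simp [betaMu]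

/-- Helper for the §10c range evaluations. [cite: Zhang2022LandauSiegel, §10 pp. 59–60] -/
theorem beta6_re : (beta6 D).re = 0 := by simp [beta6]

/-- Helper for the §10c range evaluations. [cite: Zhang2022LandauSiegel, §10 pp. 59–60] -/
theorem beta7_re : (beta7 D).re = 0 := by simp [beta7]

/-- **The truncated-weight sum is a Lemma 8.4 sum.** For `ϰ(m) = (1 − log m/log Q)(Q/m)^β·[m < Q]`
(`β ∈ iℝ`, `Q > 1`), `d, r ≥ 1`, `y = Q/(dr)` and `N ≥ ⌈y⌉`:
`Σ_{n<N} χ(n) conj(ϰ(drn)) ξ(n)/n = (log Q)⁻¹ Σ_{n<y} χ(n)ξ(n)n⁻¹(y/n)^{−β}log(y/n)`.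
[cite: Zhang2022LandauSiegel, §10 pp. 59–60] -/
theorem sum_conj_vk_eq {Q : ℝ} (hQ : 1 < Q) {β : ℂ} (hβ : β.re = 0) (vk : ℕ → ℂ)
    (hvk : ∀ m : ℕ, vk m = if (m : ℝ) < Q then
      (((1 - Real.log (m : ℝ) / Real.log Q : ℝ)) : ℂ) * (((Q / m : ℝ)) : ℂ) ^ β else 0)
    (ξ : ℕ → ℂ) {d r N : ℕ} (hd : 1 ≤ d) (hr : 1 ≤ r)
    (hN : ⌈Q / ((d * r : ℕ) : ℝ)⌉₊ ≤ N) :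
    ∑ n ∈ Finset.Ico 1 N, χ (n : ZMod D) * conj (vk (d * r * n)) * ξ n / (n : ℂ) =
      (Real.log Q : ℂ)⁻¹ * ∑ n ∈ Finset.Ico 1 ⌈Q / ((d * r : ℕ) : ℝ)⌉₊,
        χ (n : ZMod D) * ξ n / (n : ℂ) * (((Q / ((d * r : ℕ) : ℝ) / n : ℝ)) : ℂ) ^ (-β) *
          ((Real.log (Q / ((d * r : ℕ) : ℝ) / n) : ℝ) : ℂ) := by
  have hdr : (0 : ℝ) < ((d * r : ℕ) : ℝ) := by exact_mod_cast Nat.mul_pos hd hr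
  have hQ0 : 0 < Q := by linarith
  have hy0 : 0 < Q / ((d * r : ℕ) : ℝ) := div_pos hQ0 hdr
  have hceil1 : 1 ≤ ⌈Q / ((d * r : ℕ) : ℝ)⌉₊ := Nat.one_le_iff_ne_zero.mpr (by
    intro h; rw [Nat.ceil_eq_zero] at h; linarith)
  -- the key equivalence `drn < Q ↔ n < y`
  have hiff : ∀ n : ℕ, ((d * r * n : ℕ) : ℝ) < Q ↔ (n : ℝ) < Q / ((d * r : ℕ) : ℝ) := by
    intro n
    rw [lt_div_iff₀ hdr]
    push_cast
    constructor <;> intro h <;> nlinarith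
  rw [← Finset.sum_Ico_consecutive _ hceil1 hN]
  -- the tail vanishes
  have htail : ∑ n ∈ Finset.Ico ⌈Q / ((d * r : ℕ) : ℝ)⌉₊ N,
      χ (n : ZMod D) * conj (vk (d * r * n)) * ξ n / (n : ℂ) = 0 := by
    refine Finset.sum_eq_zero fun n hn => ?_
    rw [Finset.mem_Ico] at hn
    have hny : ¬ ((n : ℝ) < Q / ((d * r : ℕ) : ℝ)) := not_lt.mpr (Nat.ceil_le.mp hn.1)
    have : ¬ (((d * r * n : ℕ) : ℝ) < Q) := fun h => hny ((hiff n).mp h)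
    rw [hvk, if_neg (by exact_mod_cast this)]
    simp
  rw [htail, add_zero, Finset.mul_sum]
  refine Finset.sum_congr rfl fun n hn => ?_
  rw [Finset.mem_Ico] at hn
  have hn1 : 1 ≤ n := hn.1
  have hny : (n : ℝ) < Q / ((d * r : ℕ) : ℝ) := Nat.lt_ceil.mp hn.2
  have hlt : ((d * r * n : ℕ) : ℝ) < Q := (hiff n).mpr hny
  rw [hvk, if_pos (by exact_mod_cast hlt), conj_vkGeneric_eq hQ hβ hd hr hn1]
  ring

/-- **`nSum22` against the two Lemma 8.4 sums**: for `d, r ≥ 1`,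
`nSum22 = ι₃(log P₃)⁻¹·S84(6, P₃/(dr)) + ι₄(log P₂)⁻¹·S84(7, P₂/(dr))`, provided `1 < P₃`, `1 < P₂`
and both `⌈P₃/(dr)⌉, ⌈P₂/(dr)⌉ ≤ Nsupp`. [cite: Zhang2022LandauSiegel, §10 pp. 59–60] -/
theorem nSum22_eq_S84 (j : ℕ) {d r : ℕ} (hd : 1 ≤ d) (hr : 1 ≤ r) (hP3 : 1 < Skeleton.P3 D)
    (hP2 : 1 < Skeleton.P2 D) (hN3 : ⌈Skeleton.P3 D / ((d * r : ℕ) : ℝ)⌉₊ ≤ Nsupp D)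
    (hN2 : ⌈Skeleton.P2 D / ((d * r : ℕ) : ℝ)⌉₊ ≤ Nsupp D) :
    nSum22 c' χ j d r =
      iota3 * (Real.log (Skeleton.P3 D) : ℂ)⁻¹ *
          (∑ n ∈ Finset.Ico 1 ⌈Skeleton.P3 D / ((d * r : ℕ) : ℝ)⌉₊,
            χ (n : ZMod D) * xiZero c' D j n d r / (n : ℂ) *
              ((Skeleton.P3 D / ((d * r : ℕ) : ℝ) / n : ℝ) : ℂ) ^ (-betaMu D 6) *
                (Real.log (Skeleton.P3 D / ((d * r : ℕ) : ℝ) / n) : ℂ)) +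
        iota4 * (Real.log (Skeleton.P2 D) : ℂ)⁻¹ *
          (∑ n ∈ Finset.Ico 1 ⌈Skeleton.P2 D / ((d * r : ℕ) : ℝ)⌉₊,
            χ (n : ZMod D) * xiZero c' D j n d r / (n : ℂ) *
              ((Skeleton.P2 D / ((d * r : ℕ) : ℝ) / n : ℝ) : ℂ) ^ (-betaMu D 7) *
                (Real.log (Skeleton.P2 D / ((d * r : ℕ) : ℝ) / n) : ℂ)) := by
  have h3 := sum_conj_vk_eq χ hP3 (beta6_re (D := D)) (vk3 D) (fun m => by rfl)
    (fun n => xiZero c' D j n d r) hd hr hN3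
  have h2 := sum_conj_vk_eq χ hP2 (beta7_re (D := D)) (vk2 D) (fun m => by rfl)
    (fun n => xiZero c' D j n d r) hd hr hN2
  unfold nSum22
  rw [betaMu_six_eq, betaMu_seven_eq]
  have hsplit : ∀ n : ℕ, χ (n : ZMod D) *
      (iota3 * conj (vk3 D (d * r * n)) + iota4 * conj (vk2 D (d * r * n))) *
        xiZero c' D j n d r / (n : ℂ) =
      iota3 * (χ (n : ZMod D) * conj (vk3 D (d * r * n)) * xiZero c' D j n d r / (n : ℂ)) +
        iota4 * (χ (n : ZMod D) * conj (vk2 D (d * r * n)) * xiZero c' D j n d r / (n : ℂ)) := by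
    intro n; ring
  simp_rw [hsplit]
  rw [Finset.sum_add_distrib, ← Finset.mul_sum, ← Finset.mul_sum, h3, h2]
  ring

end NIdentity



/-! ## Part A. Abstract assembly with relative tolerances -/

section Assembly

/-- **Abstract range assembly, relative-error variant** (as the toolkit's `range_assembly_bound₂`, but
with the main-range tolerance of the second factor RELATIVE, `‖N − c₀ΠG‖ ≤ e_N·(n/φ(n))²` — the shape
delivered by Lemma 8.4 in its derivable relative form `Skeleton.Lemma84Rel`): the two contributions are
weighted by `|a(n)|(n/φ(n))³`. Pure finite-sum bookkeeping.
[cite: Zhang2022LandauSiegel, §10 pp. 59–60] -/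
theorem range_assembly_bound₃ {S : Finset ℕ} (hS : ∀ n ∈ S, n ≠ 0) (main : ℕ → Prop)
    [DecidablePred main] (a M M₀ G : ℕ → ℂ) (N Pw : ℕ → ℕ → ℂ) (c₀ : ℂ)
    {eM BM BW BG eN eW : ℝ} (heM : 0 ≤ eM) (hBM : 0 ≤ BM) (hBW : 0 ≤ BW)
    (hPi : ∀ n ∈ S, main n →
      ∑ r ∈ n.divisors with Squarefree r, (1 / (Nat.totient r : ℂ)) * Pw (n / r) r =
        (n : ℂ) / (Nat.totient n : ℂ))
    (hM : ∀ n ∈ S, main n → ‖M n - M₀ n‖ ≤ eM) (hM₀ : ∀ n ∈ S, ‖M₀ n‖ ≤ BM)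
    (hMW : ∀ n ∈ S, ¬ main n → ‖M n‖ ≤ BW) (hG : ∀ n ∈ S, ‖G n‖ ≤ BG)
    (hN : ∀ n ∈ S, main n → ∀ r ∈ n.divisors, Squarefree r →
      ‖N (n / r) r - c₀ * Pw (n / r) r * G n‖ ≤ eN * ((n : ℝ) / Nat.totient n) ^ 2)
    (hW : ∀ n ∈ S, ¬ main n → ∀ r ∈ n.divisors, Squarefree r →
      ‖N (n / r) r‖ ≤ eW * ((n : ℝ) / Nat.totient n) ^ 2) :
    ‖(∑ n ∈ S, ∑ r ∈ n.divisors,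
        (if Squarefree r then a n / (Nat.totient r : ℂ) * M n * N (n / r) r else 0)) -
      ∑ n ∈ S, a n * ((n : ℂ) / (Nat.totient n : ℂ)) * (M₀ n * c₀ * G n)‖ ≤
      (∑ n ∈ S.filter main, ‖a n‖ * ((n : ℝ) / Nat.totient n) ^ 3) *
          ((BM + eM) * eN + eM * ‖c₀‖ * BG) +
        (∑ n ∈ S.filter (fun n => ¬ main n), ‖a n‖ * ((n : ℝ) / Nat.totient n) ^ 3) *
          (BW * eW + BM * ‖c₀‖ * BG) := by
  classical
  set L : ℕ → ℂ := fun n => ∑ r ∈ n.divisors,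
    (if Squarefree r then a n / (Nat.totient r : ℂ) * M n * N (n / r) r else 0) with hL
  set R : ℕ → ℂ := fun n => a n * ((n : ℂ) / (Nat.totient n : ℂ)) * (M₀ n * c₀ * G n) with hR
  have hBG : ∀ n ∈ S, 0 ≤ BG := fun n hn => (norm_nonneg _).trans (hG n hn)
  have hφsum : ∀ n ∈ S, ∑ r ∈ n.divisors with Squarefree r, (1 / (Nat.totient r : ℝ)) =
      (n : ℝ) / Nat.totient n := fun n hn => sum_sqfree_divisors_inv_totient (hS n hn)
  have hφpos : ∀ r : ℕ, r ≠ 0 → (0 : ℝ) < Nat.totient r := fun r hr => by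
    exact_mod_cast Nat.totient_pos.mpr (Nat.pos_of_ne_zero hr)
  have hratio1 : ∀ n ∈ S, 1 ≤ (n : ℝ) / Nat.totient n := fun n hn => one_le_self_div_totient (hS n hn)
  have hpow13 : ∀ n ∈ S, (n : ℝ) / Nat.totient n ≤ ((n : ℝ) / Nat.totient n) ^ 3 := by
    intro n hn
    calc (n : ℝ) / Nat.totient n = ((n : ℝ) / Nat.totient n) ^ 1 := (pow_one _).symm
      _ ≤ ((n : ℝ) / Nat.totient n) ^ 3 := pow_le_pow_right₀ (hratio1 n hn) (by norm_num)
  have hLeq : ∀ n ∈ S, L n = a n * M n *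
      ∑ r ∈ n.divisors with Squarefree r, N (n / r) r / (Nat.totient r : ℂ) := by
    intro n hn
    rw [hL]
    simp only
    rw [Finset.sum_filter, Finset.mul_sum]
    refine Finset.sum_congr rfl fun r _ => ?_
    split_ifs
    · ring
    · simp
  have hnφC : ∀ n : ℕ, ‖((n : ℂ) / (Nat.totient n : ℂ))‖ = (n : ℝ) / Nat.totient n := by
    intro n; rw [norm_div, Complex.norm_natCast, Complex.norm_natCast]
  -- MAIN `n`
  have main_bound : ∀ n ∈ S, main n →
      ‖L n - R n‖ ≤ ‖a n‖ * ((n : ℝ) / Nat.totient n) ^ 3 * ((BM + eM) * eN + eM * ‖c₀‖ * BG) := by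
    intro n hn hmain
    have h1n := hratio1 n hn
    have hMle : ‖M n‖ ≤ BM + eM := by
      have h2 : ‖M n‖ ≤ ‖M₀ n‖ + ‖M n - M₀ n‖ := norm_le_norm_add_norm_sub' (M n) (M₀ n)
      linarith [hM n hn hmain, hM₀ n hn]
    set Err : ℂ := ∑ r ∈ n.divisors with Squarefree r,
      (N (n / r) r - c₀ * Pw (n / r) r * G n) / (Nat.totient r : ℂ) with hErr
    have hsplit : ∑ r ∈ n.divisors with Squarefree r, N (n / r) r / (Nat.totient r : ℂ) =
        c₀ * G n * ((n : ℂ) / (Nat.totient n : ℂ)) + Err := by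
      rw [← hPi n hn hmain, hErr, Finset.mul_sum, ← Finset.sum_add_distrib]
      refine Finset.sum_congr rfl fun r _ => ?_
      ring
    have hErr_le : ‖Err‖ ≤ eN * ((n : ℝ) / Nat.totient n) ^ 2 * ((n : ℝ) / Nat.totient n) := by
      have step : ‖Err‖ ≤ ∑ r ∈ n.divisors with Squarefree r,
          eN * ((n : ℝ) / Nat.totient n) ^ 2 * (1 / (Nat.totient r : ℝ)) := by
        rw [hErr]
        refine (norm_sum_le _ _).trans (Finset.sum_le_sum fun r hr => ?_)
        have hr := Finset.mem_filter.mp hr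
        have hr0 : r ≠ 0 := Nat.pos_iff_ne_zero.mp (Nat.pos_of_mem_divisors hr.1)
        rw [norm_div, Complex.norm_natCast, div_eq_mul_one_div]
        exact mul_le_mul_of_nonneg_right (hN n hn hmain r hr.1 hr.2) (by
          have := hφpos r hr0; positivity)
      rw [← Finset.mul_sum, hφsum n hn] at step
      exact step
    have hdiff : L n - R n =
        a n * (M n - M₀ n) * (c₀ * G n) * ((n : ℂ) / (Nat.totient n : ℂ)) + a n * M n * Err := by
      rw [hLeq n hn, hsplit, hR]
      ring
    rw [hdiff]
    refine (norm_add_le _ _).trans ?_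
    rw [norm_mul, norm_mul, norm_mul, norm_mul, norm_mul, norm_mul, hnφC]
    have t1 : ‖a n‖ * ‖M n - M₀ n‖ * (‖c₀‖ * ‖G n‖) * ((n : ℝ) / Nat.totient n) ≤
        ‖a n‖ * eM * (‖c₀‖ * BG) * ((n : ℝ) / Nat.totient n) ^ 3 := by
      have hBG0 := hBG n hn
      gcongr
      · exact hM n hn hmain
      · exact hG n hn
      · exact hpow13 n hn
    have t2 : ‖a n‖ * ‖M n‖ * ‖Err‖ ≤
        ‖a n‖ * (BM + eM) * (eN * ((n : ℝ) / Nat.totient n) ^ 2 * ((n : ℝ) / Nat.totient n)) := by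
      gcongr
    calc ‖a n‖ * ‖M n - M₀ n‖ * (‖c₀‖ * ‖G n‖) * ((n : ℝ) / ↑n.totient) + ‖a n‖ * ‖M n‖ * ‖Err‖
        ≤ ‖a n‖ * eM * (‖c₀‖ * BG) * ((n : ℝ) / Nat.totient n) ^ 3 +
          ‖a n‖ * (BM + eM) * (eN * ((n : ℝ) / Nat.totient n) ^ 2 * ((n : ℝ) / Nat.totient n)) :=
          add_le_add t1 t2
      _ = ‖a n‖ * ((n : ℝ) / Nat.totient n) ^ 3 * ((BM + eM) * eN + eM * ‖c₀‖ * BG) := by ring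
  -- WINDOW `n`
  have win_bound : ∀ n ∈ S, ¬ main n →
      ‖L n - R n‖ ≤ ‖a n‖ * ((n : ℝ) / Nat.totient n) ^ 3 * (BW * eW + BM * ‖c₀‖ * BG) := by
    intro n hn hwin
    have h1n := hratio1 n hn
    have hsumN : ‖∑ r ∈ n.divisors with Squarefree r, N (n / r) r / (Nat.totient r : ℂ)‖ ≤
        eW * ((n : ℝ) / Nat.totient n) ^ 2 * ((n : ℝ) / Nat.totient n) := by
      have step : ‖∑ r ∈ n.divisors with Squarefree r, N (n / r) r / (Nat.totient r : ℂ)‖ ≤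
          ∑ r ∈ n.divisors with Squarefree r,
            eW * ((n : ℝ) / Nat.totient n) ^ 2 * (1 / (Nat.totient r : ℝ)) := by
        refine (norm_sum_le _ _).trans (Finset.sum_le_sum fun r hr => ?_)
        have hr := Finset.mem_filter.mp hr
        have hr0 : r ≠ 0 := Nat.pos_iff_ne_zero.mp (Nat.pos_of_mem_divisors hr.1)
        rw [norm_div, Complex.norm_natCast, div_eq_mul_one_div]
        exact mul_le_mul_of_nonneg_right (hW n hn hwin r hr.1 hr.2) (by
          have := hφpos r hr0; positivity)
      rw [← Finset.mul_sum, hφsum n hn] at step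
      exact step
    have hL' : ‖L n‖ ≤ ‖a n‖ * BW * (eW * ((n : ℝ) / Nat.totient n) ^ 2 * ((n : ℝ) / Nat.totient n)) := by
      rw [hLeq n hn, norm_mul, norm_mul]
      gcongr
      · exact hMW n hn hwin
    have hR' : ‖R n‖ ≤ ‖a n‖ * ((n : ℝ) / Nat.totient n) * (BM * ‖c₀‖ * BG) := by
      rw [hR]
      simp only
      rw [norm_mul, norm_mul, norm_mul, norm_mul, hnφC]
      gcongr
      · exact hM₀ n hn
      · exact hG n hn
    have hR'' : ‖a n‖ * ((n : ℝ) / Nat.totient n) * (BM * ‖c₀‖ * BG) ≤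
        ‖a n‖ * ((n : ℝ) / Nat.totient n) ^ 3 * (BM * ‖c₀‖ * BG) := by
      have hBG0 := hBG n hn
      have := hpow13 n hn
      gcongr
    calc ‖L n - R n‖ ≤ ‖L n‖ + ‖R n‖ := norm_sub_le _ _
      _ ≤ ‖a n‖ * BW * (eW * ((n : ℝ) / Nat.totient n) ^ 2 * ((n : ℝ) / Nat.totient n)) +
          ‖a n‖ * ((n : ℝ) / Nat.totient n) ^ 3 * (BM * ‖c₀‖ * BG) := add_le_add hL' (hR'.trans hR'')
      _ = ‖a n‖ * ((n : ℝ) / Nat.totient n) ^ 3 * (BW * eW + BM * ‖c₀‖ * BG) := by ring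
  -- sum up
  have htot : (∑ n ∈ S, L n) - ∑ n ∈ S, R n = ∑ n ∈ S, (L n - R n) := by
    rw [Finset.sum_sub_distrib]
  rw [htot]
  refine (norm_sum_le _ _).trans ?_
  rw [← Finset.sum_filter_add_sum_filter_not S main, Finset.sum_mul, Finset.sum_mul]
  refine add_le_add (Finset.sum_le_sum fun n hn => ?_) (Finset.sum_le_sum fun n hn => ?_)
  · have h := Finset.mem_filter.mp hn
    exact main_bound n h.1 h.2
  · have h := Finset.mem_filter.mp hn
    exact win_bound n h.1 h.2


end Assembly

/-! ## Part R. Re-indexing the range sum by `n = dr` -/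

section Reindex

variable (c' : ℝ) {D : ℕ} (χ : DirichletCharacter ℂ D)

/-- **Re-indexing `S1422On` by `n = dr`.** For `𝓛 ≥ 3` and a range `[lo, hi)` with `hi ≤ ⌈PT⁻²⌉`:
`S1422On(j; lo, hi) = Σ_{lo ≤ n < hi} Σ_{r ∣ n, r squarefree} a(n)φ(r)⁻¹ · 𝔳₁ⱼ(y*(n)) · nSum22(n/r, r)`.
[cite: Zhang2022LandauSiegel, §10 pp. 59–60] -/
theorem S1422On_eq_divisor_sum (hℓ : 3 ≤ ell D) (j : ℕ) {lo hi : ℝ}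
    (hhi : ∀ n : ℕ, (n : ℝ) < hi → n < Nsupp D) :
    S1422On c' χ j lo hi =
      ∑ n ∈ (Finset.Ico 1 (Nsupp D)).filter (fun n : ℕ => lo ≤ (n : ℝ) ∧ (n : ℝ) < hi),
        ∑ r ∈ n.divisors,
          (if Squarefree r then
            (‖χ (n : ZMod D)‖ : ℂ) * lamZero c' D j n / (n : ℂ) / (Nat.totient r : ℂ) *
              frakv1 c' χ j (yShift D (n : ℝ)) * nSum22 c' χ j (n / r) r else 0) := by
  classical
  unfold S1422On
  rw [Finset.sum_comm]
  rw [sum_box_ite_eq_sum_divisors (Nsupp D) (fun n : ℕ => lo ≤ (n : ℝ) ∧ (n : ℝ) < hi)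
    (fun n hn => hhi n hn.2) (fun d r => term1422 c' χ j d r)]
  refine Finset.sum_congr rfl fun n hn => Finset.sum_congr rfl fun r hr => ?_
  have hn0 : n ≠ 0 := by
    have := (Finset.mem_Ico.mp (Finset.mem_filter.mp hn).1).1; omega
  have hrd : r ∣ n := Nat.dvd_of_mem_divisors hr
  have hr0 : r ≠ 0 := Nat.pos_iff_ne_zero.mp (Nat.pos_of_mem_divisors hr)
  have hdr : n / r * r = n := Nat.div_mul_cancel hrd
  have hd1 : 1 ≤ n / r := Nat.div_pos (Nat.le_of_dvd (Nat.pos_of_ne_zero hn0) hrd)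
    (Nat.pos_of_ne_zero hr0)
  unfold term1422
  rw [norm_chi_mul_norm_moebius_chi χ (n / r) r]
  split_ifs with hsq
  · rw [Sec10C.mSum14_eq_frakv1_yShift c' χ hℓ j hd1 (Nat.one_le_iff_ne_zero.mpr hr0), hdr]
    ring
  · simp

end Reindex


/-! ## Part NB. Sizes of the `n`-sum: main approximation (relative Lemma 8.4) and window bounds -/

section NBounds

variable (c' : ℝ) {D : ℕ} (χ : DirichletCharacter ℂ D)

omit χ in
/-- `∏_{q∣n}(1 − q⁻¹)⁻¹ = n/φ(n)` (`n ≠ 0`). [cite: Zhang2022LandauSiegel, §10 pp. 59–60] -/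
private theorem prod_one_sub_inv_inv_eq {n : ℕ} (hn : n ≠ 0) :
    ∏ q ∈ n.primeFactors, (1 - (q : ℝ)⁻¹)⁻¹ = (n : ℝ) / Nat.totient n := by
  rw [self_div_totient_eq_prod hn]
  refine Finset.prod_congr rfl fun q hq => ?_
  have h2 : (2 : ℝ) ≤ q := by exact_mod_cast (Nat.prime_of_mem_primeFactors hq).two_le
  have hq0 : (q : ℝ) ≠ 0 := by linarith
  have hq1 : (q : ℝ) - 1 ≠ 0 := by linarith
  field_simp

omit χ in
/-- `log P₃ = 0.498𝓛⁹`. [cite: Zhang2022LandauSiegel, §10 pp. 59–60] -/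
theorem log_P3_eq (D : ℕ) : Real.log (Skeleton.P3 D) = 0.498 * ell D ^ 9 := by
  rw [Skeleton.P3, log_bigP_rpow]

omit χ in
/-- `log P₂ = 0.5𝓛⁹ − 10𝓛^{1.1}`. [cite: Zhang2022LandauSiegel, §10 pp. 59–60] -/
theorem log_P2_eq (D : ℕ) : Real.log (Skeleton.P2 D) = 0.5 * ell D ^ 9 - 10 * ell D ^ (1.1 : ℝ) := by
  rw [Skeleton.P2, Real.log_div (bigP_rpow_pos D _).ne' (pow_pos (bigT_pos D) _).ne', log_bigP_rpow,
    Real.log_pow, log_bigT_eq]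
  ring

omit χ in
/-- `𝓛^{1.1} ≤ 𝓛²` (`𝓛 ≥ 1`). [cite: Zhang2022LandauSiegel, §10 pp. 59–60] -/
private theorem ell_rpow_le_sq (h1 : 1 ≤ ell D) : ell D ^ (1.1 : ℝ) ≤ ell D ^ 2 := by
  have h : ell D ^ (1.1 : ℝ) ≤ ell D ^ (2 : ℝ) := Real.rpow_le_rpow_of_exponent_le h1 (by norm_num)
  simpa using h

omit χ in
/-- `𝓛 ≤ 𝓛^{1.1}` (`𝓛 ≥ 1`). [cite: Zhang2022LandauSiegel, §10 pp. 59–60] -/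
private theorem ell_le_rpow (h1 : 1 ≤ ell D) : ell D ≤ ell D ^ (1.1 : ℝ) := by
  have h : ell D ^ (1 : ℝ) ≤ ell D ^ (1.1 : ℝ) := Real.rpow_le_rpow_of_exponent_le h1 (by norm_num)
  simpa using h

omit χ in
/-- For `𝓛 ≥ 3`: `0.4𝓛⁹ ≤ log P₂ ≤ 0.5𝓛⁹`, so `1 < P₂ < P`.
[cite: Zhang2022LandauSiegel, §10 pp. 59–60] -/
theorem log_P2_bounds (h : 3 ≤ ell D) :
    0.4 * ell D ^ 9 ≤ Real.log (Skeleton.P2 D) ∧ Real.log (Skeleton.P2 D) ≤ 0.5 * ell D ^ 9 := by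
  rw [log_P2_eq]
  have h1 : 1 ≤ ell D := by linarith
  have h11 := ell_rpow_le_sq (D := D) h1
  have h7 : (3 : ℝ) ^ 7 ≤ ell D ^ 7 := pow_le_pow_left₀ (by norm_num) h 7
  have hpos : 0 ≤ ell D ^ (1.1 : ℝ) := Real.rpow_nonneg (by linarith) _
  constructor
  · nlinarith [pow_nonneg (by linarith : (0 : ℝ) ≤ ell D) 2]
  · linarith

omit χ in
/-- Helper for the §10c range evaluations. [cite: Zhang2022LandauSiegel, §10 pp. 59–60] -/
theorem one_lt_P3 (h : 3 ≤ ell D) : 1 < Skeleton.P3 D := by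
  have : 0 < Real.log (Skeleton.P3 D) := by rw [log_P3_eq]; positivity
  exact (Real.log_pos_iff (by rw [Skeleton.P3]; exact (bigP_rpow_pos D _).le)).mp this

omit χ in
/-- Helper for the §10c range evaluations. [cite: Zhang2022LandauSiegel, §10 pp. 59–60] -/
private theorem P2_pos (D : ℕ) : 0 < Skeleton.P2 D := by
  rw [Skeleton.P2]; exact div_pos (bigP_rpow_pos D _) (pow_pos (bigT_pos D) _)

omit χ in
/-- Helper for the §10c range evaluations. [cite: Zhang2022LandauSiegel, §10 pp. 59–60] -/
theorem one_lt_P2 (h : 3 ≤ ell D) : 1 < Skeleton.P2 D := by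
  have hℓ : 0 < ell D := by linarith
  have : 0 < Real.log (Skeleton.P2 D) := by
    have := (log_P2_bounds (D := D) h).1
    have : 0 < 0.4 * ell D ^ 9 := by positivity
    linarith
  exact (Real.log_pos_iff (P2_pos D).le).mp this

omit χ in
/-- Helper for the §10c range evaluations. [cite: Zhang2022LandauSiegel, §10 pp. 59–60] -/
theorem log_P2_pos (h : 3 ≤ ell D) : 0 < Real.log (Skeleton.P2 D) := by
  have hℓ : 0 < ell D := by linarith
  have h1 := (log_P2_bounds (D := D) h).1
  have h2 : 0 < 0.4 * ell D ^ 9 := by positivity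
  linarith

omit χ in
/-- Helper for the §10c range evaluations. [cite: Zhang2022LandauSiegel, §10 pp. 59–60] -/
theorem P3_lt_bigP (h : 3 ≤ ell D) : Skeleton.P3 D < bigP D := by
  have hℓ : 0 < ell D := by linarith
  have hP1 : 1 < bigP D := by rw [bigP]; exact Real.one_lt_exp_iff.mpr (by positivity)
  rw [Skeleton.P3]
  calc bigP D ^ (0.498 : ℝ) < bigP D ^ (1 : ℝ) := Real.rpow_lt_rpow_of_exponent_lt hP1 (by norm_num)
    _ = bigP D := Real.rpow_one _

omit χ in
/-- Helper for the §10c range evaluations. [cite: Zhang2022LandauSiegel, §10 pp. 59–60] -/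
theorem P2_lt_bigP (h : 3 ≤ ell D) : Skeleton.P2 D < bigP D := by
  have hℓ : 0 < ell D := by linarith
  have := (log_P2_bounds (D := D) h).2
  have h9 : 0 < ell D ^ 9 := by positivity
  have hlt : Real.log (Skeleton.P2 D) < Real.log (bigP D) := by rw [log_bigP_eq]; linarith
  exact (Real.log_lt_log_iff (P2_pos D) (bigP_pos D)).mp hlt

/-- **Crude bound for a Lemma 8.4 sum**: for `y ≥ 1`,
`‖Σ_{n<y} χ(n)ξ₀ⱼ(n;d,r)n⁻¹(y/n)^{−β_μ}log(y/n)‖ ≤ log y · Σ_{n<y} |ξ₀ⱼ(n;d,r)|/n`.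
[cite: Zhang2022LandauSiegel, §10 pp. 59–60] -/
theorem norm_S84_le_log_mul_sum (j μ d r : ℕ) (y : ℝ) :
    ‖∑ n ∈ Finset.Ico 1 ⌈y⌉₊, χ (n : ZMod D) * xiZero c' D j n d r / (n : ℂ) *
        ((y / n : ℝ) : ℂ) ^ (-betaMu D μ) * (Real.log (y / n) : ℂ)‖ ≤
      Real.log y * ∑ n ∈ Finset.Ico 1 ⌈y⌉₊, ‖xiZero c' D j n d r‖ / n := by
  rw [Finset.mul_sum]
  refine (norm_sum_le _ _).trans (Finset.sum_le_sum fun n hn => ?_)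
  rw [Finset.mem_Ico] at hn
  have hn0 : (0 : ℝ) < n := by exact_mod_cast hn.1
  have hn1 : (1 : ℝ) ≤ n := by exact_mod_cast hn.1
  have hny : (n : ℝ) < y := Nat.lt_ceil.mp hn.2
  have hyn : 1 < y / n := by rw [lt_div_iff₀ hn0]; linarith
  have hyn0 : 0 < y / n := by linarith
  have hlog0 : 0 ≤ Real.log (y / n) := Real.log_nonneg hyn.le
  have hlog : Real.log (y / n) ≤ Real.log y := by
    rw [Real.log_div (by linarith) hn0.ne']
    linarith [Real.log_nonneg hn1]
  have hχ : ‖χ (n : ZMod D)‖ ≤ 1 := DirichletCharacter.norm_le_one χ _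
  have hcpow : ‖((y / n : ℝ) : ℂ) ^ (-betaMu D μ)‖ = 1 := by
    rw [Complex.norm_cpow_eq_rpow_re_of_pos hyn0]
    have : (-betaMu D μ).re = 0 := by
      rw [Complex.neg_re, Section8AbelProfiles.betaMu_re]; simp
    rw [this, Real.rpow_zero]
  rw [norm_mul, norm_mul, norm_div, norm_mul, hcpow, mul_one, Complex.norm_natCast,
    Complex.norm_real, Real.norm_eq_abs, abs_of_nonneg hlog0]
  calc ‖χ (n : ZMod D)‖ * ‖xiZero c' D j n d r‖ / n * Real.log (y / n)
      ≤ 1 * ‖xiZero c' D j n d r‖ / n * Real.log y := by gcongr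
    _ = Real.log y * (‖xiZero c' D j n d r‖ / n) := by ring

/-- A Lemma 8.4 sum with `y < 1` is empty. [cite: Zhang2022LandauSiegel, §10 pp. 59–60] -/
theorem S84_eq_zero_of_lt_one (j μ d r : ℕ) {y : ℝ} (hy : y < 1) :
    ∑ n ∈ Finset.Ico 1 ⌈y⌉₊, χ (n : ZMod D) * xiZero c' D j n d r / (n : ℂ) *
        ((y / n : ℝ) : ℂ) ^ (-betaMu D μ) * (Real.log (y / n) : ℂ) = 0 := by
  have : ⌈y⌉₊ ≤ 1 := Nat.ceil_le.mpr (by push_cast; exact hy.le)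
  rw [Finset.Ico_eq_empty_of_le this, Finset.sum_empty]

variable [NeZero D]

omit [NeZero D] in
/-- `‖𝔤_{jμ}(Q/t)‖ ≤ 146` for `Q, t ∈ [1, P]`, once `5|c′|α𝓛 ≤ 1` (`α log P = π ≤ 4`).
[cite: Zhang2022LandauSiegel, §10 pp. 59–60] -/
theorem norm_frakgW_div_le (hℓ : 3 ≤ ell D) (hc5 : 5 * |c'| * alpha D * ell D ≤ 1) (j μ : ℕ)
    {Q t : ℝ} (hQ1 : 1 ≤ Q) (hQP : Q ≤ bigP D) (ht1 : 1 ≤ t) (htP : t ≤ bigP D) :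
    ‖frakgW c' D j μ (Q / t)‖ ≤ 146 := by
  obtain ⟨hα, -, hαℓ⟩ := alpha_facts hℓ
  have hT : alpha D * Real.log (bigP D) ≤ 4 := by
    rw [log_bigP_eq, hαℓ]; linarith [Real.pi_lt_d2]
  exact (Section8AbelProfiles.frakgW_div_bounds c' j μ hα (by linarith) hc5 hQ1 hQP ht1 htP hT).2.1

/-- **Window size of one Lemma 8.4 part.** With the relative Lemma 8.4 at this `(μ, d, r)` available when
`T < y = Q/(dr)` and the absolute logarithmic mean of `ξ₀ⱼ` (`XiZeroMajorant.xiZeroTailMean`) when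
`y ≤ T`: `‖S84(μ, Q/(dr))‖ ≤ (584e^{9/2}𝓛² + C₂𝓛⁻⁶ + C₃𝓛(1 + log T)³log T)·(dr/φ(dr))²`.
[cite: Zhang2022LandauSiegel, §10 pp. 59–60] -/
theorem norm_S84_window_le (hℓ : 3 ≤ ell D) (hp : χ.IsPrimitive)
    (hc5 : 5 * |c'| * alpha D * ell D ≤ 1) {C₂ C₃ : ℝ} (hC₂ : 0 ≤ C₂) (hC₃ : 0 ≤ C₃)
    (j μ : ℕ) {d r : ℕ} (hd : 1 ≤ d) (hr : 1 ≤ r) (hdrP : ((d * r : ℕ) : ℝ) ≤ bigP D)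
    {Q : ℝ} (hQ1 : 1 ≤ Q) (hQP : Q ≤ bigP D)
    (h84 : bigT D < Q / ((d * r : ℕ) : ℝ) →
      ‖(∑ n ∈ Finset.Ico 1 ⌈Q / ((d * r : ℕ) : ℝ)⌉₊, χ (n : ZMod D) * xiZero c' D j n d r / (n : ℂ) *
            ((Q / ((d * r : ℕ) : ℝ) / n : ℝ) : ℂ) ^ (-betaMu D μ) *
              (Real.log (Q / ((d * r : ℕ) : ℝ) / n) : ℂ)) -
          deriv χ.LFunction 1 * PiW χ d r * frakgW c' D j μ (Q / ((d * r : ℕ) : ℝ))‖ ≤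
        C₂ * (ell D ^ 6)⁻¹ * (∏ q ∈ (d * r).primeFactors, (1 - (q : ℝ)⁻¹)⁻¹) ^ 2)
    (h3 : ∀ x : ℝ, 1 ≤ x → x ≤ bigT D →
      ∑ n ∈ Finset.Ico 1 ⌈x⌉₊, ‖xiZero c' D j n d r‖ / n ≤ C₃ * ell D * (1 + Real.log x) ^ 3) :
    ‖∑ n ∈ Finset.Ico 1 ⌈Q / ((d * r : ℕ) : ℝ)⌉₊, χ (n : ZMod D) * xiZero c' D j n d r / (n : ℂ) *
          ((Q / ((d * r : ℕ) : ℝ) / n : ℝ) : ℂ) ^ (-betaMu D μ) *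
            (Real.log (Q / ((d * r : ℕ) : ℝ) / n) : ℂ)‖ ≤
      (584 * Real.exp (9 / 2) * ell D ^ 2 + C₂ * (ell D ^ 6)⁻¹ +
          C₃ * ell D * (1 + Real.log (bigT D)) ^ 3 * Real.log (bigT D)) *
        ((((d * r : ℕ) : ℝ)) / Nat.totient (d * r)) ^ 2 := by
  have hℓ0 : 0 < ell D := by linarith
  have hdr0 : d * r ≠ 0 := (Nat.mul_pos hd hr).ne'
  have hdr1 : (1 : ℝ) ≤ ((d * r : ℕ) : ℝ) := by exact_mod_cast Nat.mul_pos hd hr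
  have hdrpos : (0 : ℝ) < ((d * r : ℕ) : ℝ) := by linarith
  have hratio1 : 1 ≤ (((d * r : ℕ) : ℝ)) / Nat.totient (d * r) := one_le_self_div_totient hdr0
  have hratio2 : 1 ≤ ((((d * r : ℕ) : ℝ)) / Nat.totient (d * r)) ^ 2 := one_le_pow₀ hratio1
  have hlogT : 0 ≤ Real.log (bigT D) := Real.log_nonneg (one_le_bigT D)
  have hK3 : 0 ≤ C₃ * ell D * (1 + Real.log (bigT D)) ^ 3 * Real.log (bigT D) := by positivity
  have hK1 : 0 ≤ 584 * Real.exp (9 / 2) * ell D ^ 2 := by positivity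
  have hK2 : 0 ≤ C₂ * (ell D ^ 6)⁻¹ := by positivity
  set y := Q / ((d * r : ℕ) : ℝ) with hy
  have hyP : y ≤ bigP D := (div_le_self (by linarith) hdr1).trans hQP
  by_cases hT : bigT D < y
  · -- main form available
    have e := h84 hT
    rw [prod_one_sub_inv_inv_eq hdr0] at e
    have hPi := norm_PiW_le χ (d := d) (r := r) (by omega) (by omega)
    have hL := norm_deriv_L_one_le χ hℓ hp
    have hg : ‖frakgW c' D j μ y‖ ≤ 146 := norm_frakgW_div_le c' hℓ hc5 j μ hQ1 hQP hdr1 hdrP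
    have hmain : ‖deriv χ.LFunction 1 * PiW χ d r * frakgW c' D j μ y‖ ≤
        4 * Real.exp (9 / 2) * ell D ^ 2 * ((((d * r : ℕ) : ℝ)) / Nat.totient (d * r)) ^ 2 * 146 := by
      rw [norm_mul, norm_mul]
      gcongr
    have := norm_le_norm_add_norm_sub' (∑ n ∈ Finset.Ico 1 ⌈y⌉₊, χ (n : ZMod D) *
      xiZero c' D j n d r / (n : ℂ) * ((y / n : ℝ) : ℂ) ^ (-betaMu D μ) * (Real.log (y / n) : ℂ))
      (deriv χ.LFunction 1 * PiW χ d r * frakgW c' D j μ y)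
    calc _ ≤ 4 * Real.exp (9 / 2) * ell D ^ 2 * ((((d * r : ℕ) : ℝ)) / Nat.totient (d * r)) ^ 2 * 146 +
          C₂ * (ell D ^ 6)⁻¹ * ((((d * r : ℕ) : ℝ)) / Nat.totient (d * r)) ^ 2 := by linarith
      _ = (584 * Real.exp (9 / 2) * ell D ^ 2 + C₂ * (ell D ^ 6)⁻¹) *
          ((((d * r : ℕ) : ℝ)) / Nat.totient (d * r)) ^ 2 := by ring
      _ ≤ _ := mul_le_mul_of_nonneg_right (by linarith) (by positivity)
  · rw [not_lt] at hT
    by_cases h1 : y < 1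
    · rw [S84_eq_zero_of_lt_one c' χ j μ d r h1, norm_zero]; positivity
    · rw [not_lt] at h1
      have hb := norm_S84_le_log_mul_sum c' χ j μ d r y
      have hm := h3 y h1 hT
      have hlogy : Real.log y ≤ Real.log (bigT D) := Real.log_le_log (by linarith) hT
      have hlogy0 : 0 ≤ Real.log y := Real.log_nonneg h1
      calc _ ≤ Real.log y * ∑ n ∈ Finset.Ico 1 ⌈y⌉₊, ‖xiZero c' D j n d r‖ / n := hb
        _ ≤ Real.log (bigT D) * (C₃ * ell D * (1 + Real.log (bigT D)) ^ 3) := by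
            refine mul_le_mul hlogy (hm.trans ?_) (Finset.sum_nonneg fun n _ => by positivity) hlogT
            gcongr
        _ = C₃ * ell D * (1 + Real.log (bigT D)) ^ 3 * Real.log (bigT D) * 1 := by ring
        _ ≤ (584 * Real.exp (9 / 2) * ell D ^ 2 + C₂ * (ell D ^ 6)⁻¹ +
            C₃ * ell D * (1 + Real.log (bigT D)) ^ 3 * Real.log (bigT D)) *
            ((((d * r : ℕ) : ℝ)) / Nat.totient (d * r)) ^ 2 :=
            mul_le_mul (by linarith) hratio2 zero_le_one (by positivity)

end NBounds

/-! ## Part NB2. The `n`-sum: main approximation and total window bound; the profile `G` -/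

section NBounds2

variable (c' : ℝ) {D : ℕ} [NeZero D] (χ : DirichletCharacter ℂ D)

omit [NeZero D] χ in
/-- `‖ι₃‖ ≤ 1.25` and `‖ι₄‖ ≤ 2.3` ((2.26): `ι₃ = −1.00635 − 0.22789i`, `ι₄ = −0.68738 + 1.60688i`).
[cite: Zhang2022LandauSiegel, §10 pp. 59–60] -/
private theorem norm_iota3_iota4_le : ‖iota3‖ ≤ 1.25 ∧ ‖iota4‖ ≤ 2.3 := by
  constructor
  · refine (Complex.norm_le_abs_re_add_abs_im _).trans ?_
    simp [iota3]
    norm_num [abs_of_nonneg, abs_of_nonpos]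
  · refine (Complex.norm_le_abs_re_add_abs_im _).trans ?_
    simp [iota4]
    norm_num [abs_of_nonneg, abs_of_nonpos]

omit [NeZero D] χ in
/-- For `𝓛 ≥ 3`: `⌈Q/(dr)⌉ ≤ Nsupp` whenever `Q ≤ P^{0.504}` and `dr ≥ 1`.
[cite: Zhang2022LandauSiegel, §10 pp. 59–60] -/
theorem ceil_div_le_Nsupp (hℓ : 3 ≤ ell D) {Q : ℝ} (hQ : Q ≤ bigP D ^ (0.504 : ℝ)) {m : ℕ} (hm : 1 ≤ m) :
    ⌈Q / (m : ℝ)⌉₊ ≤ Nsupp D := by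
  rw [Nsupp]
  refine Nat.ceil_mono ?_
  have hm1 : (1 : ℝ) ≤ m := by exact_mod_cast hm
  have h504 := Sec10B.rpow504_le_nsuppBound hℓ
  rcases le_or_gt 0 Q with hQ0 | hQ0
  · exact ((div_le_self hQ0 hm1).trans hQ).trans h504
  · have : Q / (m : ℝ) < 0 := div_neg_of_neg_of_pos hQ0 (by linarith)
    have : 0 ≤ bigP D / bigT D ^ 2 := div_nonneg (bigP_pos D).le (pow_nonneg (bigT_pos D).le _)
    linarith

omit [NeZero D] χ in
/-- Helper for the §10c range evaluations. [cite: Zhang2022LandauSiegel, §10 pp. 59–60] -/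
theorem P3_le_rpow504 (D : ℕ) : Skeleton.P3 D ≤ bigP D ^ (0.504 : ℝ) := by
  rw [Skeleton.P3]
  exact Real.rpow_le_rpow_of_exponent_le (by
    have := Real.one_le_exp (show (0:ℝ) ≤ ell D ^ 9 by
      have : 0 ≤ ell D := by rw [ell]; exact Real.log_natCast_nonneg D
      positivity); rwa [bigP]) (by norm_num)

omit [NeZero D] χ in
/-- Helper for the §10c range evaluations. [cite: Zhang2022LandauSiegel, §10 pp. 59–60] -/
private theorem P2_le_rpow_half (D : ℕ) : Skeleton.P2 D ≤ bigP D ^ (0.5 : ℝ) := by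
  rw [Skeleton.P2]
  exact div_le_self (bigP_rpow_pos D _).le (one_le_pow₀ (one_le_bigT D))

omit [NeZero D] χ in
/-- Helper for the §10c range evaluations. [cite: Zhang2022LandauSiegel, §10 pp. 59–60] -/
theorem rpow_half_le_rpow504 (D : ℕ) : bigP D ^ (0.5 : ℝ) ≤ bigP D ^ (0.504 : ℝ) :=
  Real.rpow_le_rpow_of_exponent_le (by
    have := Real.one_le_exp (show (0:ℝ) ≤ ell D ^ 9 by
      have : 0 ≤ ell D := by rw [ell]; exact Real.log_natCast_nonneg D
      positivity); rwa [bigP]) (by norm_num)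

omit [NeZero D] χ in
/-- Helper for the §10c range evaluations. [cite: Zhang2022LandauSiegel, §10 pp. 59–60] -/
theorem P2_le_rpow504 (D : ℕ) : Skeleton.P2 D ≤ bigP D ^ (0.504 : ℝ) :=
  (P2_le_rpow_half D).trans (rpow_half_le_rpow504 D)

omit [NeZero D] in
/-- **`G(m)` is bounded**: `‖ι₃(log P₃)⁻¹𝔤_{j6}(P₃/m) + ι₄(log P₂)⁻¹𝔤_{j7}(P₂/m)‖ ≤ 146(‖ι₃‖/log P₃ + ‖ι₄‖/log P₂)`
for `1 ≤ m ≤ P`. [cite: Zhang2022LandauSiegel, §10 pp. 59–60] -/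
theorem norm_G_le (hℓ : 3 ≤ ell D) (hc5 : 5 * |c'| * alpha D * ell D ≤ 1) (j : ℕ) {m : ℝ}
    (hm1 : 1 ≤ m) (hmP : m ≤ bigP D) :
    ‖iota3 * (Real.log (Skeleton.P3 D) : ℂ)⁻¹ * frakgW c' D j 6 (Skeleton.P3 D / m) +
        iota4 * (Real.log (Skeleton.P2 D) : ℂ)⁻¹ * frakgW c' D j 7 (Skeleton.P2 D / m)‖ ≤
      146 * (‖iota3‖ / Real.log (Skeleton.P3 D) + ‖iota4‖ / Real.log (Skeleton.P2 D)) := by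
  have hℓ0 : 0 < ell D := by linarith
  have hP3 : 0 < Real.log (Skeleton.P3 D) := by rw [log_P3_eq]; positivity
  have hP2 : 0 < Real.log (Skeleton.P2 D) := log_P2_pos hℓ
  have g6 := norm_frakgW_div_le c' hℓ hc5 j 6 (one_lt_P3 hℓ).le (P3_lt_bigP hℓ).le hm1 hmP
  have g7 := norm_frakgW_div_le c' hℓ hc5 j 7 (one_lt_P2 hℓ).le (P2_lt_bigP hℓ).le hm1 hmP
  have n3 : ‖(Real.log (Skeleton.P3 D) : ℂ)⁻¹‖ = (Real.log (Skeleton.P3 D))⁻¹ := by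
    rw [norm_inv, Complex.norm_real, Real.norm_eq_abs, abs_of_pos hP3]
  have n2 : ‖(Real.log (Skeleton.P2 D) : ℂ)⁻¹‖ = (Real.log (Skeleton.P2 D))⁻¹ := by
    rw [norm_inv, Complex.norm_real, Real.norm_eq_abs, abs_of_pos hP2]
  refine (norm_add_le _ _).trans ?_
  rw [norm_mul, norm_mul, norm_mul, norm_mul, n3, n2]
  calc ‖iota3‖ * (Real.log (Skeleton.P3 D))⁻¹ * ‖frakgW c' D j 6 (Skeleton.P3 D / m)‖ +
        ‖iota4‖ * (Real.log (Skeleton.P2 D))⁻¹ * ‖frakgW c' D j 7 (Skeleton.P2 D / m)‖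
      ≤ ‖iota3‖ * (Real.log (Skeleton.P3 D))⁻¹ * 146 + ‖iota4‖ * (Real.log (Skeleton.P2 D))⁻¹ * 146 := by
        gcongr
    _ = 146 * (‖iota3‖ / Real.log (Skeleton.P3 D) + ‖iota4‖ / Real.log (Skeleton.P2 D)) := by ring

/-- **Main approximation of the `n`-sum** (both parts inside Lemma 8.4's range `T < x`): for
`d, r ≥ 1` with `dr < P₃/T` (so also `dr < P₂/T`, `dr < PT⁻²`), from the relative Lemma 8.4 at
`(μ, x) = (6, P₃/(dr))` and `(7, P₂/(dr))`:
`‖nSum22 − L′(1,χ)Π(d,r)G(dr)‖ ≤ (‖ι₃‖/log P₃ + ‖ι₄‖/log P₂)·C₂𝓛⁻⁶(dr/φ(dr))²`.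
[cite: Zhang2022LandauSiegel, §10 pp. 59–60] -/
theorem norm_nSum22_sub_main_le (hℓ : 3 ≤ ell D) (j : ℕ) {d r : ℕ} (hd : 1 ≤ d) (hr : 1 ≤ r)
    {C₂ : ℝ}
    (h6 : ‖(∑ n ∈ Finset.Ico 1 ⌈Skeleton.P3 D / ((d * r : ℕ) : ℝ)⌉₊,
            χ (n : ZMod D) * xiZero c' D j n d r / (n : ℂ) *
              ((Skeleton.P3 D / ((d * r : ℕ) : ℝ) / n : ℝ) : ℂ) ^ (-betaMu D 6) *
                (Real.log (Skeleton.P3 D / ((d * r : ℕ) : ℝ) / n) : ℂ)) -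
          deriv χ.LFunction 1 * PiW χ d r * frakgW c' D j 6 (Skeleton.P3 D / ((d * r : ℕ) : ℝ))‖ ≤
        C₂ * (ell D ^ 6)⁻¹ * (∏ q ∈ (d * r).primeFactors, (1 - (q : ℝ)⁻¹)⁻¹) ^ 2)
    (h7 : ‖(∑ n ∈ Finset.Ico 1 ⌈Skeleton.P2 D / ((d * r : ℕ) : ℝ)⌉₊,
            χ (n : ZMod D) * xiZero c' D j n d r / (n : ℂ) *
              ((Skeleton.P2 D / ((d * r : ℕ) : ℝ) / n : ℝ) : ℂ) ^ (-betaMu D 7) *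
                (Real.log (Skeleton.P2 D / ((d * r : ℕ) : ℝ) / n) : ℂ)) -
          deriv χ.LFunction 1 * PiW χ d r * frakgW c' D j 7 (Skeleton.P2 D / ((d * r : ℕ) : ℝ))‖ ≤
        C₂ * (ell D ^ 6)⁻¹ * (∏ q ∈ (d * r).primeFactors, (1 - (q : ℝ)⁻¹)⁻¹) ^ 2) :
    ‖nSum22 c' χ j d r - deriv χ.LFunction 1 * PiW χ d r *
        (iota3 * (Real.log (Skeleton.P3 D) : ℂ)⁻¹ * frakgW c' D j 6 (Skeleton.P3 D / ((d * r : ℕ) : ℝ)) +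
          iota4 * (Real.log (Skeleton.P2 D) : ℂ)⁻¹ * frakgW c' D j 7 (Skeleton.P2 D / ((d * r : ℕ) : ℝ)))‖ ≤
      (‖iota3‖ / Real.log (Skeleton.P3 D) + ‖iota4‖ / Real.log (Skeleton.P2 D)) *
        (C₂ * (ell D ^ 6)⁻¹ * ((((d * r : ℕ) : ℝ)) / Nat.totient (d * r)) ^ 2) := by
  have hℓ0 : 0 < ell D := by linarith
  have hdr0 : d * r ≠ 0 := (Nat.mul_pos hd hr).ne'
  have hP3 : 0 < Real.log (Skeleton.P3 D) := by rw [log_P3_eq]; positivity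
  have hP2 : 0 < Real.log (Skeleton.P2 D) := log_P2_pos hℓ
  rw [prod_one_sub_inv_inv_eq hdr0] at h6 h7
  rw [nSum22_eq_S84 c' χ j hd hr (one_lt_P3 hℓ) (one_lt_P2 hℓ)
    (ceil_div_le_Nsupp hℓ (P3_le_rpow504 D) (Nat.mul_pos hd hr))
    (ceil_div_le_Nsupp hℓ (P2_le_rpow504 D) (Nat.mul_pos hd hr))]
  set S6 := ∑ n ∈ Finset.Ico 1 ⌈Skeleton.P3 D / ((d * r : ℕ) : ℝ)⌉₊,
            χ (n : ZMod D) * xiZero c' D j n d r / (n : ℂ) *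
              ((Skeleton.P3 D / ((d * r : ℕ) : ℝ) / n : ℝ) : ℂ) ^ (-betaMu D 6) *
                (Real.log (Skeleton.P3 D / ((d * r : ℕ) : ℝ) / n) : ℂ) with hS6
  set S7 := ∑ n ∈ Finset.Ico 1 ⌈Skeleton.P2 D / ((d * r : ℕ) : ℝ)⌉₊,
            χ (n : ZMod D) * xiZero c' D j n d r / (n : ℂ) *
              ((Skeleton.P2 D / ((d * r : ℕ) : ℝ) / n : ℝ) : ℂ) ^ (-betaMu D 7) *
                (Real.log (Skeleton.P2 D / ((d * r : ℕ) : ℝ) / n) : ℂ) with hS7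
  set L1 := deriv χ.LFunction 1
  set g6 := frakgW c' D j 6 (Skeleton.P3 D / ((d * r : ℕ) : ℝ))
  set g7 := frakgW c' D j 7 (Skeleton.P2 D / ((d * r : ℕ) : ℝ))
  have e : iota3 * (Real.log (Skeleton.P3 D) : ℂ)⁻¹ * S6 + iota4 * (Real.log (Skeleton.P2 D) : ℂ)⁻¹ * S7 -
      L1 * PiW χ d r * (iota3 * (Real.log (Skeleton.P3 D) : ℂ)⁻¹ * g6 +
        iota4 * (Real.log (Skeleton.P2 D) : ℂ)⁻¹ * g7) =
      iota3 * (Real.log (Skeleton.P3 D) : ℂ)⁻¹ * (S6 - L1 * PiW χ d r * g6) +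
        iota4 * (Real.log (Skeleton.P2 D) : ℂ)⁻¹ * (S7 - L1 * PiW χ d r * g7) := by ring
  rw [e]
  have n3 : ‖(Real.log (Skeleton.P3 D) : ℂ)⁻¹‖ = (Real.log (Skeleton.P3 D))⁻¹ := by
    rw [norm_inv, Complex.norm_real, Real.norm_eq_abs, abs_of_pos hP3]
  have n2 : ‖(Real.log (Skeleton.P2 D) : ℂ)⁻¹‖ = (Real.log (Skeleton.P2 D))⁻¹ := by
    rw [norm_inv, Complex.norm_real, Real.norm_eq_abs, abs_of_pos hP2]
  refine (norm_add_le _ _).trans ?_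
  rw [norm_mul, norm_mul, norm_mul, norm_mul, n3, n2]
  calc ‖iota3‖ * (Real.log (Skeleton.P3 D))⁻¹ * ‖S6 - L1 * PiW χ d r * g6‖ +
        ‖iota4‖ * (Real.log (Skeleton.P2 D))⁻¹ * ‖S7 - L1 * PiW χ d r * g7‖
      ≤ ‖iota3‖ * (Real.log (Skeleton.P3 D))⁻¹ *
          (C₂ * (ell D ^ 6)⁻¹ * ((((d * r : ℕ) : ℝ)) / Nat.totient (d * r)) ^ 2) +
        ‖iota4‖ * (Real.log (Skeleton.P2 D))⁻¹ *
          (C₂ * (ell D ^ 6)⁻¹ * ((((d * r : ℕ) : ℝ)) / Nat.totient (d * r)) ^ 2) := by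
        gcongr
    _ = _ := by ring

/-- **Total window bound for the `n`-sum**:
`‖nSum22‖ ≤ (‖ι₃‖/log P₃ + ‖ι₄‖/log P₂)(584e^{9/2}𝓛² + C₂𝓛⁻⁶ + C₃𝓛(1 + log T)³log T)(dr/φ(dr))²`.
[cite: Zhang2022LandauSiegel, §10 pp. 59–60] -/
theorem norm_nSum22_window_le (hℓ : 3 ≤ ell D) (hp : χ.IsPrimitive)
    (hc5 : 5 * |c'| * alpha D * ell D ≤ 1) {C₂ C₃ : ℝ} (hC₂ : 0 ≤ C₂) (hC₃ : 0 ≤ C₃)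
    (j : ℕ) {d r : ℕ} (hd : 1 ≤ d) (hr : 1 ≤ r) (hdrP : ((d * r : ℕ) : ℝ) ≤ bigP D)
    (h6 : bigT D < Skeleton.P3 D / ((d * r : ℕ) : ℝ) →
      ‖(∑ n ∈ Finset.Ico 1 ⌈Skeleton.P3 D / ((d * r : ℕ) : ℝ)⌉₊,
            χ (n : ZMod D) * xiZero c' D j n d r / (n : ℂ) *
              ((Skeleton.P3 D / ((d * r : ℕ) : ℝ) / n : ℝ) : ℂ) ^ (-betaMu D 6) *
                (Real.log (Skeleton.P3 D / ((d * r : ℕ) : ℝ) / n) : ℂ)) -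
          deriv χ.LFunction 1 * PiW χ d r * frakgW c' D j 6 (Skeleton.P3 D / ((d * r : ℕ) : ℝ))‖ ≤
        C₂ * (ell D ^ 6)⁻¹ * (∏ q ∈ (d * r).primeFactors, (1 - (q : ℝ)⁻¹)⁻¹) ^ 2)
    (h7 : bigT D < Skeleton.P2 D / ((d * r : ℕ) : ℝ) →
      ‖(∑ n ∈ Finset.Ico 1 ⌈Skeleton.P2 D / ((d * r : ℕ) : ℝ)⌉₊,
            χ (n : ZMod D) * xiZero c' D j n d r / (n : ℂ) *
              ((Skeleton.P2 D / ((d * r : ℕ) : ℝ) / n : ℝ) : ℂ) ^ (-betaMu D 7) *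
                (Real.log (Skeleton.P2 D / ((d * r : ℕ) : ℝ) / n) : ℂ)) -
          deriv χ.LFunction 1 * PiW χ d r * frakgW c' D j 7 (Skeleton.P2 D / ((d * r : ℕ) : ℝ))‖ ≤
        C₂ * (ell D ^ 6)⁻¹ * (∏ q ∈ (d * r).primeFactors, (1 - (q : ℝ)⁻¹)⁻¹) ^ 2)
    (h3 : ∀ x : ℝ, 1 ≤ x → x ≤ bigT D →
      ∑ n ∈ Finset.Ico 1 ⌈x⌉₊, ‖xiZero c' D j n d r‖ / n ≤ C₃ * ell D * (1 + Real.log x) ^ 3) :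
    ‖nSum22 c' χ j d r‖ ≤
      (‖iota3‖ / Real.log (Skeleton.P3 D) + ‖iota4‖ / Real.log (Skeleton.P2 D)) *
        ((584 * Real.exp (9 / 2) * ell D ^ 2 + C₂ * (ell D ^ 6)⁻¹ +
            C₃ * ell D * (1 + Real.log (bigT D)) ^ 3 * Real.log (bigT D)) *
          ((((d * r : ℕ) : ℝ)) / Nat.totient (d * r)) ^ 2) := by
  have hℓ0 : 0 < ell D := by linarith
  have hP3 : 0 < Real.log (Skeleton.P3 D) := by rw [log_P3_eq]; positivity
  have hP2 : 0 < Real.log (Skeleton.P2 D) := log_P2_pos hℓ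
  have b6 := norm_S84_window_le c' χ hℓ hp hc5 hC₂ hC₃ j 6 hd hr hdrP (one_lt_P3 hℓ).le
    (P3_lt_bigP hℓ).le h6 h3
  have b7 := norm_S84_window_le c' χ hℓ hp hc5 hC₂ hC₃ j 7 hd hr hdrP (one_lt_P2 hℓ).le
    (P2_lt_bigP hℓ).le h7 h3
  rw [nSum22_eq_S84 c' χ j hd hr (one_lt_P3 hℓ) (one_lt_P2 hℓ)
    (ceil_div_le_Nsupp hℓ (P3_le_rpow504 D) (Nat.mul_pos hd hr))
    (ceil_div_le_Nsupp hℓ (P2_le_rpow504 D) (Nat.mul_pos hd hr))]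
  have n3 : ‖(Real.log (Skeleton.P3 D) : ℂ)⁻¹‖ = (Real.log (Skeleton.P3 D))⁻¹ := by
    rw [norm_inv, Complex.norm_real, Real.norm_eq_abs, abs_of_pos hP3]
  have n2 : ‖(Real.log (Skeleton.P2 D) : ℂ)⁻¹‖ = (Real.log (Skeleton.P2 D))⁻¹ := by
    rw [norm_inv, Complex.norm_real, Real.norm_eq_abs, abs_of_pos hP2]
  refine (norm_add_le _ _).trans ?_
  rw [norm_mul, norm_mul, norm_mul, norm_mul, n3, n2]
  set K := (584 * Real.exp (9 / 2) * ell D ^ 2 + C₂ * (ell D ^ 6)⁻¹ +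
            C₃ * ell D * (1 + Real.log (bigT D)) ^ 3 * Real.log (bigT D)) *
          ((((d * r : ℕ) : ℝ)) / Nat.totient (d * r)) ^ 2
  calc _ ≤ ‖iota3‖ * (Real.log (Skeleton.P3 D))⁻¹ * K + ‖iota4‖ * (Real.log (Skeleton.P2 D))⁻¹ * K := by
        gcongr
    _ = _ := by ring

end NBounds2

/-! ## Part G. Replacing `P₂ = P^{0.5}T^{−10}` by `P^{0.5}` in the printed main term -/

section GLayer

variable (c' : ℝ) {D : ℕ} (χ : DirichletCharacter ℂ D)

omit χ in
/-- `log(P^{0.5}/m) − log(P₂/m) = 10𝓛^{1.1}` (`m > 0`).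
[cite: Zhang2022LandauSiegel, §10 pp. 59–60] -/
theorem log_half_div_sub_log_P2_div {m : ℝ} (hm : 0 < m) :
    Real.log (bigP D ^ (0.5 : ℝ) / m) - Real.log (Skeleton.P2 D / m) = 10 * ell D ^ (1.1 : ℝ) := by
  rw [Real.log_div (bigP_rpow_pos D _).ne' hm.ne', Real.log_div (P2_pos D).ne' hm.ne', log_P2_eq,
    log_bigP_rpow]
  ring

omit χ in
/-- **Lipschitz step**: `‖𝔤_{j7}(P₂/m) − 𝔤_{j7}(P^{0.5}/m)‖ ≤ 449α·10𝓛^{1.1}` for `1 ≤ m ≤ P^{0.5}`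
(`𝔤′ ≪ α` on `α|L| ≤ 4`, `Section8AbelProfiles.norm_frakg_le`).
[cite: Zhang2022LandauSiegel, §10 pp. 59–60] -/
theorem norm_frakgW7_P2_sub_le (hℓ : 3 ≤ ell D) (hc5 : 5 * |c'| * alpha D * ell D ≤ 1) (j : ℕ)
    {m : ℝ} (hm1 : 1 ≤ m) (hmP : m ≤ bigP D ^ (0.5 : ℝ)) :
    ‖frakgW c' D j 7 (Skeleton.P2 D / m) - frakgW c' D j 7 (bigP D ^ (0.5 : ℝ) / m)‖ ≤
      449 * alpha D * (10 * ell D ^ (1.1 : ℝ)) := by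
  obtain ⟨hα, hαeq, hαℓ⟩ := alpha_facts hℓ
  have hℓ0 : 0 < ell D := by linarith
  have hℓ1 : 1 ≤ ell D := by linarith
  have hm0 : 0 < m := by linarith
  set β1 := betaJ c' D (j + 1)
  set β2 := betaJ c' D (j + 2)
  set βμ := betaMu D 7
  set L₁ := Real.log (Skeleton.P2 D / m) with hL₁
  set L₂ := Real.log (bigP D ^ (0.5 : ℝ) / m) with hL₂
  have hdiff : L₂ - L₁ = 10 * ell D ^ (1.1 : ℝ) := log_half_div_sub_log_P2_div hm0
  have h11pos : 0 ≤ ell D ^ (1.1 : ℝ) := Real.rpow_nonneg hℓ0.le _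
  have hle : L₁ ≤ L₂ := by linarith
  -- the range of `L`: `−𝓛⁹ ≤ L₁ ≤ L ≤ L₂ ≤ 0.5𝓛⁹`
  have hL₂le : L₂ ≤ 0.5 * ell D ^ 9 := by
    rw [hL₂, Real.log_div (bigP_rpow_pos D _).ne' hm0.ne', log_bigP_rpow]
    linarith [Real.log_nonneg hm1]
  have hL₁ge : -(ell D ^ 9) ≤ L₁ := by
    have h11 := ell_rpow_le_sq (D := D) hℓ1
    have h7 : (3 : ℝ) ^ 7 ≤ ell D ^ 7 := pow_le_pow_left₀ (by norm_num) hℓ 7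
    have hL₂ge : 0 ≤ L₂ := by
      rw [hL₂]; exact Real.log_nonneg (by rw [le_div_iff₀ hm0]; linarith)
    nlinarith [pow_nonneg hℓ0.le 2]
  set f : ℝ → ℂ := fun L => frakg β1 β2 βμ (L : ℂ) with hf
  set f' : ℝ → ℂ := fun L => cexp (-(βμ * (L : ℂ))) * (-((β1 - βμ) * (β2 - βμ) / βμ) -
        (1 - β1 * β2 / βμ ^ 2 - (β1 - βμ) * (β2 - βμ) / βμ * (L : ℂ)) * βμ) with hf'
  have hderiv : ∀ x ∈ Set.Icc L₁ L₂, HasDerivWithinAt f (f' x) (Set.Icc L₁ L₂) x := by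
    intro x _
    exact ((Section8AbelProfiles.hasDerivAt_frakg β1 β2 βμ (x : ℂ)).comp_ofReal).hasDerivWithinAt
  have hbound : ∀ x ∈ Set.Ico L₁ L₂, ‖f' x‖ ≤ 449 * alpha D := by
    intro x hx
    have hxabs : alpha D * |x| ≤ 4 := by
      have : |x| ≤ ell D ^ 9 := abs_le.mpr ⟨by linarith [hx.1], by linarith [hx.2]⟩
      calc alpha D * |x| ≤ alpha D * ell D ^ 9 := by gcongr
        _ = π := hαℓ
        _ ≤ 4 := by linarith [Real.pi_lt_d2]
    have hμb := Section8AbelProfiles.norm_betaMu_bounds hα.le 7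
    exact (Section8AbelProfiles.norm_frakg_le (L := x) hα (Section8AbelProfiles.betaMu_re D 7) hμb.2
      hμb.1 (Section8AbelProfiles.norm_betaJ_le c' hα.le hℓ0.le hc5 (j + 1))
      (Section8AbelProfiles.norm_betaJ_le c' hα.le hℓ0.le hc5 (j + 2)) hxabs).2
  have key := norm_image_sub_le_of_norm_deriv_le_segment' hderiv hbound L₂
    (Set.right_mem_Icc.mpr hle)
  rw [hdiff] at key
  have e1 : frakgW c' D j 7 (Skeleton.P2 D / m) = f L₁ := rfl
  have e2 : frakgW c' D j 7 (bigP D ^ (0.5 : ℝ) / m) = f L₂ := rfl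
  rw [e1, e2, norm_sub_rev]
  linarith

/-- **`G − G_printed`**: for `1 ≤ m ≤ P^{0.5}`,
`‖ι₃(log P₃)⁻¹𝔤_{j6}(P₃/m) + ι₄(log P₂)⁻¹𝔤_{j7}(P₂/m) − (ι₃𝔤_{j6}(P^{0.498}/m)/0.498 + ι₄𝔤_{j7}(P^{0.5}/m)/0.5)/log P‖
≤ 10⁵·𝓛^{1.1}·𝓛⁻¹⁸` (the `ι₃` parts agree since `P₃ = P^{0.498}`; the `ι₄` parts differ by the
Lipschitz step and by `1/log P₂ − 2/log P = 10𝓛^{1.1}/(log P₂·0.5𝓛⁹)`).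
[cite: Zhang2022LandauSiegel, §10 pp. 59–60] -/
theorem norm_G_sub_Gpr_le (hℓ : 3 ≤ ell D) (hc5 : 5 * |c'| * alpha D * ell D ≤ 1) (j : ℕ)
    {m : ℝ} (hm1 : 1 ≤ m) (hmP : m ≤ bigP D ^ (0.5 : ℝ)) :
    ‖(iota3 * (Real.log (Skeleton.P3 D) : ℂ)⁻¹ * frakgW c' D j 6 (Skeleton.P3 D / m) +
        iota4 * (Real.log (Skeleton.P2 D) : ℂ)⁻¹ * frakgW c' D j 7 (Skeleton.P2 D / m)) -
      (iota3 / 0.498 * frakgW c' D j 6 (bigP D ^ (0.498 : ℝ) / m) +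
        iota4 / 0.5 * frakgW c' D j 7 (bigP D ^ (0.5 : ℝ) / m)) / (Real.log (bigP D) : ℂ)‖ ≤
      100000 * ell D ^ (1.1 : ℝ) * (ell D ^ 18)⁻¹ := by
  obtain ⟨hα, hαeq, hαℓ⟩ := alpha_facts hℓ
  have hℓ0 : 0 < ell D := by linarith
  have hℓ1 : 1 ≤ ell D := by linarith
  have hm0 : 0 < m := by linarith
  obtain ⟨hP2lo, hP2hi⟩ := log_P2_bounds (D := D) hℓ
  have hP2 : 0 < Real.log (Skeleton.P2 D) := log_P2_pos hℓ
  have h11pos : 0 ≤ ell D ^ (1.1 : ℝ) := Real.rpow_nonneg hℓ0.le _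
  obtain ⟨-, hi4⟩ := norm_iota3_iota4_le
  set g6 := frakgW c' D j 6 (Skeleton.P3 D / m)
  set g7 := frakgW c' D j 7 (Skeleton.P2 D / m)
  set g7' := frakgW c' D j 7 (bigP D ^ (0.5 : ℝ) / m)
  have hP3def : bigP D ^ (0.498 : ℝ) = Skeleton.P3 D := rfl
  rw [hP3def]
  -- the `ι₃` parts agree
  have hlogP : (Real.log (bigP D) : ℂ) = ((ell D ^ 9 : ℝ) : ℂ) := by rw [log_bigP_eq]
  have hlogP3 : (Real.log (Skeleton.P3 D) : ℂ) = (0.498 : ℂ) * ((ell D ^ 9 : ℝ) : ℂ) := by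
    rw [log_P3_eq]; push_cast; ring
  have hℓ9 : ((ell D ^ 9 : ℝ) : ℂ) ≠ 0 := by exact_mod_cast (by positivity : ell D ^ 9 ≠ 0)
  have hlp2 : (Real.log (Skeleton.P2 D) : ℂ) ≠ 0 := by exact_mod_cast hP2.ne'
  have hhalf9 : (((0.5 * ell D ^ 9 : ℝ)) : ℂ) ≠ 0 := by
    exact_mod_cast (by positivity : 0.5 * ell D ^ 9 ≠ 0)
  have e : (iota3 * (Real.log (Skeleton.P3 D) : ℂ)⁻¹ * g6 +
        iota4 * (Real.log (Skeleton.P2 D) : ℂ)⁻¹ * g7) -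
      (iota3 / 0.498 * g6 + iota4 / 0.5 * g7') / (Real.log (bigP D) : ℂ) =
      iota4 * ((Real.log (Skeleton.P2 D) : ℂ)⁻¹ * (g7 - g7') +
        g7' * ((Real.log (Skeleton.P2 D) : ℂ)⁻¹ - (((0.5 * ell D ^ 9 : ℝ)) : ℂ)⁻¹)) := by
    rw [hlogP, hlogP3]
    push_cast
    field_simp
    ring
  rw [e]
  have hg7' : ‖g7'‖ ≤ 146 := by
    have hhalfP : bigP D ^ (0.5 : ℝ) ≤ bigP D := by
      calc bigP D ^ (0.5 : ℝ) ≤ bigP D ^ (1 : ℝ) := Real.rpow_le_rpow_of_exponent_le (by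
            have := Real.one_le_exp (show (0:ℝ) ≤ ell D ^ 9 by positivity); rwa [bigP]) (by norm_num)
        _ = bigP D := Real.rpow_one _
    have h1half : 1 ≤ bigP D ^ (0.5 : ℝ) := by linarith
    exact norm_frakgW_div_le c' hℓ hc5 j 7 h1half hhalfP hm1 (hmP.trans hhalfP)
  have hlip := norm_frakgW7_P2_sub_le c' hℓ hc5 j hm1 hmP
  have ninv : ‖(Real.log (Skeleton.P2 D) : ℂ)⁻¹‖ = (Real.log (Skeleton.P2 D))⁻¹ := by
    rw [norm_inv, Complex.norm_real, Real.norm_eq_abs, abs_of_pos hP2]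
  have hsub0 : 0 ≤ (Real.log (Skeleton.P2 D))⁻¹ - (0.5 * ell D ^ 9)⁻¹ := by
    rw [sub_nonneg]; exact inv_anti₀ hP2 hP2hi
  have ndiff : ‖(Real.log (Skeleton.P2 D) : ℂ)⁻¹ - (((0.5 * ell D ^ 9 : ℝ)) : ℂ)⁻¹‖ =
      (Real.log (Skeleton.P2 D))⁻¹ - (0.5 * ell D ^ 9)⁻¹ := by
    have : (Real.log (Skeleton.P2 D) : ℂ)⁻¹ - (((0.5 * ell D ^ 9 : ℝ)) : ℂ)⁻¹ =
        (((Real.log (Skeleton.P2 D))⁻¹ - (0.5 * ell D ^ 9)⁻¹ : ℝ) : ℂ) := by push_cast; ring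
    rw [this, Complex.norm_real, Real.norm_eq_abs, abs_of_nonneg hsub0]
  -- size of the inverse difference
  have hinvdiff : (Real.log (Skeleton.P2 D))⁻¹ - (0.5 * ell D ^ 9)⁻¹ ≤
      50 * ell D ^ (1.1 : ℝ) * (ell D ^ 18)⁻¹ := by
    have hprod : 0.2 * ell D ^ 18 ≤ Real.log (Skeleton.P2 D) * (0.5 * ell D ^ 9) := by nlinarith
    have eq1 : (Real.log (Skeleton.P2 D))⁻¹ - (0.5 * ell D ^ 9)⁻¹ =
        (0.5 * ell D ^ 9 - Real.log (Skeleton.P2 D)) / (Real.log (Skeleton.P2 D) * (0.5 * ell D ^ 9)) :=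
      inv_sub_inv hP2.ne' (by positivity)
    rw [eq1, log_P2_eq, show 0.5 * ell D ^ 9 - (0.5 * ell D ^ 9 - 10 * ell D ^ (1.1 : ℝ)) =
      10 * ell D ^ (1.1 : ℝ) by ring, ← log_P2_eq]
    rw [div_le_iff₀ (by positivity)]
    calc 10 * ell D ^ (1.1 : ℝ) = 50 * ell D ^ (1.1 : ℝ) * (ell D ^ 18)⁻¹ * (0.2 * ell D ^ 18) := by
          field_simp; ring
      _ ≤ 50 * ell D ^ (1.1 : ℝ) * (ell D ^ 18)⁻¹ * (Real.log (Skeleton.P2 D) * (0.5 * ell D ^ 9)) := by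
          gcongr
  have hinvle : (Real.log (Skeleton.P2 D))⁻¹ ≤ (0.4 * ell D ^ 9)⁻¹ := inv_anti₀ (by positivity) hP2lo
  calc ‖iota4 * ((Real.log (Skeleton.P2 D) : ℂ)⁻¹ * (g7 - g7') +
          g7' * ((Real.log (Skeleton.P2 D) : ℂ)⁻¹ - (((0.5 * ell D ^ 9 : ℝ)) : ℂ)⁻¹))‖
      = ‖iota4‖ * ‖(Real.log (Skeleton.P2 D) : ℂ)⁻¹ * (g7 - g7') +
          g7' * ((Real.log (Skeleton.P2 D) : ℂ)⁻¹ - (((0.5 * ell D ^ 9 : ℝ)) : ℂ)⁻¹)‖ := norm_mul _ _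
    _ ≤ ‖iota4‖ * (‖(Real.log (Skeleton.P2 D) : ℂ)⁻¹ * (g7 - g7')‖ +
          ‖g7' * ((Real.log (Skeleton.P2 D) : ℂ)⁻¹ - (((0.5 * ell D ^ 9 : ℝ)) : ℂ)⁻¹)‖) := by
        gcongr; exact norm_add_le _ _
    _ = ‖iota4‖ * ((Real.log (Skeleton.P2 D))⁻¹ * ‖g7 - g7'‖ +
          ‖g7'‖ * ((Real.log (Skeleton.P2 D))⁻¹ - (0.5 * ell D ^ 9)⁻¹)) := by
        rw [norm_mul, norm_mul, ninv, ndiff]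
    _ ≤ 2.3 * ((0.4 * ell D ^ 9)⁻¹ * (449 * alpha D * (10 * ell D ^ (1.1 : ℝ))) +
          146 * (50 * ell D ^ (1.1 : ℝ) * (ell D ^ 18)⁻¹)) := by
        gcongr
    _ = ell D ^ (1.1 : ℝ) * (ell D ^ 18)⁻¹ * (2.3 * (11225 * π + 7300)) := by
        rw [hαeq]; field_simp; ring
    _ ≤ ell D ^ (1.1 : ℝ) * (ell D ^ 18)⁻¹ * 100000 := by
        gcongr; linarith [Real.pi_lt_d2]
    _ = 100000 * ell D ^ (1.1 : ℝ) * (ell D ^ 18)⁻¹ := by ring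

end GLayer

/-! ## Part W. The arithmetic weights `a(n) = |χ(n)|λ₀ⱼ(n)/n` and their range / window sums -/

section Weights

variable (c' : ℝ) {D : ℕ} (χ : DirichletCharacter ℂ D)

/-- `‖a(n)‖(n/φ(n))³ ≤ (n/φ(n))⁷/n` (`|λ₀ⱼ(n)| ≤ (n/φ(n))⁴`, `|χ(n)| ≤ 1`).
[cite: Zhang2022LandauSiegel, §10 pp. 59–60] -/
theorem norm_weight_mul_cube_le (j : ℕ) {n : ℕ} (hn : n ≠ 0) :
    ‖(‖χ (n : ZMod D)‖ : ℂ) * lamZero c' D j n / (n : ℂ)‖ * ((n : ℝ) / Nat.totient n) ^ 3 ≤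
      ((n : ℝ) / Nat.totient n) ^ 7 / n := by
  have hn0 : (0 : ℝ) < n := by exact_mod_cast Nat.pos_of_ne_zero hn
  have hr0 : 0 ≤ (n : ℝ) / Nat.totient n := by positivity
  have hχ : ‖χ (n : ZMod D)‖ ≤ 1 := DirichletCharacter.norm_le_one χ _
  have hlam := norm_lamZero_le c' D j hn
  rw [norm_div, norm_mul, Complex.norm_real, Real.norm_eq_abs, abs_of_nonneg (norm_nonneg _),
    Complex.norm_natCast]
  calc ‖χ (n : ZMod D)‖ * ‖lamZero c' D j n‖ / n * ((n : ℝ) / Nat.totient n) ^ 3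
      ≤ 1 * ((n : ℝ) / Nat.totient n) ^ 4 / n * ((n : ℝ) / Nat.totient n) ^ 3 := by gcongr
    _ = ((n : ℝ) / Nat.totient n) ^ 7 / n := by ring

omit χ in
/-- The weighted harmonic window between real endpoints: for `2 ≤ u ≤ v`,
`Σ_{⌈u⌉−1 < n ≤ ⌈v⌉} (n/φ(n))⁷/n ≤ e^{256}(3 + log v − log u)`.
[cite: Zhang2022LandauSiegel, §10 pp. 59–60] -/
theorem sum_ratio7_window_le {u v : ℝ} (hu : 2 ≤ u) (huv : u ≤ v) :
    ∑ n ∈ Finset.Ioc (⌈u⌉₊ - 1) ⌈v⌉₊, ((n : ℝ) / Nat.totient n) ^ 7 / n ≤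
      Real.exp 256 * (3 + Real.log v - Real.log u) := by
  have hu0 : 0 < u := by linarith
  have hv1 : 1 ≤ v := by linarith
  have hcu : 2 ≤ ⌈u⌉₊ := by
    have : (2 : ℝ) ≤ ⌈u⌉₊ := hu.trans (Nat.le_ceil u)
    exact_mod_cast this
  have hY : 0 < ⌈u⌉₊ - 1 := by omega
  have hYX : ⌈u⌉₊ - 1 ≤ ⌈v⌉₊ := le_trans (Nat.sub_le _ _) (Nat.ceil_mono huv)
  have h := sum_ratio_pow_div_le 7 hY hYX
  have e256 : Real.exp (2 ^ (7 + 1)) = Real.exp 256 := by norm_num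
  rw [e256] at h
  refine h.trans ?_
  have hcast : (((⌈u⌉₊ - 1 : ℕ)) : ℝ) = (⌈u⌉₊ : ℝ) - 1 := by
    rw [Nat.cast_sub (by omega)]; simp
  -- `log ⌈v⌉ ≤ log 2 + log v`, `log(⌈u⌉ − 1) ≥ log u − log 2`
  have hlog2 : Real.log 2 < 1 := by
    have := Real.log_two_lt_d9; linarith
  have hv' : Real.log (⌈v⌉₊ : ℝ) ≤ Real.log 2 + Real.log v := by
    rw [← Real.log_mul (by norm_num) (by linarith)]
    refine Real.log_le_log (by exact_mod_cast Nat.ceil_pos.mpr (by linarith)) ?_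
    have := Nat.ceil_lt_add_one (by linarith : (0 : ℝ) ≤ v)
    linarith
  have hu' : Real.log u - Real.log 2 ≤ Real.log (((⌈u⌉₊ - 1 : ℕ)) : ℝ) := by
    rw [hcast, ← Real.log_div hu0.ne' (by norm_num)]
    refine Real.log_le_log (by positivity) ?_
    have := Nat.le_ceil u
    rw [div_le_iff₀ (by norm_num : (0:ℝ) < 2)]
    linarith
  have hpos : 0 < Real.exp 256 := Real.exp_pos _
  nlinarith

/-- **Range / window weight sums**: if every `n ∈ S′` satisfies `u ≤ n ≤ v` (`2 ≤ u ≤ v`), then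
`Σ_{n∈S′} ‖a(n)‖(n/φ(n))³ ≤ e^{256}(3 + log v − log u)`.
[cite: Zhang2022LandauSiegel, §10 pp. 59–60] -/
theorem sum_weights_le (j : ℕ) {S' : Finset ℕ} {u v : ℝ} (hu : 2 ≤ u) (huv : u ≤ v)
    (hS' : ∀ n ∈ S', u ≤ (n : ℝ) ∧ (n : ℝ) ≤ v) :
    ∑ n ∈ S', ‖(‖χ (n : ZMod D)‖ : ℂ) * lamZero c' D j n / (n : ℂ)‖ * ((n : ℝ) / Nat.totient n) ^ 3 ≤
      Real.exp 256 * (3 + Real.log v - Real.log u) := by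
  have hsub : S' ⊆ Finset.Ioc (⌈u⌉₊ - 1) ⌈v⌉₊ := by
    intro n hn
    obtain ⟨h1, h2⟩ := hS' n hn
    rw [Finset.mem_Ioc]
    constructor
    · have : ⌈u⌉₊ ≤ n := Nat.ceil_le.mpr h1
      have : 1 ≤ ⌈u⌉₊ := Nat.one_le_iff_ne_zero.mpr (by
        intro h0; rw [Nat.ceil_eq_zero] at h0; linarith)
      omega
    · have : (n : ℝ) ≤ ⌈v⌉₊ := h2.trans (Nat.le_ceil v)
      exact_mod_cast this
  have hn0 : ∀ n ∈ S', n ≠ 0 := by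
    intro n hn h0
    have := (hS' n hn).1
    rw [h0] at this; simp at this; linarith
  calc ∑ n ∈ S', ‖(‖χ (n : ZMod D)‖ : ℂ) * lamZero c' D j n / (n : ℂ)‖ * ((n : ℝ) / Nat.totient n) ^ 3
      ≤ ∑ n ∈ S', ((n : ℝ) / Nat.totient n) ^ 7 / n :=
        Finset.sum_le_sum fun n hn => norm_weight_mul_cube_le c' χ j (hn0 n hn)
    _ ≤ ∑ n ∈ Finset.Ioc (⌈u⌉₊ - 1) ⌈v⌉₊, ((n : ℝ) / Nat.totient n) ^ 7 / n :=
        Finset.sum_le_sum_of_subset_of_nonneg hsub fun n _ _ => by positivity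
    _ ≤ Real.exp 256 * (3 + Real.log v - Real.log u) := sum_ratio7_window_le hu huv

end Weights

/-! ## Part T. The top range: the `ϰ₃` part of the `n`-sum vanishes for `dr ≥ P₃` -/

section TopN

variable (c' : ℝ) {D : ℕ} (χ : DirichletCharacter ℂ D)

/-- A Lemma 8.4 sum with `y ≤ 1` is empty. [cite: Zhang2022LandauSiegel, §10 pp. 59–60] -/
theorem S84_eq_zero_of_le_one (j μ d r : ℕ) {y : ℝ} (hy : y ≤ 1) :
    ∑ n ∈ Finset.Ico 1 ⌈y⌉₊, χ (n : ZMod D) * xiZero c' D j n d r / (n : ℂ) *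
        ((y / n : ℝ) : ℂ) ^ (-betaMu D μ) * (Real.log (y / n) : ℂ) = 0 := by
  have : ⌈y⌉₊ ≤ 1 := Nat.ceil_le.mpr (by push_cast; exact hy)
  rw [Finset.Ico_eq_empty_of_le this, Finset.sum_empty]

/-- **`nSum22` in the top range** (`dr ≥ P₃`, so `ϰ₃(drn) = 0` for all `n ≥ 1`):
`nSum22 = ι₄(log P₂)⁻¹·S84(7, P₂/(dr))`. [cite: Zhang2022LandauSiegel, §10 pp. 59–60] -/
theorem nSum22_eq_S84_top (hℓ : 3 ≤ ell D) (j : ℕ) {d r : ℕ} (hd : 1 ≤ d) (hr : 1 ≤ r)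
    (htop : Skeleton.P3 D ≤ ((d * r : ℕ) : ℝ)) :
    nSum22 c' χ j d r =
      iota4 * (Real.log (Skeleton.P2 D) : ℂ)⁻¹ *
        (∑ n ∈ Finset.Ico 1 ⌈Skeleton.P2 D / ((d * r : ℕ) : ℝ)⌉₊,
          χ (n : ZMod D) * xiZero c' D j n d r / (n : ℂ) *
            ((Skeleton.P2 D / ((d * r : ℕ) : ℝ) / n : ℝ) : ℂ) ^ (-betaMu D 7) *
              (Real.log (Skeleton.P2 D / ((d * r : ℕ) : ℝ) / n) : ℂ)) := by
  have hdr : (0 : ℝ) < ((d * r : ℕ) : ℝ) := by exact_mod_cast Nat.mul_pos hd hr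
  have hy : Skeleton.P3 D / ((d * r : ℕ) : ℝ) ≤ 1 := by rw [div_le_one hdr]; exact htop
  rw [nSum22_eq_S84 c' χ j hd hr (one_lt_P3 hℓ) (one_lt_P2 hℓ)
    (ceil_div_le_Nsupp hℓ (P3_le_rpow504 D) (Nat.mul_pos hd hr))
    (ceil_div_le_Nsupp hℓ (P2_le_rpow504 D) (Nat.mul_pos hd hr)),
    S84_eq_zero_of_le_one c' χ j 6 d r hy, mul_zero, zero_add]

variable [NeZero D]

/-- **Main approximation of the `n`-sum, top range**: for `dr ≥ P₃` and `T < P₂/(dr)`,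
`‖nSum22 − L′(1,χ)Π(d,r)·ι₄(log P₂)⁻¹𝔤_{j7}(P₂/(dr))‖ ≤ (‖ι₃‖/log P₃ + ‖ι₄‖/log P₂)·C₂𝓛⁻⁶(dr/φ(dr))²`.
[cite: Zhang2022LandauSiegel, §10 pp. 59–60] -/
theorem norm_nSum22_sub_main_top_le (hℓ : 3 ≤ ell D) (j : ℕ) {d r : ℕ} (hd : 1 ≤ d) (hr : 1 ≤ r)
    (htop : Skeleton.P3 D ≤ ((d * r : ℕ) : ℝ)) {C₂ : ℝ} (hC₂ : 0 ≤ C₂)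
    (h7 : ‖(∑ n ∈ Finset.Ico 1 ⌈Skeleton.P2 D / ((d * r : ℕ) : ℝ)⌉₊,
            χ (n : ZMod D) * xiZero c' D j n d r / (n : ℂ) *
              ((Skeleton.P2 D / ((d * r : ℕ) : ℝ) / n : ℝ) : ℂ) ^ (-betaMu D 7) *
                (Real.log (Skeleton.P2 D / ((d * r : ℕ) : ℝ) / n) : ℂ)) -
          deriv χ.LFunction 1 * PiW χ d r * frakgW c' D j 7 (Skeleton.P2 D / ((d * r : ℕ) : ℝ))‖ ≤
        C₂ * (ell D ^ 6)⁻¹ * (∏ q ∈ (d * r).primeFactors, (1 - (q : ℝ)⁻¹)⁻¹) ^ 2) :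
    ‖nSum22 c' χ j d r - deriv χ.LFunction 1 * PiW χ d r *
        (iota4 * (Real.log (Skeleton.P2 D) : ℂ)⁻¹ * frakgW c' D j 7 (Skeleton.P2 D / ((d * r : ℕ) : ℝ)))‖ ≤
      (‖iota3‖ / Real.log (Skeleton.P3 D) + ‖iota4‖ / Real.log (Skeleton.P2 D)) *
        (C₂ * (ell D ^ 6)⁻¹ * ((((d * r : ℕ) : ℝ)) / Nat.totient (d * r)) ^ 2) := by
  have hℓ0 : 0 < ell D := by linarith
  have hdr0 : d * r ≠ 0 := (Nat.mul_pos hd hr).ne'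
  have hP3 : 0 < Real.log (Skeleton.P3 D) := by rw [log_P3_eq]; positivity
  have hP2 : 0 < Real.log (Skeleton.P2 D) := log_P2_pos hℓ
  rw [prod_one_sub_inv_inv_eq hdr0] at h7
  rw [nSum22_eq_S84_top c' χ hℓ j hd hr htop]
  set S7 := ∑ n ∈ Finset.Ico 1 ⌈Skeleton.P2 D / ((d * r : ℕ) : ℝ)⌉₊,
            χ (n : ZMod D) * xiZero c' D j n d r / (n : ℂ) *
              ((Skeleton.P2 D / ((d * r : ℕ) : ℝ) / n : ℝ) : ℂ) ^ (-betaMu D 7) *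
                (Real.log (Skeleton.P2 D / ((d * r : ℕ) : ℝ) / n) : ℂ)
  set L1 := deriv χ.LFunction 1
  set g7 := frakgW c' D j 7 (Skeleton.P2 D / ((d * r : ℕ) : ℝ))
  have e : iota4 * (Real.log (Skeleton.P2 D) : ℂ)⁻¹ * S7 -
      L1 * PiW χ d r * (iota4 * (Real.log (Skeleton.P2 D) : ℂ)⁻¹ * g7) =
      iota4 * (Real.log (Skeleton.P2 D) : ℂ)⁻¹ * (S7 - L1 * PiW χ d r * g7) := by ring
  rw [e, norm_mul, norm_mul, norm_inv, Complex.norm_real, Real.norm_eq_abs, abs_of_pos hP2]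
  have hR3 : 0 ≤ ‖iota3‖ / Real.log (Skeleton.P3 D) := by positivity
  have hK : 0 ≤ C₂ * (ell D ^ 6)⁻¹ * ((((d * r : ℕ) : ℝ)) / Nat.totient (d * r)) ^ 2 := by positivity
  calc ‖iota4‖ * (Real.log (Skeleton.P2 D))⁻¹ * ‖S7 - L1 * PiW χ d r * g7‖
      ≤ ‖iota4‖ * (Real.log (Skeleton.P2 D))⁻¹ *
          (C₂ * (ell D ^ 6)⁻¹ * ((((d * r : ℕ) : ℝ)) / Nat.totient (d * r)) ^ 2) := by gcongr
    _ = (‖iota4‖ / Real.log (Skeleton.P2 D)) *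
          (C₂ * (ell D ^ 6)⁻¹ * ((((d * r : ℕ) : ℝ)) / Nat.totient (d * r)) ^ 2) := by ring
    _ ≤ _ := by gcongr; linarith

omit [NeZero D] in
/-- **`G − G_printed`, top range** (the `ι₄` part alone):
`‖ι₄(log P₂)⁻¹𝔤_{j7}(P₂/m) − (ι₄/0.5)𝔤_{j7}(P^{0.5}/m)/log P‖ ≤ 10⁵𝓛^{1.1}𝓛⁻¹⁸` for `1 ≤ m ≤ P^{0.5}`.
[cite: Zhang2022LandauSiegel, §10 pp. 59–60] -/
theorem norm_G7_sub_le (hℓ : 3 ≤ ell D) (hc5 : 5 * |c'| * alpha D * ell D ≤ 1) (j : ℕ)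
    {m : ℝ} (hm1 : 1 ≤ m) (hmP : m ≤ bigP D ^ (0.5 : ℝ)) :
    ‖iota4 * (Real.log (Skeleton.P2 D) : ℂ)⁻¹ * frakgW c' D j 7 (Skeleton.P2 D / m) -
        iota4 / 0.5 * frakgW c' D j 7 (bigP D ^ (0.5 : ℝ) / m) / (Real.log (bigP D) : ℂ)‖ ≤
      100000 * ell D ^ (1.1 : ℝ) * (ell D ^ 18)⁻¹ := by
  have hℓ0 : 0 < ell D := by linarith
  have key := norm_G_sub_Gpr_le c' hℓ hc5 j hm1 hmP
  have hlogP : (Real.log (bigP D) : ℂ) = ((ell D ^ 9 : ℝ) : ℂ) := by rw [log_bigP_eq]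
  have hlogP3 : (Real.log (Skeleton.P3 D) : ℂ) = (0.498 : ℂ) * ((ell D ^ 9 : ℝ) : ℂ) := by
    rw [log_P3_eq]; push_cast; ring
  have hℓ9 : ((ell D ^ 9 : ℝ) : ℂ) ≠ 0 := by exact_mod_cast (by positivity : ell D ^ 9 ≠ 0)
  have hP3def : bigP D ^ (0.498 : ℝ) = Skeleton.P3 D := rfl
  rw [hP3def] at key
  have e : (iota3 * (Real.log (Skeleton.P3 D) : ℂ)⁻¹ * frakgW c' D j 6 (Skeleton.P3 D / m) +
        iota4 * (Real.log (Skeleton.P2 D) : ℂ)⁻¹ * frakgW c' D j 7 (Skeleton.P2 D / m)) -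
      (iota3 / 0.498 * frakgW c' D j 6 (Skeleton.P3 D / m) +
        iota4 / 0.5 * frakgW c' D j 7 (bigP D ^ (0.5 : ℝ) / m)) / (Real.log (bigP D) : ℂ) =
      iota4 * (Real.log (Skeleton.P2 D) : ℂ)⁻¹ * frakgW c' D j 7 (Skeleton.P2 D / m) -
        iota4 / 0.5 * frakgW c' D j 7 (bigP D ^ (0.5 : ℝ) / m) / (Real.log (bigP D) : ℂ) := by
    rw [hlogP, hlogP3]
    field_simp
    ring
  rw [e] at key
  exact key

end TopN

/-! ## Part F. Assembly for the middle range `P^{0.496} ≤ dr < P^{0.498}` -/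

section MidRange

variable (c' : ℝ) {D : ℕ} (χ : DirichletCharacter ℂ D)

omit χ in
/-- Range facts for `𝓛 ≥ 3`: `2 ≤ P^{0.496} ≤ P^{0.498} ≤ P^{0.5} ≤ P^{0.504} ≤ P/T² ≤ ⌈P/T²⌉`, `P^{0.5} ≤ P`.
[cite: Zhang2022LandauSiegel, §10 pp. 59–60] -/
theorem range_facts (hℓ : 3 ≤ ell D) :
    2 ≤ bigP D ^ (0.496 : ℝ) ∧ bigP D ^ (0.496 : ℝ) ≤ bigP D ^ (0.498 : ℝ) ∧
      bigP D ^ (0.498 : ℝ) ≤ bigP D ^ (0.5 : ℝ) ∧ bigP D ^ (0.5 : ℝ) ≤ bigP D ^ (0.504 : ℝ) ∧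
      bigP D ^ (0.504 : ℝ) ≤ bigP D / bigT D ^ 2 ∧ bigP D ^ (0.5 : ℝ) ≤ bigP D ∧
      (∀ n : ℕ, (n : ℝ) < bigP D ^ (0.504 : ℝ) → n < Nsupp D) := by
  have hℓ0 : 0 < ell D := by linarith
  have hP1 : 1 ≤ bigP D := by
    have := Real.one_le_exp (show (0:ℝ) ≤ ell D ^ 9 by positivity); rwa [bigP]
  have mono : ∀ a b : ℝ, a ≤ b → bigP D ^ a ≤ bigP D ^ b := fun a b hab =>
    Real.rpow_le_rpow_of_exponent_le hP1 hab
  refine ⟨?_, mono _ _ (by norm_num), mono _ _ (by norm_num), mono _ _ (by norm_num),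
    Sec10B.rpow504_le_nsuppBound hℓ, ?_, ?_⟩
  · -- `P^{0.496} = exp(0.496𝓛⁹) ≥ exp 1 ≥ 2`
    rw [bigP, ← Real.exp_mul]
    have h9 : (3 : ℝ) ^ 9 ≤ ell D ^ 9 := pow_le_pow_left₀ (by norm_num) hℓ 9
    have h1 : (1 : ℝ) ≤ ell D ^ 9 * 0.496 := by nlinarith
    calc (2 : ℝ) ≤ Real.exp 1 := by have := Real.add_one_le_exp (1 : ℝ); linarith
      _ ≤ Real.exp (ell D ^ 9 * 0.496) := Real.exp_le_exp.mpr h1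
  · calc bigP D ^ (0.5 : ℝ) ≤ bigP D ^ (1 : ℝ) := mono _ _ (by norm_num)
      _ = bigP D := Real.rpow_one _
  · intro n hn
    have h := Sec10B.rpow504_le_nsuppBound hℓ
    have : (n : ℝ) < Nsupp D := by
      rw [Nsupp]
      exact lt_of_lt_of_le (hn.trans_le h) (Nat.le_ceil _)
    exact_mod_cast this

omit χ in
/-- The filtered index set of the middle range is `[⌈P^{0.496}⌉, ⌈P^{0.498}⌉)`.
[cite: Zhang2022LandauSiegel, §10 pp. 59–60] -/
theorem midSet_eq (hℓ : 3 ≤ ell D) :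
    (Finset.Ico 1 (Nsupp D)).filter
        (fun n : ℕ => bigP D ^ (0.496 : ℝ) ≤ (n : ℝ) ∧ (n : ℝ) < bigP D ^ (0.498 : ℝ)) =
      Finset.Ico ⌈bigP D ^ (0.496 : ℝ)⌉₊ ⌈bigP D ^ (0.498 : ℝ)⌉₊ := by
  obtain ⟨h2, -, hb5, h35, h4, -, hN⟩ := range_facts hℓ
  ext n
  simp only [Finset.mem_filter, Finset.mem_Ico]
  constructor
  · rintro ⟨⟨-, -⟩, ha, hb⟩
    exact ⟨Nat.ceil_le.mpr ha, Nat.lt_ceil.mpr hb⟩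
  · rintro ⟨ha, hb⟩
    have ha' : bigP D ^ (0.496 : ℝ) ≤ n := Nat.ceil_le.mp ha
    have hb' : (n : ℝ) < bigP D ^ (0.498 : ℝ) := Nat.lt_ceil.mp hb
    refine ⟨⟨?_, hN n (hb'.trans_le (by linarith))⟩, ha', hb'⟩
    have : (1 : ℝ) ≤ n := by linarith
    exact_mod_cast this

variable [NeZero D]

/-- **Step D (exact): the collapsed main term IS the printed `n`-sum `midSum1422`.**
[cite: Zhang2022LandauSiegel, §10 pp. 59–60] -/
theorem mid_mainterm_eq (hℓ : 3 ≤ ell D) (j : ℕ) :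
    ∑ n ∈ (Finset.Ico 1 (Nsupp D)).filter
        (fun n : ℕ => bigP D ^ (0.496 : ℝ) ≤ (n : ℝ) ∧ (n : ℝ) < bigP D ^ (0.498 : ℝ)),
      (‖χ (n : ZMod D)‖ : ℂ) * lamZero c' D j n / (n : ℂ) * ((n : ℂ) / (Nat.totient n : ℂ)) *
        (500 * deriv χ.LFunction 1 / (Real.log (bigP D) : ℂ) *
            (-1 - betaJ c' D j * (Real.log (bigP D ^ (-0.496 : ℝ) * n) : ℂ)) *
          deriv χ.LFunction 1 *
          ((iota3 / 0.498 * frakgW c' D j 6 (bigP D ^ (0.498 : ℝ) / n) +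
              iota4 / 0.5 * frakgW c' D j 7 (bigP D ^ (0.5 : ℝ) / n)) / (Real.log (bigP D) : ℂ))) =
      midSum1422 c' χ j := by
  rw [midSet_eq hℓ]
  unfold midSum1422 lamAvg
  rw [Finset.mul_sum]
  refine Finset.sum_congr rfl fun n hn => ?_
  have h2 := (range_facts (D := D) hℓ).1
  have hn1 : 1 ≤ n := by
    have := (Finset.mem_Ico.mp hn).1
    have : (2 : ℝ) ≤ ⌈bigP D ^ (0.496 : ℝ)⌉₊ := h2.trans (Nat.le_ceil _)
    have : 2 ≤ ⌈bigP D ^ (0.496 : ℝ)⌉₊ := by exact_mod_cast this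
    omega
  have hn0 : (n : ℂ) ≠ 0 := by exact_mod_cast (by omega : n ≠ 0)
  field_simp

/-- `‖M₀(n)‖ ≤ 28000e^{9/2}𝓛⁻⁷` on the middle range (`log(P^{−0.496}n) ∈ [0, 𝓛⁹]`).
[cite: Zhang2022LandauSiegel, §10 pp. 59–60] -/
theorem norm_M0mid_le (hℓ : 3 ≤ ell D) (hp : χ.IsPrimitive) (hc5 : 5 * |c'| * alpha D * ell D ≤ 1)
    (j : ℕ) {n : ℕ} (hlo : bigP D ^ (0.496 : ℝ) ≤ n) (hhi : (n : ℝ) < bigP D ^ (0.498 : ℝ)) :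
    ‖500 * deriv χ.LFunction 1 / (Real.log (bigP D) : ℂ) *
        (-1 - betaJ c' D j * (Real.log (bigP D ^ (-0.496 : ℝ) * n) : ℂ))‖ ≤
      28000 * Real.exp (9 / 2) * (ell D ^ 7)⁻¹ := by
  have hℓ0 : 0 < ell D := by linarith
  have hP := bigP_pos D
  have hx : bigP D ^ (-0.496 : ℝ) * n = n / bigP D ^ (0.496 : ℝ) := by
    rw [Real.rpow_neg hP.le, inv_mul_eq_div]
  have ha := bigP_rpow_pos D 0.496
  have hx1 : 1 ≤ bigP D ^ (-0.496 : ℝ) * n := by rw [hx, le_div_iff₀ ha]; linarith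
  have hxP : bigP D ^ (-0.496 : ℝ) * n ≤ bigP D := by
    rw [hx, div_le_iff₀ ha]
    obtain ⟨-, -, h35, -, -, h5P, -⟩ := range_facts hℓ
    have : (1 : ℝ) ≤ bigP D ^ (0.496 : ℝ) := by linarith [(range_facts (D := D) hℓ).1]
    nlinarith
  obtain ⟨hl0, hl⟩ := log_le_of_le_bigP hx1 hxP
  have hw := norm_one_sub_betaJ_mul_le c' hℓ hc5 j (-1) (by simp) (abs_le.mpr ⟨by linarith, hl⟩)
  calc _ ≤ 2000 * Real.exp (9 / 2) * (ell D ^ 7)⁻¹ * ‖(-1 : ℂ) - betaJ c' D j *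
        (Real.log (bigP D ^ (-0.496 : ℝ) * n) : ℂ)‖ := norm_main101_le χ hℓ hp _
    _ ≤ 2000 * Real.exp (9 / 2) * (ell D ^ 7)⁻¹ * 14 := by gcongr
    _ = 28000 * Real.exp (9 / 2) * (ell D ^ 7)⁻¹ := by ring

/-- **Step C: replacing `G` by the printed profile costs `≤ W·28000e^{9/2}𝓛⁻⁷·|L′(1,χ)|·10⁵𝓛^{1.1}𝓛⁻¹⁸`.**
[cite: Zhang2022LandauSiegel, §10 pp. 59–60] -/
theorem mid_Gswap_le (hℓ : 3 ≤ ell D) (hp : χ.IsPrimitive) (hc5 : 5 * |c'| * alpha D * ell D ≤ 1)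
    (j : ℕ) :
    ‖(∑ n ∈ (Finset.Ico 1 (Nsupp D)).filter
        (fun n : ℕ => bigP D ^ (0.496 : ℝ) ≤ (n : ℝ) ∧ (n : ℝ) < bigP D ^ (0.498 : ℝ)),
      (‖χ (n : ZMod D)‖ : ℂ) * lamZero c' D j n / (n : ℂ) * ((n : ℂ) / (Nat.totient n : ℂ)) *
        (500 * deriv χ.LFunction 1 / (Real.log (bigP D) : ℂ) *
            (-1 - betaJ c' D j * (Real.log (bigP D ^ (-0.496 : ℝ) * n) : ℂ)) *
          deriv χ.LFunction 1 *
          (iota3 * (Real.log (Skeleton.P3 D) : ℂ)⁻¹ * frakgW c' D j 6 (Skeleton.P3 D / n) +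
            iota4 * (Real.log (Skeleton.P2 D) : ℂ)⁻¹ * frakgW c' D j 7 (Skeleton.P2 D / n)))) -
      ∑ n ∈ (Finset.Ico 1 (Nsupp D)).filter
        (fun n : ℕ => bigP D ^ (0.496 : ℝ) ≤ (n : ℝ) ∧ (n : ℝ) < bigP D ^ (0.498 : ℝ)),
      (‖χ (n : ZMod D)‖ : ℂ) * lamZero c' D j n / (n : ℂ) * ((n : ℂ) / (Nat.totient n : ℂ)) *
        (500 * deriv χ.LFunction 1 / (Real.log (bigP D) : ℂ) *
            (-1 - betaJ c' D j * (Real.log (bigP D ^ (-0.496 : ℝ) * n) : ℂ)) *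
          deriv χ.LFunction 1 *
          ((iota3 / 0.498 * frakgW c' D j 6 (bigP D ^ (0.498 : ℝ) / n) +
              iota4 / 0.5 * frakgW c' D j 7 (bigP D ^ (0.5 : ℝ) / n)) / (Real.log (bigP D) : ℂ)))‖ ≤
      (∑ n ∈ (Finset.Ico 1 (Nsupp D)).filter
        (fun n : ℕ => bigP D ^ (0.496 : ℝ) ≤ (n : ℝ) ∧ (n : ℝ) < bigP D ^ (0.498 : ℝ)),
          ‖(‖χ (n : ZMod D)‖ : ℂ) * lamZero c' D j n / (n : ℂ)‖ * ((n : ℝ) / Nat.totient n) ^ 3) *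
        (28000 * Real.exp (9 / 2) * (ell D ^ 7)⁻¹ * ‖deriv χ.LFunction 1‖ *
          (100000 * ell D ^ (1.1 : ℝ) * (ell D ^ 18)⁻¹)) := by
  have hℓ0 : 0 < ell D := by linarith
  obtain ⟨h2, hab, hb5, -, -, h5P, -⟩ := range_facts hℓ
  rw [← Finset.sum_sub_distrib, Finset.sum_mul]
  refine (norm_sum_le _ _).trans (Finset.sum_le_sum fun n hn => ?_)
  obtain ⟨hn', hlo, hhi⟩ := Finset.mem_filter.mp hn
  have hn1 : 1 ≤ n := (Finset.mem_Ico.mp hn').1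
  have hn0 : n ≠ 0 := by omega
  have hn1r : (1 : ℝ) ≤ n := by exact_mod_cast hn1
  have hnhalf : (n : ℝ) ≤ bigP D ^ (0.5 : ℝ) := by linarith
  set A := (‖χ (n : ZMod D)‖ : ℂ) * lamZero c' D j n / (n : ℂ)
  set M0 := 500 * deriv χ.LFunction 1 / (Real.log (bigP D) : ℂ) *
            (-1 - betaJ c' D j * (Real.log (bigP D ^ (-0.496 : ℝ) * n) : ℂ))
  set L1 := deriv χ.LFunction 1
  set G := iota3 * (Real.log (Skeleton.P3 D) : ℂ)⁻¹ * frakgW c' D j 6 (Skeleton.P3 D / n) +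
            iota4 * (Real.log (Skeleton.P2 D) : ℂ)⁻¹ * frakgW c' D j 7 (Skeleton.P2 D / n)
  set Gp := (iota3 / 0.498 * frakgW c' D j 6 (bigP D ^ (0.498 : ℝ) / n) +
              iota4 / 0.5 * frakgW c' D j 7 (bigP D ^ (0.5 : ℝ) / n)) / (Real.log (bigP D) : ℂ)
  have e : A * ((n : ℂ) / (Nat.totient n : ℂ)) * (M0 * L1 * G) -
      A * ((n : ℂ) / (Nat.totient n : ℂ)) * (M0 * L1 * Gp) =
      A * ((n : ℂ) / (Nat.totient n : ℂ)) * (M0 * L1 * (G - Gp)) := by ring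
  rw [e]
  have hnφ : ‖((n : ℂ) / (Nat.totient n : ℂ))‖ = (n : ℝ) / Nat.totient n := by
    rw [norm_div, Complex.norm_natCast, Complex.norm_natCast]
  have hM0 := norm_M0mid_le c' χ hℓ hp hc5 j hlo hhi
  have hG := norm_G_sub_Gpr_le c' hℓ hc5 j hn1r hnhalf
  have hr1 := one_le_self_div_totient hn0
  have hr3 : (n : ℝ) / Nat.totient n ≤ ((n : ℝ) / Nat.totient n) ^ 3 := by
    calc (n : ℝ) / Nat.totient n = ((n : ℝ) / Nat.totient n) ^ 1 := (pow_one _).symm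
      _ ≤ ((n : ℝ) / Nat.totient n) ^ 3 := pow_le_pow_right₀ hr1 (by norm_num)
  rw [norm_mul, norm_mul, norm_mul, norm_mul, hnφ]
  have h0 : 0 ≤ 28000 * Real.exp (9 / 2) * (ell D ^ 7)⁻¹ := by positivity
  calc ‖A‖ * ((n : ℝ) / Nat.totient n) * (‖M0‖ * ‖L1‖ * ‖G - Gp‖)
      ≤ ‖A‖ * ((n : ℝ) / Nat.totient n) ^ 3 * (28000 * Real.exp (9 / 2) * (ell D ^ 7)⁻¹ * ‖L1‖ *
          (100000 * ell D ^ (1.1 : ℝ) * (ell D ^ 18)⁻¹)) := by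
        gcongr

end MidRange

section MidAssembly

variable (c' : ℝ) {D : ℕ} [NeZero D] (χ : DirichletCharacter ℂ D)

omit [NeZero D] χ in
/-- `P^{0.498}/T ≤ P^{0.5}/T^{11}` for `𝓛 ≥ 4` (`T^{10} ≤ P^{0.002}`).
[cite: Zhang2022LandauSiegel, §10 pp. 59–60] -/
theorem rpow498_div_T_le (hℓ4 : 4 ≤ ell D) :
    bigP D ^ (0.498 : ℝ) / bigT D ≤ bigP D ^ (0.5 : ℝ) / bigT D ^ 11 := by
  have hℓ0 : 0 < ell D := by linarith
  have hℓ1 : 1 ≤ ell D := by linarith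
  have hT := bigT_pos D
  have hP := bigP_pos D
  rw [div_le_div_iff₀ hT (pow_pos hT 11)]
  have hT10 : bigT D ^ 10 ≤ bigP D ^ (0.002 : ℝ) := by
    -- `T^{10} = exp(10𝓛^{1.1}) ≤ exp(0.002𝓛⁹) = P^{0.002}`
    rw [bigT, ← Real.exp_nat_mul, bigP, ← Real.exp_mul, Real.exp_le_exp]
    have h11 := ell_rpow_le_sq (D := D) hℓ1
    have h7 : (4 : ℝ) ^ 7 ≤ ell D ^ 7 := pow_le_pow_left₀ (by norm_num) hℓ4 7
    push_cast
    nlinarith [pow_nonneg hℓ0.le 2]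
  calc bigP D ^ (0.498 : ℝ) * bigT D ^ 11 = bigP D ^ (0.498 : ℝ) * (bigT D ^ 10 * bigT D) := by ring
    _ ≤ bigP D ^ (0.498 : ℝ) * (bigP D ^ (0.002 : ℝ) * bigT D) := by
        have := (bigP_rpow_pos D 0.498).le
        gcongr
    _ = bigP D ^ (0.5 : ℝ) * bigT D := by
        rw [← mul_assoc, ← Real.rpow_add hP]; norm_num

/-- **Step B (the range assembly for the middle range).** With Lemma 10.1 (body `h101`), the
relative Lemma 8.4 (body `h84`) and the absolute logarithmic mean of `ξ₀ⱼ` (body `h3`) at this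
modulus: the re-indexed range sum minus the collapsed main term is bounded by the weighted
main-range and window contributions of `range_assembly_bound₃`.
[cite: Zhang2022LandauSiegel, §10 pp. 59–60] -/
theorem mid_assembly_le (hℓ4 : 4 ≤ ell D) (hq : χ.IsQuadratic) (hp : χ.IsPrimitive)
    (hc5 : 5 * |c'| * alpha D * ell D ≤ 1) {c C₁ C₂ C₃ : ℝ} (hC₁ : 0 ≤ C₁) (hC₂ : 0 ≤ C₂)
    (hC₃ : 0 ≤ C₃) (hTc : bigT D ^ (-c) ≤ (ell D ^ 7)⁻¹)
    (h101 : ∀ j ∈ ({1, 2, 3} : Finset ℕ), ∀ y : ℝ,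
      (1 ≤ y → y ≤ bigP D ^ (0.5 : ℝ) / bigT D → ‖frakv1 c' χ j y‖ ≤ C₁ * bigT D ^ (-c)) ∧
      (bigP D ^ (0.5 : ℝ) < y → y ≤ bigP D ^ (0.502 : ℝ) / bigT D →
        ‖frakv1 c' χ j y - 500 * deriv χ.LFunction 1 / Real.log (bigP D) *
          (-1 - betaJ c' D j * (Real.log (y / bigP D ^ (0.5 : ℝ)) : ℂ))‖ ≤ C₁ * (ell D ^ 15)⁻¹) ∧
      (bigP D ^ (0.502 : ℝ) < y → y ≤ bigP D ^ (0.504 : ℝ) / bigT D →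
        ‖frakv1 c' χ j y - 500 * deriv χ.LFunction 1 / Real.log (bigP D) *
          (1 - betaJ c' D j * (Real.log (bigP D ^ (0.504 : ℝ) / y) : ℂ))‖ ≤ C₁ * (ell D ^ 15)⁻¹) ∧
      ((bigP D ^ (0.5 : ℝ) / bigT D < y ∧ y ≤ bigP D ^ (0.5 : ℝ)) ∨
          (bigP D ^ (0.502 : ℝ) / bigT D < y ∧ y ≤ bigP D ^ (0.502 : ℝ)) ∨
          (bigP D ^ (0.504 : ℝ) / bigT D < y ∧ y < bigP D ^ (0.504 : ℝ)) →
        ‖frakv1 c' χ j y‖ ≤ C₁ * (ell D ^ 7)⁻¹))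
    (h84 : ∀ j ∈ ({1, 2, 3} : Finset ℕ), ∀ μ ∈ ({6, 7} : Finset ℕ), ∀ d r : ℕ, 1 ≤ d → 1 ≤ r →
      ((d * r : ℕ) : ℝ) < bigP D / bigT D ^ 2 → ∀ y : ℝ, bigT D < y → y < bigP D →
        ‖(∑ n ∈ Finset.Ico 1 ⌈y⌉₊, χ (n : ZMod D) * xiZero c' D j n d r / (n : ℂ) *
              ((y / n : ℝ) : ℂ) ^ (-betaMu D μ) * (Real.log (y / n) : ℂ)) -
            deriv χ.LFunction 1 * PiW χ d r * frakgW c' D j μ y‖ ≤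
          C₂ * (ell D ^ 6)⁻¹ * (∏ q ∈ (d * r).primeFactors, (1 - (q : ℝ)⁻¹)⁻¹) ^ 2)
    (h3 : ∀ j ∈ ({1, 2, 3} : Finset ℕ), ∀ d r : ℕ, 1 ≤ d → 1 ≤ r →
      ((d * r : ℕ) : ℝ) < Skeleton.P1 D → ∀ x : ℝ, 1 ≤ x → x ≤ bigT D →
        ∑ n ∈ Finset.Ico 1 ⌈x⌉₊, ‖xiZero c' D j n d r‖ / n ≤ C₃ * ell D * (1 + Real.log x) ^ 3)
    {j : ℕ} (hj : j ∈ ({1, 2, 3} : Finset ℕ)) :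
    ‖(∑ n ∈ (Finset.Ico 1 (Nsupp D)).filter
          (fun n : ℕ => bigP D ^ (0.496 : ℝ) ≤ (n : ℝ) ∧ (n : ℝ) < bigP D ^ (0.498 : ℝ)),
        ∑ r ∈ n.divisors,
          (if Squarefree r then
            (‖χ (n : ZMod D)‖ : ℂ) * lamZero c' D j n / (n : ℂ) / (Nat.totient r : ℂ) *
              frakv1 c' χ j (yShift D (n : ℝ)) * nSum22 c' χ j (n / r) r else 0)) -
      ∑ n ∈ (Finset.Ico 1 (Nsupp D)).filter
          (fun n : ℕ => bigP D ^ (0.496 : ℝ) ≤ (n : ℝ) ∧ (n : ℝ) < bigP D ^ (0.498 : ℝ)),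
        (‖χ (n : ZMod D)‖ : ℂ) * lamZero c' D j n / (n : ℂ) * ((n : ℂ) / (Nat.totient n : ℂ)) *
          (500 * deriv χ.LFunction 1 / (Real.log (bigP D) : ℂ) *
              (-1 - betaJ c' D j * (Real.log (bigP D ^ (-0.496 : ℝ) * n) : ℂ)) *
            deriv χ.LFunction 1 *
            (iota3 * (Real.log (Skeleton.P3 D) : ℂ)⁻¹ * frakgW c' D j 6 (Skeleton.P3 D / n) +
              iota4 * (Real.log (Skeleton.P2 D) : ℂ)⁻¹ * frakgW c' D j 7 (Skeleton.P2 D / n)))‖ ≤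
      (∑ n ∈ ((Finset.Ico 1 (Nsupp D)).filter
          (fun n : ℕ => bigP D ^ (0.496 : ℝ) ≤ (n : ℝ) ∧ (n : ℝ) < bigP D ^ (0.498 : ℝ))).filter
            (fun n : ℕ => bigP D ^ (0.496 : ℝ) * ((D : ℝ) * t0 D) < (n : ℝ) ∧
              (n : ℝ) < bigP D ^ (0.498 : ℝ) / bigT D),
          ‖(‖χ (n : ZMod D)‖ : ℂ) * lamZero c' D j n / (n : ℂ)‖ * ((n : ℝ) / Nat.totient n) ^ 3) *
          ((28000 * Real.exp (9 / 2) * (ell D ^ 7)⁻¹ +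
                (C₁ + 2000 * Real.exp (9 / 2) * (4 * π) * 520) * (ell D ^ 15)⁻¹) *
              ((‖iota3‖ / Real.log (Skeleton.P3 D) + ‖iota4‖ / Real.log (Skeleton.P2 D)) *
                (C₂ * (ell D ^ 6)⁻¹)) +
            (C₁ + 2000 * Real.exp (9 / 2) * (4 * π) * 520) * (ell D ^ 15)⁻¹ *
              ‖deriv χ.LFunction 1‖ *
              (146 * (‖iota3‖ / Real.log (Skeleton.P3 D) + ‖iota4‖ / Real.log (Skeleton.P2 D)))) +
        (∑ n ∈ ((Finset.Ico 1 (Nsupp D)).filter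
          (fun n : ℕ => bigP D ^ (0.496 : ℝ) ≤ (n : ℝ) ∧ (n : ℝ) < bigP D ^ (0.498 : ℝ))).filter
            (fun n : ℕ => ¬ (bigP D ^ (0.496 : ℝ) * ((D : ℝ) * t0 D) < (n : ℝ) ∧
              (n : ℝ) < bigP D ^ (0.498 : ℝ) / bigT D)),
          ‖(‖χ (n : ZMod D)‖ : ℂ) * lamZero c' D j n / (n : ℂ)‖ * ((n : ℝ) / Nat.totient n) ^ 3) *
          ((C₁ + 28000 * Real.exp (9 / 2)) * (ell D ^ 7)⁻¹ *
              ((‖iota3‖ / Real.log (Skeleton.P3 D) + ‖iota4‖ / Real.log (Skeleton.P2 D)) *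
                (584 * Real.exp (9 / 2) * ell D ^ 2 + C₂ * (ell D ^ 6)⁻¹ +
                  C₃ * ell D * (1 + Real.log (bigT D)) ^ 3 * Real.log (bigT D))) +
            28000 * Real.exp (9 / 2) * (ell D ^ 7)⁻¹ * ‖deriv χ.LFunction 1‖ *
              (146 * (‖iota3‖ / Real.log (Skeleton.P3 D) + ‖iota4‖ / Real.log (Skeleton.P2 D)))) := by
  classical
  have hℓ : 3 ≤ ell D := by linarith
  have hℓ0 : 0 < ell D := by linarith
  obtain ⟨h2, hab, hb5, h5504, h504, h5P, hN⟩ := range_facts (D := D) hℓ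
  have hP := bigP_pos D
  have hT := bigT_pos D
  have hT1 := one_le_bigT D
  have hDt1 := Dt0_ge_one hℓ
  have h498T := rpow498_div_T_le (D := D) hℓ4
  have hP3def : Skeleton.P3 D = bigP D ^ (0.498 : ℝ) := rfl
  set S := (Finset.Ico 1 (Nsupp D)).filter
      (fun n : ℕ => bigP D ^ (0.496 : ℝ) ≤ (n : ℝ) ∧ (n : ℝ) < bigP D ^ (0.498 : ℝ)) with hSdef
  have memS : ∀ n ∈ S, 1 ≤ n ∧ bigP D ^ (0.496 : ℝ) ≤ (n : ℝ) ∧ (n : ℝ) < bigP D ^ (0.498 : ℝ) := by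
    intro n hn
    rw [hSdef, Finset.mem_filter, Finset.mem_Ico] at hn
    exact ⟨hn.1.1, hn.2.1, hn.2.2⟩
  have hS0 : ∀ n ∈ S, n ≠ 0 := fun n hn => by have := (memS n hn).1; omega
  -- the constants
  have hR0 : 0 ≤ ‖iota3‖ / Real.log (Skeleton.P3 D) + ‖iota4‖ / Real.log (Skeleton.P2 D) := by
    have := log_P2_pos hℓ
    have : 0 < Real.log (Skeleton.P3 D) := by rw [log_P3_eq]; positivity
    positivity
  refine range_assembly_bound₃ hS0
    (fun n : ℕ => bigP D ^ (0.496 : ℝ) * ((D : ℝ) * t0 D) < (n : ℝ) ∧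
      (n : ℝ) < bigP D ^ (0.498 : ℝ) / bigT D)
    (fun n => (‖χ (n : ZMod D)‖ : ℂ) * lamZero c' D j n / (n : ℂ))
    (fun n => frakv1 c' χ j (yShift D (n : ℝ)))
    (fun n => 500 * deriv χ.LFunction 1 / (Real.log (bigP D) : ℂ) *
      (-1 - betaJ c' D j * (Real.log (bigP D ^ (-0.496 : ℝ) * n) : ℂ)))
    (fun n => iota3 * (Real.log (Skeleton.P3 D) : ℂ)⁻¹ * frakgW c' D j 6 (Skeleton.P3 D / n) +
      iota4 * (Real.log (Skeleton.P2 D) : ℂ)⁻¹ * frakgW c' D j 7 (Skeleton.P2 D / n))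
    (fun d r => nSum22 c' χ j d r) (fun d r => PiW χ d r) (deriv χ.LFunction 1)
    (by positivity) (by positivity) (by positivity) ?_ ?_ ?_ ?_ ?_ ?_ ?_
  · -- hPi: (8.10)
    intro n hn _
    exact Section8FrontEnd810.eq810_holds D χ hq n (hS0 n hn)
  · -- hM: Lemma 10.1 in the main range
    intro n hn hmain
    exact norm_frakv1_yShift_sub_mid c' χ hℓ hp hc5 h101 hj hmain.1 hmain.2
  · -- hM₀
    intro n hn
    obtain ⟨-, hlo, hhi⟩ := memS n hn
    exact norm_M0mid_le c' χ hℓ hp hc5 j hlo hhi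
  · -- hMW: crude Lemma 10.1
    intro n hn _
    obtain ⟨-, hlo, hhi⟩ := memS n hn
    exact norm_frakv1_yShift_le c' χ hℓ hp hc5 hC₁ hTc h101 hj hlo (hhi.trans_le hb5)
  · -- hG
    intro n hn
    obtain ⟨hn1, -, hhi⟩ := memS n hn
    exact norm_G_le c' hℓ hc5 j (by exact_mod_cast hn1) (by linarith)
  · -- hN: the relative Lemma 8.4, both parts in range
    intro n hn hmain r hr hsq
    obtain ⟨hn1, hlo, hhi⟩ := memS n hn
    have hrd : r ∣ n := Nat.dvd_of_mem_divisors hr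
    have hr0 : r ≠ 0 := Nat.pos_iff_ne_zero.mp (Nat.pos_of_mem_divisors hr)
    have hr1 : 1 ≤ r := Nat.one_le_iff_ne_zero.mpr hr0
    have hdr : n / r * r = n := Nat.div_mul_cancel hrd
    have hd1 : 1 ≤ n / r := Nat.div_pos (Nat.le_of_dvd (by omega) hrd) (by omega)
    have hcast : ((n / r * r : ℕ) : ℝ) = n := by rw [hdr]
    have hdrP : ((n / r * r : ℕ) : ℝ) < bigP D / bigT D ^ 2 := by rw [hcast]; linarith
    have hn0r : (0 : ℝ) < n := by exact_mod_cast (by omega : 0 < n)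
    -- the two Lemma 8.4 instances
    have hy6T : bigT D < Skeleton.P3 D / ((n / r * r : ℕ) : ℝ) := by
      rw [hcast, hP3def, lt_div_iff₀ hn0r]
      have := (lt_div_iff₀ hT).mp hmain.2
      linarith
    have hy6P : Skeleton.P3 D / ((n / r * r : ℕ) : ℝ) < bigP D := by
      rw [hcast]
      exact lt_of_le_of_lt (div_le_self (by rw [hP3def]; exact (bigP_rpow_pos D _).le)
        (by exact_mod_cast hn1)) (P3_lt_bigP hℓ)
    have hy7T : bigT D < Skeleton.P2 D / ((n / r * r : ℕ) : ℝ) := by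
      rw [hcast, Skeleton.P2, lt_div_iff₀ hn0r]
      have h1 : (n : ℝ) < bigP D ^ (0.5 : ℝ) / bigT D ^ 11 := lt_of_lt_of_le hmain.2 h498T
      rw [lt_div_iff₀ (pow_pos hT 11)] at h1
      rw [lt_div_iff₀ (pow_pos hT 10)]
      calc bigT D * n * bigT D ^ 10 = n * bigT D ^ 11 := by ring
        _ < bigP D ^ (0.5 : ℝ) := h1
    have hy7P : Skeleton.P2 D / ((n / r * r : ℕ) : ℝ) < bigP D := by
      rw [hcast]
      exact lt_of_le_of_lt (div_le_self (P2_pos D).le (by exact_mod_cast hn1)) (P2_lt_bigP hℓ)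
    have i6 := h84 j hj 6 (by simp) (n / r) r hd1 hr1 hdrP _ hy6T hy6P
    have i7 := h84 j hj 7 (by simp) (n / r) r hd1 hr1 hdrP _ hy7T hy7P
    have key := norm_nSum22_sub_main_le c' χ hℓ j hd1 hr1 i6 i7
    rw [hdr] at key
    exact key.trans (le_of_eq (by ring))
  · -- hW: window bound
    intro n hn _ r hr hsq
    obtain ⟨hn1, hlo, hhi⟩ := memS n hn
    have hrd : r ∣ n := Nat.dvd_of_mem_divisors hr
    have hr0 : r ≠ 0 := Nat.pos_iff_ne_zero.mp (Nat.pos_of_mem_divisors hr)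
    have hr1 : 1 ≤ r := Nat.one_le_iff_ne_zero.mpr hr0
    have hdr : n / r * r = n := Nat.div_mul_cancel hrd
    have hd1 : 1 ≤ n / r := Nat.div_pos (Nat.le_of_dvd (by omega) hrd) (by omega)
    have hcast : ((n / r * r : ℕ) : ℝ) = n := by rw [hdr]
    have hdrP2 : ((n / r * r : ℕ) : ℝ) < bigP D / bigT D ^ 2 := by rw [hcast]; linarith
    have hdrP : ((n / r * r : ℕ) : ℝ) ≤ bigP D := by rw [hcast]; linarith
    have hdrP1 : ((n / r * r : ℕ) : ℝ) < Skeleton.P1 D := by rw [hcast, Skeleton.P1]; linarith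
    have hy6P : Skeleton.P3 D / ((n / r * r : ℕ) : ℝ) < bigP D := by
      rw [hcast]
      exact lt_of_le_of_lt (div_le_self (by rw [hP3def]; exact (bigP_rpow_pos D _).le)
        (by exact_mod_cast hn1)) (P3_lt_bigP hℓ)
    have hy7P : Skeleton.P2 D / ((n / r * r : ℕ) : ℝ) < bigP D := by
      rw [hcast]
      exact lt_of_le_of_lt (div_le_self (P2_pos D).le (by exact_mod_cast hn1)) (P2_lt_bigP hℓ)
    have key := norm_nSum22_window_le c' χ hℓ hp hc5 hC₂ hC₃ j hd1 hr1 hdrP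
      (fun hT6 => h84 j hj 6 (by simp) (n / r) r hd1 hr1 hdrP2 _ hT6 hy6P)
      (fun hT7 => h84 j hj 7 (by simp) (n / r) r hd1 hr1 hdrP2 _ hT7 hy7P)
      (fun x hx1 hxT => h3 j hj (n / r) r hd1 hr1 hdrP1 x hx1 hxT)
    rw [hdr] at key
    exact key.trans (le_of_eq (by ring))

end MidAssembly

section MidWeights

variable (c' : ℝ) {D : ℕ} (χ : DirichletCharacter ℂ D)

omit χ in
/-- `P^b/R ≥ 2` when `log R + 1 ≤ b𝓛⁹` (`R > 0`). [cite: Zhang2022LandauSiegel, §10 pp. 59–60] -/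
theorem two_le_rpow_div {b R : ℝ} (hR : 0 < R) (h : Real.log R + 1 ≤ b * ell D ^ 9) :
    2 ≤ bigP D ^ b / R := by
  rw [le_div_iff₀ hR, bigP, ← Real.exp_mul]
  have : 2 * R ≤ Real.exp (Real.log R + 1) := by
    rw [Real.exp_add, Real.exp_log hR]
    have := Real.add_one_le_exp (1 : ℝ)
    nlinarith
  refine this.trans (Real.exp_le_exp.mpr ?_)
  linarith

/-- **Weights of the whole middle range**: `Σ_{n∈S} ‖a(n)‖(n/φ(n))³ ≤ e^{256}(3 + 0.002𝓛⁹)`.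
[cite: Zhang2022LandauSiegel, §10 pp. 59–60] -/
theorem mid_weights_all_le (hℓ : 3 ≤ ell D) (j : ℕ) :
    ∑ n ∈ (Finset.Ico 1 (Nsupp D)).filter
        (fun n : ℕ => bigP D ^ (0.496 : ℝ) ≤ (n : ℝ) ∧ (n : ℝ) < bigP D ^ (0.498 : ℝ)),
      ‖(‖χ (n : ZMod D)‖ : ℂ) * lamZero c' D j n / (n : ℂ)‖ * ((n : ℝ) / Nat.totient n) ^ 3 ≤
      Real.exp 256 * (3 + 0.002 * ell D ^ 9) := by
  obtain ⟨h2, hab, -, -, -, -, -⟩ := range_facts (D := D) hℓ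
  have h := sum_weights_le c' χ j h2 hab (S' := (Finset.Ico 1 (Nsupp D)).filter
        (fun n : ℕ => bigP D ^ (0.496 : ℝ) ≤ (n : ℝ) ∧ (n : ℝ) < bigP D ^ (0.498 : ℝ)))
    (fun n hn => by
      obtain ⟨-, hlo, hhi⟩ := Finset.mem_filter.mp hn
      exact ⟨hlo, hhi.le⟩)
  rw [log_bigP_rpow, log_bigP_rpow] at h
  refine h.trans (le_of_eq ?_)
  ring

/-- **Window weights of the middle range** (`n ≤ P^{0.496}Dt₀` or `n ≥ P^{0.498}/T`):
`≤ e^{256}(6 + 520𝓛 + 𝓛^{1.1})`. [cite: Zhang2022LandauSiegel, §10 pp. 59–60] -/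
theorem mid_weights_window_le (hℓ : 3 ≤ ell D) (j : ℕ) :
    ∑ n ∈ ((Finset.Ico 1 (Nsupp D)).filter
        (fun n : ℕ => bigP D ^ (0.496 : ℝ) ≤ (n : ℝ) ∧ (n : ℝ) < bigP D ^ (0.498 : ℝ))).filter
          (fun n : ℕ => ¬ (bigP D ^ (0.496 : ℝ) * ((D : ℝ) * t0 D) < (n : ℝ) ∧
            (n : ℝ) < bigP D ^ (0.498 : ℝ) / bigT D)),
      ‖(‖χ (n : ZMod D)‖ : ℂ) * lamZero c' D j n / (n : ℂ)‖ * ((n : ℝ) / Nat.totient n) ^ 3 ≤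
      Real.exp 256 * (6 + 520 * ell D + ell D ^ (1.1 : ℝ)) := by
  classical
  have hℓ0 : 0 < ell D := by linarith
  have hℓ1 : 1 ≤ ell D := by linarith
  obtain ⟨h2, hab, -, -, -, -, -⟩ := range_facts (D := D) hℓ
  have hDt1 := Dt0_ge_one hℓ
  have hDt := Dt0_pos hℓ
  have hT := bigT_pos D
  have hT1 := one_le_bigT D
  set S := (Finset.Ico 1 (Nsupp D)).filter
        (fun n : ℕ => bigP D ^ (0.496 : ℝ) ≤ (n : ℝ) ∧ (n : ℝ) < bigP D ^ (0.498 : ℝ)) with hS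
  set W := S.filter (fun n : ℕ => ¬ (bigP D ^ (0.496 : ℝ) * ((D : ℝ) * t0 D) < (n : ℝ) ∧
            (n : ℝ) < bigP D ^ (0.498 : ℝ) / bigT D)) with hW
  set f : ℕ → ℝ := fun n =>
    ‖(‖χ (n : ZMod D)‖ : ℂ) * lamZero c' D j n / (n : ℂ)‖ * ((n : ℝ) / Nat.totient n) ^ 3 with hf
  rw [← Finset.sum_filter_add_sum_filter_not W (fun n : ℕ => (n : ℝ) ≤ bigP D ^ (0.496 : ℝ) * ((D : ℝ) * t0 D))]
  -- left window
  have hleft : ∑ n ∈ W.filter (fun n : ℕ => (n : ℝ) ≤ bigP D ^ (0.496 : ℝ) * ((D : ℝ) * t0 D)), f n ≤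
      Real.exp 256 * (3 + 520 * ell D) := by
    have hv : bigP D ^ (0.496 : ℝ) ≤ bigP D ^ (0.496 : ℝ) * ((D : ℝ) * t0 D) :=
      le_mul_of_one_le_right (by linarith) hDt1
    have h := sum_weights_le c' χ j h2 hv
      (S' := W.filter (fun n : ℕ => (n : ℝ) ≤ bigP D ^ (0.496 : ℝ) * ((D : ℝ) * t0 D)))
      (fun n hn => by
        obtain ⟨hn', hle⟩ := Finset.mem_filter.mp hn
        obtain ⟨hnS, -⟩ := Finset.mem_filter.mp hn'
        obtain ⟨-, hlo, -⟩ := Finset.mem_filter.mp hnS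
        exact ⟨hlo, hle⟩)
    refine h.trans ?_
    rw [Real.log_mul (by positivity) hDt.ne']
    have := log_Dt0_le hℓ
    have hpos : 0 < Real.exp 256 := Real.exp_pos _
    nlinarith
  -- right window
  have hright : ∑ n ∈ W.filter (fun n : ℕ => ¬ (n : ℝ) ≤ bigP D ^ (0.496 : ℝ) * ((D : ℝ) * t0 D)), f n ≤
      Real.exp 256 * (3 + ell D ^ (1.1 : ℝ)) := by
    have hu2 : 2 ≤ bigP D ^ (0.498 : ℝ) / bigT D := by
      refine two_le_rpow_div hT ?_
      rw [log_bigT_eq]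
      have h11 := ell_rpow_le_sq (D := D) hℓ1
      have h7 : (3 : ℝ) ^ 7 ≤ ell D ^ 7 := pow_le_pow_left₀ (by norm_num) hℓ 7
      nlinarith [pow_nonneg hℓ0.le 2]
    have hv : bigP D ^ (0.498 : ℝ) / bigT D ≤ bigP D ^ (0.498 : ℝ) :=
      div_le_self (bigP_rpow_pos D _).le hT1
    have h := sum_weights_le c' χ j hu2 hv
      (S' := W.filter (fun n : ℕ => ¬ (n : ℝ) ≤ bigP D ^ (0.496 : ℝ) * ((D : ℝ) * t0 D)))
      (fun n hn => by
        obtain ⟨hn', hle⟩ := Finset.mem_filter.mp hn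
        obtain ⟨hnS, hnm⟩ := Finset.mem_filter.mp hn'
        obtain ⟨-, hlo, hhi⟩ := Finset.mem_filter.mp hnS
        rw [not_le] at hle
        refine ⟨?_, hhi.le⟩
        by_contra hcon
        rw [not_le] at hcon
        exact hnm ⟨hle, hcon⟩)
    refine h.trans (le_of_eq ?_)
    rw [Real.log_div (bigP_rpow_pos D _).ne' hT.ne', log_bigT_eq]
    ring
  have hpos : 0 < Real.exp 256 := Real.exp_pos _
  linarith

end MidWeights


/-! ## Part F (middle range, final): bookkeeping, thresholds and the edge `Mid1422Eval` -/

section MidFinal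

variable (c' : ℝ) {D : ℕ} (χ : DirichletCharacter ℂ D)

/-- Monomial comparison [folklore: arithmetic]: `τ^q/ℓ^k ≤ τ⁵/ℓ¹⁵` for `1 ≤ ℓ ≤ τ`, `q ≤ 5`, `10 + q ≤ k`.
[cite: Zhang2022LandauSiegel, §10 pp. 59–60] -/
theorem pow_ratio_le {ℓ τ : ℝ} (h1 : 1 ≤ ℓ) (hτ : ℓ ≤ τ) {q k : ℕ} (hq : q ≤ 5) (hk : 10 + q ≤ k) :
    τ ^ q / ℓ ^ k ≤ τ ^ 5 / ℓ ^ 15 := by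
  have hℓ0 : 0 < ℓ := by linarith
  have hτ1 : 1 ≤ τ := h1.trans hτ
  rw [div_le_div_iff₀ (by positivity) (by positivity)]
  calc τ ^ q * ℓ ^ 15 = τ ^ q * (ℓ ^ (5 - q) * ℓ ^ (10 + q)) := by
        rw [← pow_add, show 5 - q + (10 + q) = 15 by omega]
    _ ≤ τ ^ q * (τ ^ (5 - q) * ℓ ^ k) := by
        apply mul_le_mul_of_nonneg_left _ (by positivity)
        exact mul_le_mul (pow_le_pow_left₀ hℓ0.le hτ _) (pow_le_pow_right₀ h1 hk)
          (by positivity) (by positivity)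
    _ = τ ^ 5 * ℓ ^ k := by
        rw [← mul_assoc, ← pow_add, show q + (5 - q) = 5 by omega]

/-- Bookkeeping of the middle range: every error monomial is `≤ K·τ⁵𝓛⁻¹⁵` (`τ = 𝓛^{1.1}`).
[folklore: arithmetic] [cite: Zhang2022LandauSiegel, §10 pp. 59–60] -/
theorem mid_numeric_bound {ℓ τ Wm Ww Wa R L C₁ C₂ C₃ : ℝ} (h3 : 3 ≤ ℓ) (hτ : ℓ ≤ τ)
    (hWm : Wm ≤ Real.exp 256 * ℓ ^ 9)
    (hWw : Ww ≤ 537 * Real.exp 256 * τ) (hWa : Wa ≤ Real.exp 256 * ℓ ^ 9)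
    (hR0 : 0 ≤ R) (hR : R ≤ 9 * (ℓ ^ 9)⁻¹) (hL0 : 0 ≤ L) (hL : L ≤ 4 * Real.exp (9 / 2) * ℓ ^ 2)
    (hC₁ : 0 ≤ C₁) (hC₂ : 0 ≤ C₂) (hC₃ : 0 ≤ C₃) :
    Wm * ((28000 * Real.exp (9 / 2) * (ℓ ^ 7)⁻¹ +
              (C₁ + 2000 * Real.exp (9 / 2) * (4 * π) * 520) * (ℓ ^ 15)⁻¹) *
            (R * (C₂ * (ℓ ^ 6)⁻¹)) +
          (C₁ + 2000 * Real.exp (9 / 2) * (4 * π) * 520) * (ℓ ^ 15)⁻¹ * L * (146 * R)) +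
      Ww * ((C₁ + 28000 * Real.exp (9 / 2)) * (ℓ ^ 7)⁻¹ *
            (R * (584 * Real.exp (9 / 2) * ℓ ^ 2 + C₂ * (ℓ ^ 6)⁻¹ + C₃ * ℓ * (1 + τ) ^ 3 * τ)) +
          28000 * Real.exp (9 / 2) * (ℓ ^ 7)⁻¹ * L * (146 * R)) +
      Wa * (28000 * Real.exp (9 / 2) * (ℓ ^ 7)⁻¹ * L * (100000 * τ * (ℓ ^ 18)⁻¹)) ≤
      Real.exp 256 *
          ((28000 * Real.exp (9 / 2) + C₁ + 2000 * Real.exp (9 / 2) * (4 * π) * 520) * 9 * C₂ +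
            (C₁ + 2000 * Real.exp (9 / 2) * (4 * π) * 520) * (4 * Real.exp (9 / 2)) * 146 * 9 +
            537 * (C₁ + 28000 * Real.exp (9 / 2)) * 9 * (584 * Real.exp (9 / 2) + C₂ + 8 * C₃) +
            537 * (28000 * Real.exp (9 / 2)) * (4 * Real.exp (9 / 2)) * 146 * 9 +
            28000 * Real.exp (9 / 2) * (4 * Real.exp (9 / 2)) * 100000) *
        τ ^ 5 * (ℓ ^ 15)⁻¹ := by
  have h1 : 1 ≤ ℓ := by linarith
  have hℓ0 : 0 < ℓ := by linarith
  have hτ1 : 1 ≤ τ := h1.trans hτ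
  have hτ0 : 0 < τ := by linarith
  set e45 := Real.exp (9 / 2) with he45
  set e256 := Real.exp 256 with he256
  set K₀ := 2000 * e45 * (4 * π) * 520 with hK₀
  have hK₀ : 0 ≤ K₀ := by positivity
  set u := τ ^ 5 * (ℓ ^ 15)⁻¹ with hu
  have hu' : u = τ ^ 5 / ℓ ^ 15 := by rw [hu, div_eq_mul_inv]
  -- monomials
  have m1 : ℓ ^ 9 * (ℓ ^ 7)⁻¹ * (ℓ ^ 9)⁻¹ * (ℓ ^ 6)⁻¹ ≤ u := by
    have e : ℓ ^ 9 * (ℓ ^ 7)⁻¹ * (ℓ ^ 9)⁻¹ * (ℓ ^ 6)⁻¹ = τ ^ 0 / ℓ ^ 13 := by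
      field_simp
    rw [e, hu']; exact pow_ratio_le h1 hτ (by norm_num) (by norm_num)
  have m2 : ℓ ^ 9 * (ℓ ^ 15)⁻¹ * ℓ ^ 2 * (ℓ ^ 9)⁻¹ ≤ u := by
    have e : ℓ ^ 9 * (ℓ ^ 15)⁻¹ * ℓ ^ 2 * (ℓ ^ 9)⁻¹ = τ ^ 0 / ℓ ^ 13 := by
      field_simp
    rw [e, hu']; exact pow_ratio_le h1 hτ (by norm_num) (by norm_num)
  have m3 : τ * (ℓ ^ 7)⁻¹ * (ℓ ^ 9)⁻¹ * ℓ ^ 2 ≤ u := by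
    have e : τ * (ℓ ^ 7)⁻¹ * (ℓ ^ 9)⁻¹ * ℓ ^ 2 = τ ^ 1 / ℓ ^ 14 := by
      field_simp
    rw [e, hu']; exact pow_ratio_le h1 hτ (by norm_num) (by norm_num)
  have m4 : τ * (ℓ ^ 7)⁻¹ * (ℓ ^ 9)⁻¹ * (ℓ ^ 6)⁻¹ ≤ u := by
    have e : τ * (ℓ ^ 7)⁻¹ * (ℓ ^ 9)⁻¹ * (ℓ ^ 6)⁻¹ = τ ^ 1 / ℓ ^ 22 := by
      field_simp
    rw [e, hu']; exact pow_ratio_le h1 hτ (by norm_num) (by norm_num)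
  have m5 : τ * (ℓ ^ 7)⁻¹ * (ℓ ^ 9)⁻¹ * (ℓ * τ ^ 3 * τ) ≤ u := by
    have e : τ * (ℓ ^ 7)⁻¹ * (ℓ ^ 9)⁻¹ * (ℓ * τ ^ 3 * τ) = τ ^ 5 / ℓ ^ 15 := by
      field_simp
    rw [e, hu']
  have m6 : ℓ ^ 9 * (ℓ ^ 7)⁻¹ * ℓ ^ 2 * (τ * (ℓ ^ 18)⁻¹) ≤ u := by
    have e : ℓ ^ 9 * (ℓ ^ 7)⁻¹ * ℓ ^ 2 * (τ * (ℓ ^ 18)⁻¹) = τ ^ 1 / ℓ ^ 14 := by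
      field_simp
    rw [e, hu']; exact pow_ratio_le h1 hτ (by norm_num) (by norm_num)
  -- elementary replacements
  have h15_7 : (ℓ ^ 15)⁻¹ ≤ (ℓ ^ 7)⁻¹ := by
    rw [inv_le_inv₀ (by positivity) (by positivity)]; exact pow_le_pow_right₀ h1 (by norm_num)
  have h6 : (ℓ ^ 6)⁻¹ ≤ 1 := inv_le_one_of_one_le₀ (one_le_pow₀ h1)
  have hcube : (1 + τ) ^ 3 ≤ 8 * τ ^ 3 := by nlinarith [pow_le_pow_left₀ (by linarith : (0:ℝ) ≤ 1 + τ) (by linarith : 1 + τ ≤ 2 * τ) 3]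
  -- names
  set A := e256 * ℓ ^ 9 with hA
  set B := 537 * e256 * τ with hB
  set R' := 9 * (ℓ ^ 9)⁻¹ with hR'
  set L' := 4 * e45 * ℓ ^ 2 with hL'
  set Mtot := 28000 * e45 + C₁ + K₀ with hMtot
  have hBMeM : 28000 * e45 * (ℓ ^ 7)⁻¹ + (C₁ + K₀) * (ℓ ^ 15)⁻¹ ≤ Mtot * (ℓ ^ 7)⁻¹ := by
    calc 28000 * e45 * (ℓ ^ 7)⁻¹ + (C₁ + K₀) * (ℓ ^ 15)⁻¹
        ≤ 28000 * e45 * (ℓ ^ 7)⁻¹ + (C₁ + K₀) * (ℓ ^ 7)⁻¹ := by gcongr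
      _ = Mtot * (ℓ ^ 7)⁻¹ := by rw [hMtot]; ring
  -- step 1: leaves
  have step1 :
      Wm * ((28000 * e45 * (ℓ ^ 7)⁻¹ + (C₁ + K₀) * (ℓ ^ 15)⁻¹) * (R * (C₂ * (ℓ ^ 6)⁻¹)) +
            (C₁ + K₀) * (ℓ ^ 15)⁻¹ * L * (146 * R)) +
        Ww * ((C₁ + 28000 * e45) * (ℓ ^ 7)⁻¹ *
              (R * (584 * e45 * ℓ ^ 2 + C₂ * (ℓ ^ 6)⁻¹ + C₃ * ℓ * (1 + τ) ^ 3 * τ)) +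
            28000 * e45 * (ℓ ^ 7)⁻¹ * L * (146 * R)) +
        Wa * (28000 * e45 * (ℓ ^ 7)⁻¹ * L * (100000 * τ * (ℓ ^ 18)⁻¹)) ≤
      A * ((Mtot * (ℓ ^ 7)⁻¹) * (R' * (C₂ * (ℓ ^ 6)⁻¹)) +
            (C₁ + K₀) * (ℓ ^ 15)⁻¹ * L' * (146 * R')) +
        B * ((C₁ + 28000 * e45) * (ℓ ^ 7)⁻¹ *
              (R' * (584 * e45 * ℓ ^ 2 + C₂ * (ℓ ^ 6)⁻¹ + C₃ * ℓ * (8 * τ ^ 3) * τ)) +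
            28000 * e45 * (ℓ ^ 7)⁻¹ * L' * (146 * R')) +
        A * (28000 * e45 * (ℓ ^ 7)⁻¹ * L' * (100000 * τ * (ℓ ^ 18)⁻¹)) := by
    gcongr
  -- step 2: monomials
  have s1 : A * ((Mtot * (ℓ ^ 7)⁻¹) * (R' * (C₂ * (ℓ ^ 6)⁻¹)) +
            (C₁ + K₀) * (ℓ ^ 15)⁻¹ * L' * (146 * R')) ≤
      e256 * (Mtot * 9 * C₂ + (C₁ + K₀) * (4 * e45) * 146 * 9) * u := by
    calc A * ((Mtot * (ℓ ^ 7)⁻¹) * (R' * (C₂ * (ℓ ^ 6)⁻¹)) +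
            (C₁ + K₀) * (ℓ ^ 15)⁻¹ * L' * (146 * R'))
        = e256 * Mtot * 9 * C₂ * (ℓ ^ 9 * (ℓ ^ 7)⁻¹ * (ℓ ^ 9)⁻¹ * (ℓ ^ 6)⁻¹) +
            e256 * ((C₁ + K₀) * (4 * e45) * 146 * 9) *
              (ℓ ^ 9 * (ℓ ^ 15)⁻¹ * ℓ ^ 2 * (ℓ ^ 9)⁻¹) := by
          rw [hA, hR', hL']; ring
      _ ≤ e256 * Mtot * 9 * C₂ * u + e256 * ((C₁ + K₀) * (4 * e45) * 146 * 9) * u := by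
          gcongr
      _ = _ := by ring
  have s2 : B * ((C₁ + 28000 * e45) * (ℓ ^ 7)⁻¹ *
              (R' * (584 * e45 * ℓ ^ 2 + C₂ * (ℓ ^ 6)⁻¹ + C₃ * ℓ * (8 * τ ^ 3) * τ)) +
            28000 * e45 * (ℓ ^ 7)⁻¹ * L' * (146 * R')) ≤
      e256 * (537 * (C₁ + 28000 * e45) * 9 * (584 * e45 + C₂ + 8 * C₃) +
        537 * (28000 * e45) * (4 * e45) * 146 * 9) * u := by
    calc B * ((C₁ + 28000 * e45) * (ℓ ^ 7)⁻¹ *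
              (R' * (584 * e45 * ℓ ^ 2 + C₂ * (ℓ ^ 6)⁻¹ + C₃ * ℓ * (8 * τ ^ 3) * τ)) +
            28000 * e45 * (ℓ ^ 7)⁻¹ * L' * (146 * R'))
        = e256 * (537 * (C₁ + 28000 * e45) * 9 * (584 * e45)) *
              (τ * (ℓ ^ 7)⁻¹ * (ℓ ^ 9)⁻¹ * ℓ ^ 2) +
            e256 * (537 * (C₁ + 28000 * e45) * 9 * C₂) *
              (τ * (ℓ ^ 7)⁻¹ * (ℓ ^ 9)⁻¹ * (ℓ ^ 6)⁻¹) +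
            e256 * (537 * (C₁ + 28000 * e45) * 9 * (8 * C₃)) *
              (τ * (ℓ ^ 7)⁻¹ * (ℓ ^ 9)⁻¹ * (ℓ * τ ^ 3 * τ)) +
            e256 * (537 * (28000 * e45) * (4 * e45) * 146 * 9) *
              (τ * (ℓ ^ 7)⁻¹ * (ℓ ^ 9)⁻¹ * ℓ ^ 2) := by
          rw [hB, hR', hL']; ring
      _ ≤ e256 * (537 * (C₁ + 28000 * e45) * 9 * (584 * e45)) * u +
            e256 * (537 * (C₁ + 28000 * e45) * 9 * C₂) * u +
            e256 * (537 * (C₁ + 28000 * e45) * 9 * (8 * C₃)) * u +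
            e256 * (537 * (28000 * e45) * (4 * e45) * 146 * 9) * u := by
          gcongr
      _ = _ := by ring
  have s3 : A * (28000 * e45 * (ℓ ^ 7)⁻¹ * L' * (100000 * τ * (ℓ ^ 18)⁻¹)) ≤
      e256 * (28000 * e45 * (4 * e45) * 100000) * u := by
    calc A * (28000 * e45 * (ℓ ^ 7)⁻¹ * L' * (100000 * τ * (ℓ ^ 18)⁻¹))
        = e256 * (28000 * e45 * (4 * e45) * 100000) *
            (ℓ ^ 9 * (ℓ ^ 7)⁻¹ * ℓ ^ 2 * (τ * (ℓ ^ 18)⁻¹)) := by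
          rw [hA, hL']; ring
      _ ≤ e256 * (28000 * e45 * (4 * e45) * 100000) * u := by gcongr
  refine step1.trans ?_
  refine (add_le_add (add_le_add s1 s2) s3).trans (le_of_eq ?_)
  rw [hu, hMtot]; ring


omit χ in
/-- `|ι₃|/log P₃ + |ι₄|/log P₂ ≤ 9𝓛⁻⁹` (`log P₃ = 0.498𝓛⁹`, `log P₂ ≥ 0.4𝓛⁹`, `|ι₃| ≤ 1.25`,
`|ι₄| ≤ 2.3`). [cite: Zhang2022LandauSiegel, §10 p. 59] -/
theorem iotaR_le (h : 3 ≤ ell D) :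
    ‖iota3‖ / Real.log (Skeleton.P3 D) + ‖iota4‖ / Real.log (Skeleton.P2 D) ≤ 9 * (ell D ^ 9)⁻¹ := by
  have hℓ0 : 0 < ell D := by linarith
  obtain ⟨h3, h4⟩ := norm_iota3_iota4_le
  have hP2 := (log_P2_bounds (D := D) h).1
  have h9 : 0 < ell D ^ 9 := by positivity
  rw [log_P3_eq]
  calc ‖iota3‖ / (0.498 * ell D ^ 9) + ‖iota4‖ / Real.log (Skeleton.P2 D)
      ≤ 1.25 / (0.498 * ell D ^ 9) + 2.3 / (0.4 * ell D ^ 9) := by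
        gcongr
    _ = (1.25 / 0.498 + 2.3 / 0.4) * (ell D ^ 9)⁻¹ := by ring
    _ ≤ 9 * (ell D ^ 9)⁻¹ := mul_le_mul_of_nonneg_right (by norm_num) (by positivity)

omit χ in
/-- Helper for the §10c range evaluations. [cite: Zhang2022LandauSiegel, §10 pp. 59–60] -/
theorem iotaR_nonneg (h : 3 ≤ ell D) :
    0 ≤ ‖iota3‖ / Real.log (Skeleton.P3 D) + ‖iota4‖ / Real.log (Skeleton.P2 D) := by
  have hℓ0 : 0 < ell D := by linarith
  have hP3 : 0 < Real.log (Skeleton.P3 D) := by rw [log_P3_eq]; positivity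
  have hP2 := log_P2_pos (D := D) h
  positivity

omit χ in
/-- From `D ≥ ⌈e^x⌉`: `x ≤ 𝓛`. [cite: Zhang2022LandauSiegel, §10 pp. 59–60] -/
theorem le_ell_of_ceil_exp_le {x : ℝ} (hD : ⌈Real.exp x⌉₊ ≤ D) : x ≤ ell D := by
  have h1 : Real.exp x ≤ (D : ℝ) := (Nat.le_ceil _).trans (by exact_mod_cast hD)
  rw [ell]
  calc x = Real.log (Real.exp x) := (Real.log_exp x).symm
    _ ≤ Real.log D := Real.log_le_log (Real.exp_pos x) h1

omit χ in
/-- `T^{−c} ≤ 𝓛⁻⁷` once `𝓛 ≥ (7/c)^{10}` (`T = exp 𝓛^{1.1}`, `7 log 𝓛 ≤ 7𝓛 ≤ c𝓛^{1.1}`).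
[cite: Zhang2022LandauSiegel, §10 pp. 59–60] -/
theorem bigT_rpow_neg_le {c : ℝ} (hc : 0 < c) (h1 : 1 ≤ ell D) (h : (7 / c) ^ 10 ≤ ell D) :
    bigT D ^ (-c) ≤ (ell D ^ 7)⁻¹ := by
  have hℓ0 : 0 < ell D := by linarith
  have hT : bigT D ^ (-c) = Real.exp (-(c * ell D ^ (1.1 : ℝ))) := by
    rw [bigT, ← Real.exp_mul]; ring_nf
  have hL : (ell D ^ 7)⁻¹ = Real.exp (-(7 * Real.log (ell D))) := by
    rw [Real.exp_neg, show 7 * Real.log (ell D) = Real.log (ell D ^ 7) by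
      rw [Real.log_pow]; norm_num, Real.exp_log (by positivity)]
  rw [hT, hL, Real.exp_le_exp, neg_le_neg_iff]
  have hlog : Real.log (ell D) ≤ ell D := (Real.log_le_sub_one_of_pos hℓ0).trans (by linarith)
  have h01 : 7 / c ≤ ell D ^ (0.1 : ℝ) := by
    have h' : ((7 / c) ^ 10) ^ (0.1 : ℝ) ≤ ell D ^ (0.1 : ℝ) :=
      Real.rpow_le_rpow (by positivity) h (by norm_num)
    rwa [← Real.rpow_natCast, ← Real.rpow_mul (by positivity),
      show ((10 : ℕ) : ℝ) * (0.1 : ℝ) = 1 by norm_num, Real.rpow_one] at h'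
  have h7 : 7 ≤ c * ell D ^ (0.1 : ℝ) := by
    rw [div_le_iff₀ hc] at h01; linarith
  have hsplit : ell D ^ (1.1 : ℝ) = ell D * ell D ^ (0.1 : ℝ) := by
    rw [show (1.1 : ℝ) = 1 + 0.1 by norm_num, Real.rpow_add hℓ0, Real.rpow_one]
  rw [hsplit]
  calc 7 * Real.log (ell D) ≤ 7 * ell D := by gcongr
    _ ≤ c * ell D ^ (0.1 : ℝ) * ell D := mul_le_mul_of_nonneg_right h7 hℓ0.le
    _ = c * (ell D * ell D ^ (0.1 : ℝ)) := by ring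

omit χ in
/-- `5|c′|α𝓛 ≤ 1` once `𝓛 ≥ 5|c′|π` (`α𝓛 = π𝓛⁻⁸ ≤ π/𝓛`).
[cite: Zhang2022LandauSiegel, §10 pp. 59–60] -/
theorem hc5_of_le (hℓ : 3 ≤ ell D) (h : 5 * |c'| * π ≤ ell D) :
    5 * |c'| * alpha D * ell D ≤ 1 := by
  have hℓ0 : 0 < ell D := by linarith
  have h1 : 1 ≤ ell D := by linarith
  obtain ⟨-, hα, -⟩ := alpha_facts (D := D) hℓ
  rw [hα]
  have h8 : ell D ≤ ell D ^ 8 := le_self_pow₀ h1 (by norm_num)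
  rw [show 5 * |c'| * (π / ell D ^ 9) * ell D = 5 * |c'| * π / ell D ^ 8 by field_simp,
    div_le_one (by positivity)]
  linarith

omit χ in
/-- The `ε`-step: `K·τ⁵𝓛⁻¹⁵ ≤ ε·α` (`α = π𝓛⁻⁹`, `τ¹⁰ = 𝓛¹¹`) once `𝓛 ≥ K²/(ε²π²)`.
[cite: Zhang2022LandauSiegel, §10 pp. 59–60] -/
theorem K_tau5_le_eps_alpha {K ε : ℝ} (hK : 0 ≤ K) (hε : 0 < ε) (hℓ : 3 ≤ ell D)
    (hbig : K ^ 2 / (ε ^ 2 * π ^ 2) ≤ ell D) :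
    K * (ell D ^ (1.1 : ℝ)) ^ 5 * (ell D ^ 15)⁻¹ ≤ ε * alpha D := by
  have hℓ0 : 0 < ell D := by linarith
  obtain ⟨-, hα, -⟩ := alpha_facts (D := D) hℓ
  rw [hα]
  have hs : ((ell D ^ (1.1 : ℝ)) ^ 5) ^ 2 = ell D ^ 11 := by
    rw [← pow_mul, show 5 * 2 = 10 by rfl, ← Real.rpow_natCast _ 10,
      ← Real.rpow_mul hℓ0.le, show (1.1 : ℝ) * ((10 : ℕ) : ℝ) = ((11 : ℕ) : ℝ) by norm_num,
      Real.rpow_natCast]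
  have hK2 : K ^ 2 ≤ ε ^ 2 * π ^ 2 * ell D := by
    rw [div_le_iff₀ (by positivity)] at hbig; linarith
  have key : K * (ell D ^ (1.1 : ℝ)) ^ 5 ≤ ε * π * ell D ^ 6 := by
    refine (pow_le_pow_iff_left₀ (by positivity) (by positivity) two_ne_zero).mp ?_
    calc (K * (ell D ^ (1.1 : ℝ)) ^ 5) ^ 2 = K ^ 2 * ell D ^ 11 := by rw [mul_pow, hs]
      _ ≤ ε ^ 2 * π ^ 2 * ell D * ell D ^ 11 := by gcongr
      _ = (ε * π * ell D ^ 6) ^ 2 := by ring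
  calc K * (ell D ^ (1.1 : ℝ)) ^ 5 * (ell D ^ 15)⁻¹ ≤ ε * π * ell D ^ 6 * (ell D ^ 15)⁻¹ :=
        mul_le_mul_of_nonneg_right key (by positivity)
    _ = ε * (π / ell D ^ 9) := by field_simp

variable [NeZero D]

/-- Monotonicity of the Lemma 10.1 body in its constant.
[cite: Zhang2022LandauSiegel, §10 pp. 59–60] -/
theorem body101_mono {c C C' : ℝ} (hCC' : C ≤ C')
    (h101 : ∀ j ∈ ({1, 2, 3} : Finset ℕ), ∀ y : ℝ,
      (1 ≤ y → y ≤ bigP D ^ (0.5 : ℝ) / bigT D → ‖frakv1 c' χ j y‖ ≤ C * bigT D ^ (-c)) ∧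
      (bigP D ^ (0.5 : ℝ) < y → y ≤ bigP D ^ (0.502 : ℝ) / bigT D →
        ‖frakv1 c' χ j y - 500 * deriv χ.LFunction 1 / Real.log (bigP D) *
          (-1 - betaJ c' D j * (Real.log (y / bigP D ^ (0.5 : ℝ)) : ℂ))‖ ≤ C * (ell D ^ 15)⁻¹) ∧
      (bigP D ^ (0.502 : ℝ) < y → y ≤ bigP D ^ (0.504 : ℝ) / bigT D →
        ‖frakv1 c' χ j y - 500 * deriv χ.LFunction 1 / Real.log (bigP D) *
          (1 - betaJ c' D j * (Real.log (bigP D ^ (0.504 : ℝ) / y) : ℂ))‖ ≤ C * (ell D ^ 15)⁻¹) ∧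
      ((bigP D ^ (0.5 : ℝ) / bigT D < y ∧ y ≤ bigP D ^ (0.5 : ℝ)) ∨
          (bigP D ^ (0.502 : ℝ) / bigT D < y ∧ y ≤ bigP D ^ (0.502 : ℝ)) ∨
          (bigP D ^ (0.504 : ℝ) / bigT D < y ∧ y < bigP D ^ (0.504 : ℝ)) →
        ‖frakv1 c' χ j y‖ ≤ C * (ell D ^ 7)⁻¹)) :
    ∀ j ∈ ({1, 2, 3} : Finset ℕ), ∀ y : ℝ,
      (1 ≤ y → y ≤ bigP D ^ (0.5 : ℝ) / bigT D → ‖frakv1 c' χ j y‖ ≤ C' * bigT D ^ (-c)) ∧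
      (bigP D ^ (0.5 : ℝ) < y → y ≤ bigP D ^ (0.502 : ℝ) / bigT D →
        ‖frakv1 c' χ j y - 500 * deriv χ.LFunction 1 / Real.log (bigP D) *
          (-1 - betaJ c' D j * (Real.log (y / bigP D ^ (0.5 : ℝ)) : ℂ))‖ ≤ C' * (ell D ^ 15)⁻¹) ∧
      (bigP D ^ (0.502 : ℝ) < y → y ≤ bigP D ^ (0.504 : ℝ) / bigT D →
        ‖frakv1 c' χ j y - 500 * deriv χ.LFunction 1 / Real.log (bigP D) *
          (1 - betaJ c' D j * (Real.log (bigP D ^ (0.504 : ℝ) / y) : ℂ))‖ ≤ C' * (ell D ^ 15)⁻¹) ∧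
      ((bigP D ^ (0.5 : ℝ) / bigT D < y ∧ y ≤ bigP D ^ (0.5 : ℝ)) ∨
          (bigP D ^ (0.502 : ℝ) / bigT D < y ∧ y ≤ bigP D ^ (0.502 : ℝ)) ∨
          (bigP D ^ (0.504 : ℝ) / bigT D < y ∧ y < bigP D ^ (0.504 : ℝ)) →
        ‖frakv1 c' χ j y‖ ≤ C' * (ell D ^ 7)⁻¹) := by
  have hT : 0 ≤ bigT D ^ (-c) := (Real.rpow_pos_of_pos (bigT_pos D) _).le
  have hℓ : 0 ≤ ell D := by rw [ell]; exact Real.log_natCast_nonneg D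
  have h15 : 0 ≤ (ell D ^ 15)⁻¹ := inv_nonneg.mpr (pow_nonneg hℓ _)
  have h7 : 0 ≤ (ell D ^ 7)⁻¹ := inv_nonneg.mpr (pow_nonneg hℓ _)
  intro j hj y
  obtain ⟨h1, h2, h3, h4⟩ := h101 j hj y
  exact ⟨fun a b => (h1 a b).trans (mul_le_mul_of_nonneg_right hCC' hT),
    fun a b => (h2 a b).trans (mul_le_mul_of_nonneg_right hCC' h15),
    fun a b => (h3 a b).trans (mul_le_mul_of_nonneg_right hCC' h15),
    fun a => (h4 a).trans (mul_le_mul_of_nonneg_right hCC' h7)⟩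

/-- Monotonicity of the relative Lemma 8.4 body in its constant.
[cite: Zhang2022LandauSiegel, §10 pp. 59–60] -/
theorem body84_mono {C C' : ℝ} (hCC' : C ≤ C')
    (h84 : ∀ j ∈ ({1, 2, 3} : Finset ℕ), ∀ μ ∈ ({6, 7} : Finset ℕ), ∀ d r : ℕ, 1 ≤ d → 1 ≤ r →
      ((d * r : ℕ) : ℝ) < bigP D / bigT D ^ 2 → ∀ y : ℝ, bigT D < y → y < bigP D →
        ‖(∑ n ∈ Finset.Ico 1 ⌈y⌉₊, χ (n : ZMod D) * xiZero c' D j n d r / (n : ℂ) *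
              ((y / n : ℝ) : ℂ) ^ (-betaMu D μ) * (Real.log (y / n) : ℂ)) -
            deriv χ.LFunction 1 * PiW χ d r * frakgW c' D j μ y‖ ≤
          C * (ell D ^ 6)⁻¹ * (∏ q ∈ (d * r).primeFactors, (1 - (q : ℝ)⁻¹)⁻¹) ^ 2) :
    ∀ j ∈ ({1, 2, 3} : Finset ℕ), ∀ μ ∈ ({6, 7} : Finset ℕ), ∀ d r : ℕ, 1 ≤ d → 1 ≤ r →
      ((d * r : ℕ) : ℝ) < bigP D / bigT D ^ 2 → ∀ y : ℝ, bigT D < y → y < bigP D →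
        ‖(∑ n ∈ Finset.Ico 1 ⌈y⌉₊, χ (n : ZMod D) * xiZero c' D j n d r / (n : ℂ) *
              ((y / n : ℝ) : ℂ) ^ (-betaMu D μ) * (Real.log (y / n) : ℂ)) -
            deriv χ.LFunction 1 * PiW χ d r * frakgW c' D j μ y‖ ≤
          C' * (ell D ^ 6)⁻¹ * (∏ q ∈ (d * r).primeFactors, (1 - (q : ℝ)⁻¹)⁻¹) ^ 2 := by
  intro j hj μ hμ d r hd hr hdr y hTy hyP
  exact (h84 j hj μ hμ d r hd hr hdr y hTy hyP).trans (by gcongr)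

omit [NeZero D] in
/-- Monotonicity of the tail-mean body in its constant.
[cite: Zhang2022LandauSiegel, §10 pp. 59–60] -/
theorem body3_mono {C C' : ℝ} (hCC' : C ≤ C')
    (h3 : ∀ j ∈ ({1, 2, 3} : Finset ℕ), ∀ d r : ℕ, 1 ≤ d → 1 ≤ r →
      ((d * r : ℕ) : ℝ) < Skeleton.P1 D → ∀ x : ℝ, 1 ≤ x → x ≤ bigT D →
        ∑ n ∈ Finset.Ico 1 ⌈x⌉₊, ‖xiZero c' D j n d r‖ / n ≤ C * ell D * (1 + Real.log x) ^ 3) :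
    ∀ j ∈ ({1, 2, 3} : Finset ℕ), ∀ d r : ℕ, 1 ≤ d → 1 ≤ r →
      ((d * r : ℕ) : ℝ) < Skeleton.P1 D → ∀ x : ℝ, 1 ≤ x → x ≤ bigT D →
        ∑ n ∈ Finset.Ico 1 ⌈x⌉₊, ‖xiZero c' D j n d r‖ / n ≤ C' * ell D * (1 + Real.log x) ^ 3 := by
  intro j hj d r hd hr hdr x hx1 hxT
  have hℓ : 0 ≤ ell D := by rw [ell]; exact Real.log_natCast_nonneg D
  have hl : 0 ≤ 1 + Real.log x := by have := Real.log_nonneg hx1; linarith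
  exact (h3 j hj d r hd hr hdr x hx1 hxT).trans (by gcongr)

/-- **The middle range at a fixed modulus** [cite: Zhang2022LandauSiegel, §10 p. 59 (u049 (ii))]:
under the bodies of Lemma 10.1 (constant `C₁`, exponent `c` with `T^{−c} ≤ 𝓛⁻⁷`), of the relative
Lemma 8.4 (`C₂`) and of the `ξ₀`-tail mean (`C₃`), for `𝓛 ≥ 4` and `5|c′|α𝓛 ≤ 1`,
`|S_{14,22}[P^{0.496},P^{0.498}) − midSum| ≤ K(C₁⁺,C₂⁺,C₃⁺)·𝓛^{5.5}·𝓛⁻¹⁵`. -/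
theorem mid_at (hℓ4 : 4 ≤ ell D) (hq : χ.IsQuadratic) (hp : χ.IsPrimitive)
    (hc5 : 5 * |c'| * alpha D * ell D ≤ 1) {c C₁ C₂ C₃ : ℝ}
    (hTc : bigT D ^ (-c) ≤ (ell D ^ 7)⁻¹)
    (h101 : ∀ j ∈ ({1, 2, 3} : Finset ℕ), ∀ y : ℝ,
      (1 ≤ y → y ≤ bigP D ^ (0.5 : ℝ) / bigT D → ‖frakv1 c' χ j y‖ ≤ C₁ * bigT D ^ (-c)) ∧
      (bigP D ^ (0.5 : ℝ) < y → y ≤ bigP D ^ (0.502 : ℝ) / bigT D →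
        ‖frakv1 c' χ j y - 500 * deriv χ.LFunction 1 / Real.log (bigP D) *
          (-1 - betaJ c' D j * (Real.log (y / bigP D ^ (0.5 : ℝ)) : ℂ))‖ ≤ C₁ * (ell D ^ 15)⁻¹) ∧
      (bigP D ^ (0.502 : ℝ) < y → y ≤ bigP D ^ (0.504 : ℝ) / bigT D →
        ‖frakv1 c' χ j y - 500 * deriv χ.LFunction 1 / Real.log (bigP D) *
          (1 - betaJ c' D j * (Real.log (bigP D ^ (0.504 : ℝ) / y) : ℂ))‖ ≤ C₁ * (ell D ^ 15)⁻¹) ∧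
      ((bigP D ^ (0.5 : ℝ) / bigT D < y ∧ y ≤ bigP D ^ (0.5 : ℝ)) ∨
          (bigP D ^ (0.502 : ℝ) / bigT D < y ∧ y ≤ bigP D ^ (0.502 : ℝ)) ∨
          (bigP D ^ (0.504 : ℝ) / bigT D < y ∧ y < bigP D ^ (0.504 : ℝ)) →
        ‖frakv1 c' χ j y‖ ≤ C₁ * (ell D ^ 7)⁻¹))
    (h84 : ∀ j ∈ ({1, 2, 3} : Finset ℕ), ∀ μ ∈ ({6, 7} : Finset ℕ), ∀ d r : ℕ, 1 ≤ d → 1 ≤ r →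
      ((d * r : ℕ) : ℝ) < bigP D / bigT D ^ 2 → ∀ y : ℝ, bigT D < y → y < bigP D →
        ‖(∑ n ∈ Finset.Ico 1 ⌈y⌉₊, χ (n : ZMod D) * xiZero c' D j n d r / (n : ℂ) *
              ((y / n : ℝ) : ℂ) ^ (-betaMu D μ) * (Real.log (y / n) : ℂ)) -
            deriv χ.LFunction 1 * PiW χ d r * frakgW c' D j μ y‖ ≤
          C₂ * (ell D ^ 6)⁻¹ * (∏ q ∈ (d * r).primeFactors, (1 - (q : ℝ)⁻¹)⁻¹) ^ 2)
    (h3 : ∀ j ∈ ({1, 2, 3} : Finset ℕ), ∀ d r : ℕ, 1 ≤ d → 1 ≤ r →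
      ((d * r : ℕ) : ℝ) < Skeleton.P1 D → ∀ x : ℝ, 1 ≤ x → x ≤ bigT D →
        ∑ n ∈ Finset.Ico 1 ⌈x⌉₊, ‖xiZero c' D j n d r‖ / n ≤ C₃ * ell D * (1 + Real.log x) ^ 3)
    {j : ℕ} (hj : j ∈ ({1, 2, 3} : Finset ℕ)) :
    ‖S1422On c' χ j (bigP D ^ (0.496 : ℝ)) (bigP D ^ (0.498 : ℝ)) - midSum1422 c' χ j‖ ≤
      Real.exp 256 *
          ((28000 * Real.exp (9 / 2) + max C₁ 0 + 2000 * Real.exp (9 / 2) * (4 * π) * 520) * 9 * max C₂ 0 +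
            (max C₁ 0 + 2000 * Real.exp (9 / 2) * (4 * π) * 520) * (4 * Real.exp (9 / 2)) * 146 * 9 +
            537 * (max C₁ 0 + 28000 * Real.exp (9 / 2)) * 9 * (584 * Real.exp (9 / 2) + max C₂ 0 + 8 * max C₃ 0) +
            537 * (28000 * Real.exp (9 / 2)) * (4 * Real.exp (9 / 2)) * 146 * 9 +
            28000 * Real.exp (9 / 2) * (4 * Real.exp (9 / 2)) * 100000) *
        (ell D ^ (1.1 : ℝ)) ^ 5 * (ell D ^ 15)⁻¹ := by
  classical
  have hℓ : 3 ≤ ell D := by linarith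
  have hℓ1 : 1 ≤ ell D := by linarith
  have hℓ0 : 0 < ell D := by linarith
  obtain ⟨-, -, hb5, h5504, -, -, hN⟩ := range_facts (D := D) hℓ
  have h101' := body101_mono c' χ (le_max_left C₁ 0) h101
  have h84' := body84_mono c' χ (le_max_left C₂ 0) h84
  have h3' := body3_mono c' (le_max_left C₃ 0) h3
  have hA := mid_assembly_le c' χ hℓ4 hq hp hc5 (le_max_right C₁ 0) (le_max_right C₂ 0)
    (le_max_right C₃ 0) hTc h101' h84' h3' hj
  have hB := mid_Gswap_le c' χ hℓ hp hc5 j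
  have hC := mid_mainterm_eq c' χ hℓ j
  rw [hC] at hB
  rw [log_bigT_eq] at hA
  rw [S1422On_eq_divisor_sum c' χ hℓ j (fun n hn => hN n (hn.trans_le (hb5.trans h5504)))]
  refine (norm_sub_le_norm_sub_add_norm_sub _ _ _).trans ((add_le_add hA hB).trans ?_)
  -- weights
  have hτ := ell_le_rpow (D := D) hℓ1
  have h9 : 3 + 0.002 * ell D ^ 9 ≤ ell D ^ 9 := by
    have : (3 : ℝ) ^ 9 ≤ ell D ^ 9 := pow_le_pow_left₀ (by norm_num) hℓ 9
    nlinarith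
  have hWa := (mid_weights_all_le c' χ hℓ j).trans
    (mul_le_mul_of_nonneg_left h9 (Real.exp_pos _).le)
  have hWw : _ ≤ 537 * Real.exp 256 * ell D ^ (1.1 : ℝ) :=
    (mid_weights_window_le c' χ hℓ j).trans (by nlinarith [Real.exp_pos 256])
  have hWm : (∑ n ∈ ((Finset.Ico 1 (Nsupp D)).filter
        (fun n : ℕ => bigP D ^ (0.496 : ℝ) ≤ (n : ℝ) ∧ (n : ℝ) < bigP D ^ (0.498 : ℝ))).filter
          (fun n : ℕ => bigP D ^ (0.496 : ℝ) * ((D : ℝ) * t0 D) < (n : ℝ) ∧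
            (n : ℝ) < bigP D ^ (0.498 : ℝ) / bigT D),
        ‖(‖χ (n : ZMod D)‖ : ℂ) * lamZero c' D j n / (n : ℂ)‖ * ((n : ℝ) / Nat.totient n) ^ 3) ≤
      Real.exp 256 * ell D ^ 9 :=
    (Finset.sum_le_sum_of_subset_of_nonneg (Finset.filter_subset _ _)
      (fun n _ _ => by positivity)).trans hWa
  exact mid_numeric_bound (τ := ell D ^ (1.1 : ℝ)) (L := ‖deriv χ.LFunction 1‖)
    (R := ‖iota3‖ / Real.log (Skeleton.P3 D) + ‖iota4‖ / Real.log (Skeleton.P2 D))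
    hℓ hτ hWm hWw hWa (iotaR_nonneg hℓ) (iotaR_le hℓ) (norm_nonneg _)
    (norm_deriv_L_one_le χ hℓ hp) (le_max_right _ _) (le_max_right _ _) (le_max_right _ _)

end MidFinal


/-! ## Part F′. Assembly for the top range `P^{0.498} ≤ dr < P^{0.5}` (Z22:§10.u050 (i)) -/

section TopRange

variable (c' : ℝ) {D : ℕ} (χ : DirichletCharacter ℂ D)

omit χ in
/-- The filtered index set of the top range is `[⌈P^{0.498}⌉, ⌈P^{0.5}⌉)`.
[cite: Zhang2022LandauSiegel, §10 pp. 59–60] -/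
theorem topSet_eq (hℓ : 3 ≤ ell D) :
    (Finset.Ico 1 (Nsupp D)).filter
        (fun n : ℕ => bigP D ^ (0.498 : ℝ) ≤ (n : ℝ) ∧ (n : ℝ) < bigP D ^ (0.5 : ℝ)) =
      Finset.Ico ⌈bigP D ^ (0.498 : ℝ)⌉₊ ⌈bigP D ^ (0.5 : ℝ)⌉₊ := by
  obtain ⟨h2, hab, hb5, h5504, h4, -, hN⟩ := range_facts hℓ
  ext n
  simp only [Finset.mem_filter, Finset.mem_Ico]
  constructor
  · rintro ⟨⟨-, -⟩, ha, hb⟩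
    exact ⟨Nat.ceil_le.mpr ha, Nat.lt_ceil.mpr hb⟩
  · rintro ⟨ha, hb⟩
    have ha' : bigP D ^ (0.498 : ℝ) ≤ n := Nat.ceil_le.mp ha
    have hb' : (n : ℝ) < bigP D ^ (0.5 : ℝ) := Nat.lt_ceil.mp hb
    refine ⟨⟨?_, hN n (hb'.trans_le h5504)⟩, ha', hb'⟩
    have : (1 : ℝ) ≤ n := by linarith
    exact_mod_cast this

variable [NeZero D]

/-- **Top range, step D (exact): the collapsed main term IS the printed `n`-sum `topSum1422`.**
[cite: Zhang2022LandauSiegel, §10 p. 60] -/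
theorem top_mainterm_eq (hℓ : 3 ≤ ell D) (j : ℕ) :
    ∑ n ∈ (Finset.Ico 1 (Nsupp D)).filter
        (fun n : ℕ => bigP D ^ (0.498 : ℝ) ≤ (n : ℝ) ∧ (n : ℝ) < bigP D ^ (0.5 : ℝ)),
      (‖χ (n : ZMod D)‖ : ℂ) * lamZero c' D j n / (n : ℂ) * ((n : ℂ) / (Nat.totient n : ℂ)) *
        ((500 * deriv χ.LFunction 1 / (Real.log (bigP D) : ℂ) *
            (1 - betaJ c' D j * (Real.log (bigP D ^ (0.5 : ℝ) / n) : ℂ))) *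
          deriv χ.LFunction 1 *
          (iota4 / 0.5 * frakgW c' D j 7 (bigP D ^ (0.5 : ℝ) / n) / (Real.log (bigP D) : ℂ))) =
      topSum1422 c' χ j := by
  rw [topSet_eq hℓ]
  unfold topSum1422 lamAvg
  rw [Finset.mul_sum]
  refine Finset.sum_congr rfl fun n hn => ?_
  obtain ⟨h2, hab, -⟩ := range_facts (D := D) hℓ
  have hn1 : 1 ≤ n := by
    have := (Finset.mem_Ico.mp hn).1
    have : (2 : ℝ) ≤ ⌈bigP D ^ (0.498 : ℝ)⌉₊ := (h2.trans hab).trans (Nat.le_ceil _)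
    have : 2 ≤ ⌈bigP D ^ (0.498 : ℝ)⌉₊ := by exact_mod_cast this
    omega
  have hn0 : (n : ℂ) ≠ 0 := by exact_mod_cast (by omega : n ≠ 0)
  field_simp

/-- `‖M₀(n)‖ ≤ 28000e^{9/2}𝓛⁻⁷` on the top range (`log(P^{0.5}/n) ∈ [0, 𝓛⁹]`).
[cite: Zhang2022LandauSiegel, §10 p. 60] -/
theorem norm_M0top_le (hℓ : 3 ≤ ell D) (hp : χ.IsPrimitive) (hc5 : 5 * |c'| * alpha D * ell D ≤ 1)
    (j : ℕ) {n : ℕ} (hlo : bigP D ^ (0.498 : ℝ) ≤ n) (hhi : (n : ℝ) < bigP D ^ (0.5 : ℝ)) :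
    ‖(500 * deriv χ.LFunction 1 / (Real.log (bigP D) : ℂ) *
            (1 - betaJ c' D j * (Real.log (bigP D ^ (0.5 : ℝ) / n) : ℂ)))‖ ≤
      28000 * Real.exp (9 / 2) * (ell D ^ 7)⁻¹ := by
  have hℓ0 : 0 < ell D := by linarith
  obtain ⟨h2, hab, -, -, -, h5P, -⟩ := range_facts (D := D) hℓ
  have hn0 : (0 : ℝ) < n := by linarith
  have hx1 : 1 ≤ bigP D ^ (0.5 : ℝ) / n := by rw [le_div_iff₀ hn0]; linarith
  have hxP : bigP D ^ (0.5 : ℝ) / n ≤ bigP D := by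
    refine (div_le_self (bigP_rpow_pos D _).le ?_).trans h5P
    linarith
  obtain ⟨hl0, hl⟩ := log_le_of_le_bigP hx1 hxP
  have hw := norm_one_sub_betaJ_mul_le c' hℓ hc5 j 1 (by simp) (abs_le.mpr ⟨by linarith, hl⟩)
  calc _ ≤ 2000 * Real.exp (9 / 2) * (ell D ^ 7)⁻¹ * ‖(1 : ℂ) - betaJ c' D j *
        (Real.log (bigP D ^ (0.5 : ℝ) / n) : ℂ)‖ := norm_main101_le χ hℓ hp _
    _ ≤ 2000 * Real.exp (9 / 2) * (ell D ^ 7)⁻¹ * 14 := by gcongr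
    _ = 28000 * Real.exp (9 / 2) * (ell D ^ 7)⁻¹ := by ring

omit [NeZero D] in
/-- `‖ι₄(log P₂)⁻¹𝔤_{j7}(P₂/m)‖ ≤ 146(|ι₃|/log P₃ + |ι₄|/log P₂)` for `1 ≤ m ≤ P`.
[cite: Zhang2022LandauSiegel, §8 (8.11) p. 48] -/
theorem norm_Gtop_le (hℓ : 3 ≤ ell D) (hc5 : 5 * |c'| * alpha D * ell D ≤ 1) (j : ℕ) {m : ℝ}
    (hm1 : 1 ≤ m) (hmP : m ≤ bigP D) :
    ‖iota4 * (Real.log (Skeleton.P2 D) : ℂ)⁻¹ * frakgW c' D j 7 (Skeleton.P2 D / m)‖ ≤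
      146 * (‖iota3‖ / Real.log (Skeleton.P3 D) + ‖iota4‖ / Real.log (Skeleton.P2 D)) := by
  have hℓ0 : 0 < ell D := by linarith
  have hP3 : 0 < Real.log (Skeleton.P3 D) := by rw [log_P3_eq]; positivity
  have hP2 : 0 < Real.log (Skeleton.P2 D) := log_P2_pos hℓ
  have g7 := norm_frakgW_div_le c' hℓ hc5 j 7 (one_lt_P2 hℓ).le (P2_lt_bigP hℓ).le hm1 hmP
  rw [norm_mul, norm_mul, norm_inv, Complex.norm_real, Real.norm_eq_abs, abs_of_pos hP2]
  have hR3 : 0 ≤ ‖iota3‖ / Real.log (Skeleton.P3 D) := by positivity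
  calc ‖iota4‖ * (Real.log (Skeleton.P2 D))⁻¹ * ‖frakgW c' D j 7 (Skeleton.P2 D / m)‖
      ≤ ‖iota4‖ * (Real.log (Skeleton.P2 D))⁻¹ * 146 := by gcongr
    _ = 146 * (‖iota4‖ / Real.log (Skeleton.P2 D)) := by ring
    _ ≤ 146 * (‖iota3‖ / Real.log (Skeleton.P3 D) + ‖iota4‖ / Real.log (Skeleton.P2 D)) := by gcongr; linarith

/-- **Top range, step C**: replacing `G` by the printed profile costs
`≤ W·28000e^{9/2}𝓛⁻⁷·|L′(1,χ)|·10⁵𝓛^{1.1}𝓛⁻¹⁸`. [cite: Zhang2022LandauSiegel, §10 p. 60] -/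
theorem top_Gswap_le (hℓ : 3 ≤ ell D) (hp : χ.IsPrimitive) (hc5 : 5 * |c'| * alpha D * ell D ≤ 1)
    (j : ℕ) :
    ‖(∑ n ∈ (Finset.Ico 1 (Nsupp D)).filter
        (fun n : ℕ => bigP D ^ (0.498 : ℝ) ≤ (n : ℝ) ∧ (n : ℝ) < bigP D ^ (0.5 : ℝ)),
      (‖χ (n : ZMod D)‖ : ℂ) * lamZero c' D j n / (n : ℂ) * ((n : ℂ) / (Nat.totient n : ℂ)) *
        ((500 * deriv χ.LFunction 1 / (Real.log (bigP D) : ℂ) *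
            (1 - betaJ c' D j * (Real.log (bigP D ^ (0.5 : ℝ) / n) : ℂ))) *
          deriv χ.LFunction 1 *
          (iota4 * (Real.log (Skeleton.P2 D) : ℂ)⁻¹ * frakgW c' D j 7 (Skeleton.P2 D / n)))) -
      ∑ n ∈ (Finset.Ico 1 (Nsupp D)).filter
        (fun n : ℕ => bigP D ^ (0.498 : ℝ) ≤ (n : ℝ) ∧ (n : ℝ) < bigP D ^ (0.5 : ℝ)),
      (‖χ (n : ZMod D)‖ : ℂ) * lamZero c' D j n / (n : ℂ) * ((n : ℂ) / (Nat.totient n : ℂ)) *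
        ((500 * deriv χ.LFunction 1 / (Real.log (bigP D) : ℂ) *
            (1 - betaJ c' D j * (Real.log (bigP D ^ (0.5 : ℝ) / n) : ℂ))) *
          deriv χ.LFunction 1 *
          (iota4 / 0.5 * frakgW c' D j 7 (bigP D ^ (0.5 : ℝ) / n) / (Real.log (bigP D) : ℂ)))‖ ≤
      (∑ n ∈ (Finset.Ico 1 (Nsupp D)).filter
        (fun n : ℕ => bigP D ^ (0.498 : ℝ) ≤ (n : ℝ) ∧ (n : ℝ) < bigP D ^ (0.5 : ℝ)),
          ‖(‖χ (n : ZMod D)‖ : ℂ) * lamZero c' D j n / (n : ℂ)‖ * ((n : ℝ) / Nat.totient n) ^ 3) *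
        (28000 * Real.exp (9 / 2) * (ell D ^ 7)⁻¹ * ‖deriv χ.LFunction 1‖ *
          (100000 * ell D ^ (1.1 : ℝ) * (ell D ^ 18)⁻¹)) := by
  have hℓ0 : 0 < ell D := by linarith
  obtain ⟨h2, hab, hb5, -, -, h5P, -⟩ := range_facts hℓ
  rw [← Finset.sum_sub_distrib, Finset.sum_mul]
  refine (norm_sum_le _ _).trans (Finset.sum_le_sum fun n hn => ?_)
  obtain ⟨hn', hlo, hhi⟩ := Finset.mem_filter.mp hn
  have hn1 : 1 ≤ n := (Finset.mem_Ico.mp hn').1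
  have hn0 : n ≠ 0 := by omega
  have hn1r : (1 : ℝ) ≤ n := by exact_mod_cast hn1
  set A := (‖χ (n : ZMod D)‖ : ℂ) * lamZero c' D j n / (n : ℂ)
  set M0 := (500 * deriv χ.LFunction 1 / (Real.log (bigP D) : ℂ) *
            (1 - betaJ c' D j * (Real.log (bigP D ^ (0.5 : ℝ) / n) : ℂ)))
  set L1 := deriv χ.LFunction 1
  set G := (iota4 * (Real.log (Skeleton.P2 D) : ℂ)⁻¹ * frakgW c' D j 7 (Skeleton.P2 D / n))
  set Gp := (iota4 / 0.5 * frakgW c' D j 7 (bigP D ^ (0.5 : ℝ) / n) / (Real.log (bigP D) : ℂ))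
  have e : A * ((n : ℂ) / (Nat.totient n : ℂ)) * (M0 * L1 * G) -
      A * ((n : ℂ) / (Nat.totient n : ℂ)) * (M0 * L1 * Gp) =
      A * ((n : ℂ) / (Nat.totient n : ℂ)) * (M0 * L1 * (G - Gp)) := by ring
  rw [e]
  have hnφ : ‖((n : ℂ) / (Nat.totient n : ℂ))‖ = (n : ℝ) / Nat.totient n := by
    rw [norm_div, Complex.norm_natCast, Complex.norm_natCast]
  have hM0 := norm_M0top_le c' χ hℓ hp hc5 j hlo hhi
  have hG := norm_G7_sub_le c' hℓ hc5 j hn1r hhi.le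
  have hr1 := one_le_self_div_totient hn0
  have hr3 : (n : ℝ) / Nat.totient n ≤ ((n : ℝ) / Nat.totient n) ^ 3 := by
    calc (n : ℝ) / Nat.totient n = ((n : ℝ) / Nat.totient n) ^ 1 := (pow_one _).symm
      _ ≤ ((n : ℝ) / Nat.totient n) ^ 3 := pow_le_pow_right₀ hr1 (by norm_num)
  rw [norm_mul, norm_mul, norm_mul, norm_mul, hnφ]
  have h0 : 0 ≤ 28000 * Real.exp (9 / 2) * (ell D ^ 7)⁻¹ := by positivity
  calc ‖A‖ * ((n : ℝ) / Nat.totient n) * (‖M0‖ * ‖L1‖ * ‖G - Gp‖)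
      ≤ ‖A‖ * ((n : ℝ) / Nat.totient n) ^ 3 * (28000 * Real.exp (9 / 2) * (ell D ^ 7)⁻¹ * ‖L1‖ *
          (100000 * ell D ^ (1.1 : ℝ) * (ell D ^ 18)⁻¹)) := by
        gcongr

end TopRange

section TopAssembly

variable (c' : ℝ) {D : ℕ} [NeZero D] (χ : DirichletCharacter ℂ D)

/-- **Top range, step B (the range assembly).** With Lemma 10.1 (body `h101`), the relative
Lemma 8.4 (body `h84`) and the absolute logarithmic mean of `ξ₀ⱼ` (body `h3`) at this modulus: the
re-indexed range sum minus the collapsed main term is bounded by the weighted main-range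
(`P^{0.498}Dt₀ < n < P^{0.5}T⁻¹¹`) and window contributions. [cite: Zhang2022LandauSiegel, §10 p. 60] -/
theorem top_assembly_le (hℓ : 3 ≤ ell D) (hq : χ.IsQuadratic) (hp : χ.IsPrimitive)
    (hc5 : 5 * |c'| * alpha D * ell D ≤ 1) {c C₁ C₂ C₃ : ℝ} (hC₁ : 0 ≤ C₁) (hC₂ : 0 ≤ C₂)
    (hC₃ : 0 ≤ C₃) (hTc : bigT D ^ (-c) ≤ (ell D ^ 7)⁻¹)
    (h101 : ∀ j ∈ ({1, 2, 3} : Finset ℕ), ∀ y : ℝ,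
      (1 ≤ y → y ≤ bigP D ^ (0.5 : ℝ) / bigT D → ‖frakv1 c' χ j y‖ ≤ C₁ * bigT D ^ (-c)) ∧
      (bigP D ^ (0.5 : ℝ) < y → y ≤ bigP D ^ (0.502 : ℝ) / bigT D →
        ‖frakv1 c' χ j y - 500 * deriv χ.LFunction 1 / Real.log (bigP D) *
          (-1 - betaJ c' D j * (Real.log (y / bigP D ^ (0.5 : ℝ)) : ℂ))‖ ≤ C₁ * (ell D ^ 15)⁻¹) ∧
      (bigP D ^ (0.502 : ℝ) < y → y ≤ bigP D ^ (0.504 : ℝ) / bigT D →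
        ‖frakv1 c' χ j y - 500 * deriv χ.LFunction 1 / Real.log (bigP D) *
          (1 - betaJ c' D j * (Real.log (bigP D ^ (0.504 : ℝ) / y) : ℂ))‖ ≤ C₁ * (ell D ^ 15)⁻¹) ∧
      ((bigP D ^ (0.5 : ℝ) / bigT D < y ∧ y ≤ bigP D ^ (0.5 : ℝ)) ∨
          (bigP D ^ (0.502 : ℝ) / bigT D < y ∧ y ≤ bigP D ^ (0.502 : ℝ)) ∨
          (bigP D ^ (0.504 : ℝ) / bigT D < y ∧ y < bigP D ^ (0.504 : ℝ)) →
        ‖frakv1 c' χ j y‖ ≤ C₁ * (ell D ^ 7)⁻¹))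
    (h84 : ∀ j ∈ ({1, 2, 3} : Finset ℕ), ∀ μ ∈ ({6, 7} : Finset ℕ), ∀ d r : ℕ, 1 ≤ d → 1 ≤ r →
      ((d * r : ℕ) : ℝ) < bigP D / bigT D ^ 2 → ∀ y : ℝ, bigT D < y → y < bigP D →
        ‖(∑ n ∈ Finset.Ico 1 ⌈y⌉₊, χ (n : ZMod D) * xiZero c' D j n d r / (n : ℂ) *
              ((y / n : ℝ) : ℂ) ^ (-betaMu D μ) * (Real.log (y / n) : ℂ)) -
            deriv χ.LFunction 1 * PiW χ d r * frakgW c' D j μ y‖ ≤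
          C₂ * (ell D ^ 6)⁻¹ * (∏ q ∈ (d * r).primeFactors, (1 - (q : ℝ)⁻¹)⁻¹) ^ 2)
    (h3 : ∀ j ∈ ({1, 2, 3} : Finset ℕ), ∀ d r : ℕ, 1 ≤ d → 1 ≤ r →
      ((d * r : ℕ) : ℝ) < Skeleton.P1 D → ∀ x : ℝ, 1 ≤ x → x ≤ bigT D →
        ∑ n ∈ Finset.Ico 1 ⌈x⌉₊, ‖xiZero c' D j n d r‖ / n ≤ C₃ * ell D * (1 + Real.log x) ^ 3)
    {j : ℕ} (hj : j ∈ ({1, 2, 3} : Finset ℕ)) :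
    ‖(∑ n ∈ (Finset.Ico 1 (Nsupp D)).filter
        (fun n : ℕ => bigP D ^ (0.498 : ℝ) ≤ (n : ℝ) ∧ (n : ℝ) < bigP D ^ (0.5 : ℝ)),
        ∑ r ∈ n.divisors,
          (if Squarefree r then
            (‖χ (n : ZMod D)‖ : ℂ) * lamZero c' D j n / (n : ℂ) / (Nat.totient r : ℂ) *
              frakv1 c' χ j (yShift D (n : ℝ)) * nSum22 c' χ j (n / r) r else 0)) -
      ∑ n ∈ (Finset.Ico 1 (Nsupp D)).filter
        (fun n : ℕ => bigP D ^ (0.498 : ℝ) ≤ (n : ℝ) ∧ (n : ℝ) < bigP D ^ (0.5 : ℝ)),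
        (‖χ (n : ZMod D)‖ : ℂ) * lamZero c' D j n / (n : ℂ) * ((n : ℂ) / (Nat.totient n : ℂ)) *
          ((500 * deriv χ.LFunction 1 / (Real.log (bigP D) : ℂ) *
            (1 - betaJ c' D j * (Real.log (bigP D ^ (0.5 : ℝ) / n) : ℂ))) *
            deriv χ.LFunction 1 *
            (iota4 * (Real.log (Skeleton.P2 D) : ℂ)⁻¹ * frakgW c' D j 7 (Skeleton.P2 D / n)))‖ ≤
      (∑ n ∈ ((Finset.Ico 1 (Nsupp D)).filter
        (fun n : ℕ => bigP D ^ (0.498 : ℝ) ≤ (n : ℝ) ∧ (n : ℝ) < bigP D ^ (0.5 : ℝ))).filter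
            (fun n : ℕ => bigP D ^ (0.498 : ℝ) * ((D : ℝ) * t0 D) < (n : ℝ) ∧
              (n : ℝ) < bigP D ^ (0.5 : ℝ) / bigT D ^ 11),
          ‖(‖χ (n : ZMod D)‖ : ℂ) * lamZero c' D j n / (n : ℂ)‖ * ((n : ℝ) / Nat.totient n) ^ 3) *
          ((28000 * Real.exp (9 / 2) * (ell D ^ 7)⁻¹ +
                (C₁ + 2000 * Real.exp (9 / 2) * (4 * π) * 520) * (ell D ^ 15)⁻¹) *
              ((‖iota3‖ / Real.log (Skeleton.P3 D) + ‖iota4‖ / Real.log (Skeleton.P2 D)) *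
                (C₂ * (ell D ^ 6)⁻¹)) +
            (C₁ + 2000 * Real.exp (9 / 2) * (4 * π) * 520) * (ell D ^ 15)⁻¹ *
              ‖deriv χ.LFunction 1‖ *
              (146 * (‖iota3‖ / Real.log (Skeleton.P3 D) + ‖iota4‖ / Real.log (Skeleton.P2 D)))) +
        (∑ n ∈ ((Finset.Ico 1 (Nsupp D)).filter
        (fun n : ℕ => bigP D ^ (0.498 : ℝ) ≤ (n : ℝ) ∧ (n : ℝ) < bigP D ^ (0.5 : ℝ))).filter
            (fun n : ℕ => ¬ (bigP D ^ (0.498 : ℝ) * ((D : ℝ) * t0 D) < (n : ℝ) ∧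
              (n : ℝ) < bigP D ^ (0.5 : ℝ) / bigT D ^ 11)),
          ‖(‖χ (n : ZMod D)‖ : ℂ) * lamZero c' D j n / (n : ℂ)‖ * ((n : ℝ) / Nat.totient n) ^ 3) *
          ((C₁ + 28000 * Real.exp (9 / 2)) * (ell D ^ 7)⁻¹ *
              ((‖iota3‖ / Real.log (Skeleton.P3 D) + ‖iota4‖ / Real.log (Skeleton.P2 D)) *
                (584 * Real.exp (9 / 2) * ell D ^ 2 + C₂ * (ell D ^ 6)⁻¹ +
                  C₃ * ell D * (1 + Real.log (bigT D)) ^ 3 * Real.log (bigT D))) +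
            28000 * Real.exp (9 / 2) * (ell D ^ 7)⁻¹ * ‖deriv χ.LFunction 1‖ *
              (146 * (‖iota3‖ / Real.log (Skeleton.P3 D) + ‖iota4‖ / Real.log (Skeleton.P2 D)))) := by
  classical
  have hℓ0 : 0 < ell D := by linarith
  obtain ⟨h2, hab, hb5, h5504, h504, h5P, hN⟩ := range_facts (D := D) hℓ
  have hP := bigP_pos D
  have hT := bigT_pos D
  have hT1 := one_le_bigT D
  have hDt1 := Dt0_ge_one hℓ
  have hP3def : Skeleton.P3 D = bigP D ^ (0.498 : ℝ) := rfl
  set S := (Finset.Ico 1 (Nsupp D)).filter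
        (fun n : ℕ => bigP D ^ (0.498 : ℝ) ≤ (n : ℝ) ∧ (n : ℝ) < bigP D ^ (0.5 : ℝ)) with hSdef
  have memS : ∀ n ∈ S, 1 ≤ n ∧ bigP D ^ (0.498 : ℝ) ≤ (n : ℝ) ∧ (n : ℝ) < bigP D ^ (0.5 : ℝ) := by
    intro n hn
    rw [hSdef, Finset.mem_filter, Finset.mem_Ico] at hn
    exact ⟨hn.1.1, hn.2.1, hn.2.2⟩
  have hS0 : ∀ n ∈ S, n ≠ 0 := fun n hn => by have := (memS n hn).1; omega
  have hR0 : 0 ≤ (‖iota3‖ / Real.log (Skeleton.P3 D) + ‖iota4‖ / Real.log (Skeleton.P2 D)) := by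
    have := log_P2_pos hℓ
    have : 0 < Real.log (Skeleton.P3 D) := by rw [log_P3_eq]; positivity
    positivity
  refine range_assembly_bound₃ hS0
    (fun n : ℕ => bigP D ^ (0.498 : ℝ) * ((D : ℝ) * t0 D) < (n : ℝ) ∧
              (n : ℝ) < bigP D ^ (0.5 : ℝ) / bigT D ^ 11)
    (fun n => (‖χ (n : ZMod D)‖ : ℂ) * lamZero c' D j n / (n : ℂ))
    (fun n => frakv1 c' χ j (yShift D (n : ℝ)))
    (fun n => 500 * deriv χ.LFunction 1 / (Real.log (bigP D) : ℂ) *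
      (1 - betaJ c' D j * (Real.log (bigP D ^ (0.5 : ℝ) / n) : ℂ)))
    (fun n => iota4 * (Real.log (Skeleton.P2 D) : ℂ)⁻¹ * frakgW c' D j 7 (Skeleton.P2 D / n))
    (fun d r => nSum22 c' χ j d r) (fun d r => PiW χ d r) (deriv χ.LFunction 1)
    (by positivity) (by positivity) (by positivity) ?_ ?_ ?_ ?_ ?_ ?_ ?_
  · -- hPi: (8.10)
    intro n hn _
    exact Section8FrontEnd810.eq810_holds D χ hq n (hS0 n hn)
  · -- hM: Lemma 10.1 in the main range
    intro n hn hmain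
    exact norm_frakv1_yShift_sub_top c' χ hℓ hp hc5 h101 hj hmain.1 hmain.2
  · -- hM₀
    intro n hn
    obtain ⟨-, hlo, hhi⟩ := memS n hn
    exact norm_M0top_le c' χ hℓ hp hc5 j hlo hhi
  · -- hMW: crude Lemma 10.1
    intro n hn _
    obtain ⟨-, hlo, hhi⟩ := memS n hn
    exact norm_frakv1_yShift_le c' χ hℓ hp hc5 hC₁ hTc h101 hj (hab.trans hlo) hhi
  · -- hG
    intro n hn
    obtain ⟨hn1, -, hhi⟩ := memS n hn
    exact norm_Gtop_le c' hℓ hc5 j (by exact_mod_cast hn1) (by linarith)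
  · -- hN: the relative Lemma 8.4 (μ = 7) in range; the `ϰ₃` part vanishes
    intro n hn hmain r hr hsq
    obtain ⟨hn1, hlo, hhi⟩ := memS n hn
    have hrd : r ∣ n := Nat.dvd_of_mem_divisors hr
    have hr0 : r ≠ 0 := Nat.pos_iff_ne_zero.mp (Nat.pos_of_mem_divisors hr)
    have hr1 : 1 ≤ r := Nat.one_le_iff_ne_zero.mpr hr0
    have hdr : n / r * r = n := Nat.div_mul_cancel hrd
    have hd1 : 1 ≤ n / r := Nat.div_pos (Nat.le_of_dvd (by omega) hrd) (by omega)
    have hcast : ((n / r * r : ℕ) : ℝ) = n := by rw [hdr]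
    have hdrP : ((n / r * r : ℕ) : ℝ) < bigP D / bigT D ^ 2 := by rw [hcast]; linarith
    have hn0r : (0 : ℝ) < n := by exact_mod_cast (by omega : 0 < n)
    have htop : Skeleton.P3 D ≤ ((n / r * r : ℕ) : ℝ) := by rw [hcast, hP3def]; exact hlo
    have hy7T : bigT D < Skeleton.P2 D / ((n / r * r : ℕ) : ℝ) := by
      rw [hcast, Skeleton.P2, lt_div_iff₀ hn0r]
      have h1 : (n : ℝ) < bigP D ^ (0.5 : ℝ) / bigT D ^ 11 := hmain.2
      rw [lt_div_iff₀ (pow_pos hT 11)] at h1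
      rw [lt_div_iff₀ (pow_pos hT 10)]
      calc bigT D * n * bigT D ^ 10 = n * bigT D ^ 11 := by ring
        _ < bigP D ^ (0.5 : ℝ) := h1
    have hy7P : Skeleton.P2 D / ((n / r * r : ℕ) : ℝ) < bigP D := by
      rw [hcast]
      exact lt_of_le_of_lt (div_le_self (P2_pos D).le (by exact_mod_cast hn1)) (P2_lt_bigP hℓ)
    have i7 := h84 j hj 7 (by simp) (n / r) r hd1 hr1 hdrP _ hy7T hy7P
    have key := norm_nSum22_sub_main_top_le c' χ hℓ j hd1 hr1 htop hC₂ i7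
    rw [hdr] at key
    exact key.trans (le_of_eq (by ring))
  · -- hW: window bound
    intro n hn _ r hr hsq
    obtain ⟨hn1, hlo, hhi⟩ := memS n hn
    have hrd : r ∣ n := Nat.dvd_of_mem_divisors hr
    have hr0 : r ≠ 0 := Nat.pos_iff_ne_zero.mp (Nat.pos_of_mem_divisors hr)
    have hr1 : 1 ≤ r := Nat.one_le_iff_ne_zero.mpr hr0
    have hdr : n / r * r = n := Nat.div_mul_cancel hrd
    have hd1 : 1 ≤ n / r := Nat.div_pos (Nat.le_of_dvd (by omega) hrd) (by omega)
    have hcast : ((n / r * r : ℕ) : ℝ) = n := by rw [hdr]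
    have hdrP2 : ((n / r * r : ℕ) : ℝ) < bigP D / bigT D ^ 2 := by rw [hcast]; linarith
    have hdrP : ((n / r * r : ℕ) : ℝ) ≤ bigP D := by rw [hcast]; linarith
    have hdrP1 : ((n / r * r : ℕ) : ℝ) < Skeleton.P1 D := by rw [hcast, Skeleton.P1]; linarith
    have hy6P : Skeleton.P3 D / ((n / r * r : ℕ) : ℝ) < bigP D := by
      rw [hcast]
      exact lt_of_le_of_lt (div_le_self (by rw [hP3def]; exact (bigP_rpow_pos D _).le)
        (by exact_mod_cast hn1)) (P3_lt_bigP hℓ)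
    have hy7P : Skeleton.P2 D / ((n / r * r : ℕ) : ℝ) < bigP D := by
      rw [hcast]
      exact lt_of_le_of_lt (div_le_self (P2_pos D).le (by exact_mod_cast hn1)) (P2_lt_bigP hℓ)
    have key := norm_nSum22_window_le c' χ hℓ hp hc5 hC₂ hC₃ j hd1 hr1 hdrP
      (fun hT6 => h84 j hj 6 (by simp) (n / r) r hd1 hr1 hdrP2 _ hT6 hy6P)
      (fun hT7 => h84 j hj 7 (by simp) (n / r) r hd1 hr1 hdrP2 _ hT7 hy7P)
      (fun x hx1 hxT => h3 j hj (n / r) r hd1 hr1 hdrP1 x hx1 hxT)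
    rw [hdr] at key
    exact key.trans (le_of_eq (by ring))

end TopAssembly

section TopWeights

variable (c' : ℝ) {D : ℕ} (χ : DirichletCharacter ℂ D)

/-- **Weights of the whole top range**: `Σ_{n∈S} ‖a(n)‖(n/φ(n))³ ≤ e^{256}(3 + 0.002𝓛⁹)`.
[cite: Zhang2022LandauSiegel, §10 pp. 59–60] -/
theorem top_weights_all_le (hℓ : 3 ≤ ell D) (j : ℕ) :
    ∑ n ∈ (Finset.Ico 1 (Nsupp D)).filter
        (fun n : ℕ => bigP D ^ (0.498 : ℝ) ≤ (n : ℝ) ∧ (n : ℝ) < bigP D ^ (0.5 : ℝ)),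
      ‖(‖χ (n : ZMod D)‖ : ℂ) * lamZero c' D j n / (n : ℂ)‖ * ((n : ℝ) / Nat.totient n) ^ 3 ≤
      Real.exp 256 * (3 + 0.002 * ell D ^ 9) := by
  obtain ⟨h2, hab, hb5, -, -, -, -⟩ := range_facts (D := D) hℓ
  have h := sum_weights_le c' χ j (h2.trans hab) hb5 (S' := (Finset.Ico 1 (Nsupp D)).filter
        (fun n : ℕ => bigP D ^ (0.498 : ℝ) ≤ (n : ℝ) ∧ (n : ℝ) < bigP D ^ (0.5 : ℝ)))
    (fun n hn => by
      obtain ⟨-, hlo, hhi⟩ := Finset.mem_filter.mp hn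
      exact ⟨hlo, hhi.le⟩)
  rw [log_bigP_rpow, log_bigP_rpow] at h
  refine h.trans (le_of_eq ?_)
  ring

/-- **Window weights of the top range** (`n ≤ P^{0.498}Dt₀` or `n ≥ P^{0.5}T⁻¹¹`):
`≤ e^{256}(6 + 520𝓛 + 11𝓛^{1.1})`. [cite: Zhang2022LandauSiegel, §10 pp. 59–60] -/
theorem top_weights_window_le (hℓ : 3 ≤ ell D) (j : ℕ) :
    ∑ n ∈ ((Finset.Ico 1 (Nsupp D)).filter
        (fun n : ℕ => bigP D ^ (0.498 : ℝ) ≤ (n : ℝ) ∧ (n : ℝ) < bigP D ^ (0.5 : ℝ))).filter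
          (fun n : ℕ => ¬ (bigP D ^ (0.498 : ℝ) * ((D : ℝ) * t0 D) < (n : ℝ) ∧
            (n : ℝ) < bigP D ^ (0.5 : ℝ) / bigT D ^ 11)),
      ‖(‖χ (n : ZMod D)‖ : ℂ) * lamZero c' D j n / (n : ℂ)‖ * ((n : ℝ) / Nat.totient n) ^ 3 ≤
      Real.exp 256 * (6 + 520 * ell D + 11 * ell D ^ (1.1 : ℝ)) := by
  classical
  have hℓ0 : 0 < ell D := by linarith
  have hℓ1 : 1 ≤ ell D := by linarith
  obtain ⟨h2, hab, hb5, -, -, -, -⟩ := range_facts (D := D) hℓ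
  have h2' : 2 ≤ bigP D ^ (0.498 : ℝ) := h2.trans hab
  have hDt1 := Dt0_ge_one hℓ
  have hDt := Dt0_pos hℓ
  have hT := bigT_pos D
  have hT1 := one_le_bigT D
  have hT11 : 0 < bigT D ^ 11 := pow_pos hT 11
  have hT11' : 1 ≤ bigT D ^ 11 := one_le_pow₀ hT1
  set S := (Finset.Ico 1 (Nsupp D)).filter
        (fun n : ℕ => bigP D ^ (0.498 : ℝ) ≤ (n : ℝ) ∧ (n : ℝ) < bigP D ^ (0.5 : ℝ)) with hS
  set W := S.filter (fun n : ℕ => ¬ (bigP D ^ (0.498 : ℝ) * ((D : ℝ) * t0 D) < (n : ℝ) ∧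
            (n : ℝ) < bigP D ^ (0.5 : ℝ) / bigT D ^ 11)) with hW
  set f : ℕ → ℝ := fun n =>
    ‖(‖χ (n : ZMod D)‖ : ℂ) * lamZero c' D j n / (n : ℂ)‖ * ((n : ℝ) / Nat.totient n) ^ 3 with hf
  rw [← Finset.sum_filter_add_sum_filter_not W (fun n : ℕ => (n : ℝ) ≤ bigP D ^ (0.498 : ℝ) * ((D : ℝ) * t0 D))]
  -- left window
  have hleft : ∑ n ∈ W.filter (fun n : ℕ => (n : ℝ) ≤ bigP D ^ (0.498 : ℝ) * ((D : ℝ) * t0 D)), f n ≤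
      Real.exp 256 * (3 + 520 * ell D) := by
    have hv : bigP D ^ (0.498 : ℝ) ≤ bigP D ^ (0.498 : ℝ) * ((D : ℝ) * t0 D) :=
      le_mul_of_one_le_right (by linarith) hDt1
    have h := sum_weights_le c' χ j h2' hv
      (S' := W.filter (fun n : ℕ => (n : ℝ) ≤ bigP D ^ (0.498 : ℝ) * ((D : ℝ) * t0 D)))
      (fun n hn => by
        obtain ⟨hn', hle⟩ := Finset.mem_filter.mp hn
        obtain ⟨hnS, -⟩ := Finset.mem_filter.mp hn'
        obtain ⟨-, hlo, -⟩ := Finset.mem_filter.mp hnS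
        exact ⟨hlo, hle⟩)
    refine h.trans ?_
    rw [Real.log_mul (by positivity) hDt.ne']
    have := log_Dt0_le hℓ
    have hpos : 0 < Real.exp 256 := Real.exp_pos _
    nlinarith
  -- right window
  have hright : ∑ n ∈ W.filter (fun n : ℕ => ¬ (n : ℝ) ≤ bigP D ^ (0.498 : ℝ) * ((D : ℝ) * t0 D)), f n ≤
      Real.exp 256 * (3 + 11 * ell D ^ (1.1 : ℝ)) := by
    have hu2 : 2 ≤ bigP D ^ (0.5 : ℝ) / bigT D ^ 11 := by
      refine two_le_rpow_div hT11 ?_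
      rw [Real.log_pow, log_bigT_eq]
      have h11 := ell_rpow_le_sq (D := D) hℓ1
      have h7 : (3 : ℝ) ^ 7 ≤ ell D ^ 7 := pow_le_pow_left₀ (by norm_num) hℓ 7
      push_cast
      nlinarith [pow_nonneg hℓ0.le 2]
    have hv : bigP D ^ (0.5 : ℝ) / bigT D ^ 11 ≤ bigP D ^ (0.5 : ℝ) :=
      div_le_self (bigP_rpow_pos D _).le hT11'
    have h := sum_weights_le c' χ j hu2 hv
      (S' := W.filter (fun n : ℕ => ¬ (n : ℝ) ≤ bigP D ^ (0.498 : ℝ) * ((D : ℝ) * t0 D)))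
      (fun n hn => by
        obtain ⟨hn', hle⟩ := Finset.mem_filter.mp hn
        obtain ⟨hnS, hnm⟩ := Finset.mem_filter.mp hn'
        obtain ⟨-, hlo, hhi⟩ := Finset.mem_filter.mp hnS
        rw [not_le] at hle
        refine ⟨?_, hhi.le⟩
        by_contra hcon
        rw [not_le] at hcon
        exact hnm ⟨hle, hcon⟩)
    refine h.trans (le_of_eq ?_)
    rw [Real.log_div (bigP_rpow_pos D _).ne' hT11.ne', Real.log_pow, log_bigT_eq]
    push_cast
    ring
  have hpos : 0 < Real.exp 256 := Real.exp_pos _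
  linarith

end TopWeights

section TopFinal

variable (c' : ℝ) {D : ℕ} [NeZero D] (χ : DirichletCharacter ℂ D)

/-- **The top range at a fixed modulus** [cite: Zhang2022LandauSiegel, §10 p. 60 (u050 (i))]:
under the bodies of Lemma 10.1, the relative Lemma 8.4 and the `ξ₀`-tail mean, for `𝓛 ≥ 4` and
`5|c′|α𝓛 ≤ 1`, `|S_{14,22}[P^{0.498},P^{0.5}) − topSum| ≤ K(C₁⁺,C₂⁺,C₃⁺)·𝓛^{5.5}·𝓛⁻¹⁵`. -/
theorem top_at (hℓ4 : 4 ≤ ell D) (hq : χ.IsQuadratic) (hp : χ.IsPrimitive)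
    (hc5 : 5 * |c'| * alpha D * ell D ≤ 1) {c C₁ C₂ C₃ : ℝ}
    (hTc : bigT D ^ (-c) ≤ (ell D ^ 7)⁻¹)
    (h101 : ∀ j ∈ ({1, 2, 3} : Finset ℕ), ∀ y : ℝ,
      (1 ≤ y → y ≤ bigP D ^ (0.5 : ℝ) / bigT D → ‖frakv1 c' χ j y‖ ≤ C₁ * bigT D ^ (-c)) ∧
      (bigP D ^ (0.5 : ℝ) < y → y ≤ bigP D ^ (0.502 : ℝ) / bigT D →
        ‖frakv1 c' χ j y - 500 * deriv χ.LFunction 1 / Real.log (bigP D) *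
          (-1 - betaJ c' D j * (Real.log (y / bigP D ^ (0.5 : ℝ)) : ℂ))‖ ≤ C₁ * (ell D ^ 15)⁻¹) ∧
      (bigP D ^ (0.502 : ℝ) < y → y ≤ bigP D ^ (0.504 : ℝ) / bigT D →
        ‖frakv1 c' χ j y - 500 * deriv χ.LFunction 1 / Real.log (bigP D) *
          (1 - betaJ c' D j * (Real.log (bigP D ^ (0.504 : ℝ) / y) : ℂ))‖ ≤ C₁ * (ell D ^ 15)⁻¹) ∧
      ((bigP D ^ (0.5 : ℝ) / bigT D < y ∧ y ≤ bigP D ^ (0.5 : ℝ)) ∨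
          (bigP D ^ (0.502 : ℝ) / bigT D < y ∧ y ≤ bigP D ^ (0.502 : ℝ)) ∨
          (bigP D ^ (0.504 : ℝ) / bigT D < y ∧ y < bigP D ^ (0.504 : ℝ)) →
        ‖frakv1 c' χ j y‖ ≤ C₁ * (ell D ^ 7)⁻¹))
    (h84 : ∀ j ∈ ({1, 2, 3} : Finset ℕ), ∀ μ ∈ ({6, 7} : Finset ℕ), ∀ d r : ℕ, 1 ≤ d → 1 ≤ r →
      ((d * r : ℕ) : ℝ) < bigP D / bigT D ^ 2 → ∀ y : ℝ, bigT D < y → y < bigP D →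
        ‖(∑ n ∈ Finset.Ico 1 ⌈y⌉₊, χ (n : ZMod D) * xiZero c' D j n d r / (n : ℂ) *
              ((y / n : ℝ) : ℂ) ^ (-betaMu D μ) * (Real.log (y / n) : ℂ)) -
            deriv χ.LFunction 1 * PiW χ d r * frakgW c' D j μ y‖ ≤
          C₂ * (ell D ^ 6)⁻¹ * (∏ q ∈ (d * r).primeFactors, (1 - (q : ℝ)⁻¹)⁻¹) ^ 2)
    (h3 : ∀ j ∈ ({1, 2, 3} : Finset ℕ), ∀ d r : ℕ, 1 ≤ d → 1 ≤ r →
      ((d * r : ℕ) : ℝ) < Skeleton.P1 D → ∀ x : ℝ, 1 ≤ x → x ≤ bigT D →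
        ∑ n ∈ Finset.Ico 1 ⌈x⌉₊, ‖xiZero c' D j n d r‖ / n ≤ C₃ * ell D * (1 + Real.log x) ^ 3)
    {j : ℕ} (hj : j ∈ ({1, 2, 3} : Finset ℕ)) :
    ‖S1422On c' χ j (bigP D ^ (0.498 : ℝ)) (bigP D ^ (0.5 : ℝ)) - topSum1422 c' χ j‖ ≤
      Real.exp 256 *
          ((28000 * Real.exp (9 / 2) + max C₁ 0 + 2000 * Real.exp (9 / 2) * (4 * π) * 520) * 9 * max C₂ 0 +
            (max C₁ 0 + 2000 * Real.exp (9 / 2) * (4 * π) * 520) * (4 * Real.exp (9 / 2)) * 146 * 9 +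
            537 * (max C₁ 0 + 28000 * Real.exp (9 / 2)) * 9 * (584 * Real.exp (9 / 2) + max C₂ 0 + 8 * max C₃ 0) +
            537 * (28000 * Real.exp (9 / 2)) * (4 * Real.exp (9 / 2)) * 146 * 9 +
            28000 * Real.exp (9 / 2) * (4 * Real.exp (9 / 2)) * 100000) *
        (ell D ^ (1.1 : ℝ)) ^ 5 * (ell D ^ 15)⁻¹ := by
  classical
  have hℓ : 3 ≤ ell D := by linarith
  have hℓ1 : 1 ≤ ell D := by linarith
  have hℓ0 : 0 < ell D := by linarith
  obtain ⟨-, -, -, h5504, -, -, hN⟩ := range_facts (D := D) hℓ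
  have h101' := body101_mono c' χ (le_max_left C₁ 0) h101
  have h84' := body84_mono c' χ (le_max_left C₂ 0) h84
  have h3' := body3_mono c' (le_max_left C₃ 0) h3
  have hA := top_assembly_le c' χ hℓ hq hp hc5 (le_max_right C₁ 0) (le_max_right C₂ 0)
    (le_max_right C₃ 0) hTc h101' h84' h3' hj
  have hB := top_Gswap_le c' χ hℓ hp hc5 j
  have hC := top_mainterm_eq c' χ hℓ j
  rw [hC] at hB
  rw [log_bigT_eq] at hA
  rw [S1422On_eq_divisor_sum c' χ hℓ j (fun n hn => hN n (hn.trans_le h5504))]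
  refine (norm_sub_le_norm_sub_add_norm_sub _ _ _).trans ((add_le_add hA hB).trans ?_)
  -- weights
  have hτ := ell_le_rpow (D := D) hℓ1
  have h9 : 3 + 0.002 * ell D ^ 9 ≤ ell D ^ 9 := by
    have : (3 : ℝ) ^ 9 ≤ ell D ^ 9 := pow_le_pow_left₀ (by norm_num) hℓ 9
    nlinarith
  have hWa := (top_weights_all_le c' χ hℓ j).trans
    (mul_le_mul_of_nonneg_left h9 (Real.exp_pos _).le)
  have hWw : _ ≤ 537 * Real.exp 256 * ell D ^ (1.1 : ℝ) :=
    (top_weights_window_le c' χ hℓ j).trans (by nlinarith [Real.exp_pos 256])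
  have hWm : (∑ n ∈ ((Finset.Ico 1 (Nsupp D)).filter
        (fun n : ℕ => bigP D ^ (0.498 : ℝ) ≤ (n : ℝ) ∧ (n : ℝ) < bigP D ^ (0.5 : ℝ))).filter
          (fun n : ℕ => bigP D ^ (0.498 : ℝ) * ((D : ℝ) * t0 D) < (n : ℝ) ∧
              (n : ℝ) < bigP D ^ (0.5 : ℝ) / bigT D ^ 11),
        ‖(‖χ (n : ZMod D)‖ : ℂ) * lamZero c' D j n / (n : ℂ)‖ * ((n : ℝ) / Nat.totient n) ^ 3) ≤
      Real.exp 256 * ell D ^ 9 :=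
    (Finset.sum_le_sum_of_subset_of_nonneg (Finset.filter_subset _ _)
      (fun n _ _ => by positivity)).trans hWa
  exact mid_numeric_bound (τ := ell D ^ (1.1 : ℝ)) (L := ‖deriv χ.LFunction 1‖)
    (R := (‖iota3‖ / Real.log (Skeleton.P3 D) + ‖iota4‖ / Real.log (Skeleton.P2 D)))
    hℓ hτ hWm hWw hWa (iotaR_nonneg hℓ) (iotaR_le hℓ) (norm_nonneg _)
    (norm_deriv_L_one_le χ hℓ hp) (le_max_right _ _) (le_max_right _ _) (le_max_right _ _)

end TopFinal

end Ranges1422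

/-! ## The edges (DAG nodes Z22:§10.u049 (ii) and Z22:§10.u050 (i)) -/

section Edges

open Ranges1422

variable (c' : ℝ)

/-- **DAG node Z22:§10.u049 (ii) as an edge** [cite: Zhang2022LandauSiegel, §10 p. 59]:
Lemma 10.1 and the relative Lemma 8.4 imply the middle-range evaluation `Mid1422Eval` of
`S_j(𝐚₁₄,𝐚₂₂)` on `[P^{0.496}, P^{0.498})`. -/
theorem mid1422Eval_of_rel (h101 : Lemma101 c') (h84 : Lemma84Rel c') : Mid1422Eval c' := by
  intro ε hε
  obtain ⟨c, hc, C₁, H101⟩ := h101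
  obtain ⟨C₂, H84⟩ := h84
  obtain ⟨C₃, H3⟩ := XiZeroMajorant.xiZeroTailMean c'
  set K : ℝ := Real.exp 256 *
          ((28000 * Real.exp (9 / 2) + max C₁ 0 + 2000 * Real.exp (9 / 2) * (4 * π) * 520) * 9 * max C₂ 0 +
            (max C₁ 0 + 2000 * Real.exp (9 / 2) * (4 * π) * 520) * (4 * Real.exp (9 / 2)) * 146 * 9 +
            537 * (max C₁ 0 + 28000 * Real.exp (9 / 2)) * 9 * (584 * Real.exp (9 / 2) + max C₂ 0 + 8 * max C₃ 0) +
            537 * (28000 * Real.exp (9 / 2)) * (4 * Real.exp (9 / 2)) * 146 * 9 +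
            28000 * Real.exp (9 / 2) * (4 * Real.exp (9 / 2)) * 100000) with hK
  have hK0 : 0 ≤ K := by positivity
  set x : ℝ := max 4 (max (5 * |c'| * π) (max ((7 / c) ^ 10) (K ^ 2 / (ε ^ 2 * π ^ 2)))) with hx
  have FL : ForAllLarge fun D _ _ => 4 ≤ ell D ∧ 5 * |c'| * π ≤ ell D ∧ (7 / c) ^ 10 ≤ ell D ∧
      K ^ 2 / (ε ^ 2 * π ^ 2) ≤ ell D := by
    refine ForAllLarge.of_le ⌈Real.exp x⌉₊ fun D _ χ hD _ _ => ?_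
    have hxℓ := le_ell_of_ceil_exp_le hD
    refine ⟨?_, ?_, ?_, ?_⟩ <;> refine le_trans ?_ hxℓ <;> simp [hx]
  refine (((H101.and H84).and H3).and FL).mono ?_
  intro D _ χ hq hp ⟨⟨⟨hA, hB⟩, hC⟩, h4, h5, h7, hKℓ⟩ hAss j hj
  have hℓ : 3 ≤ ell D := by linarith
  have hℓ1 : 1 ≤ ell D := by linarith
  exact (mid_at c' χ h4 hq hp (hc5_of_le c' hℓ h5) (hTc := bigT_rpow_neg_le hc hℓ1 h7)
    (hA hAss) (hB hAss) hC hj).trans (K_tau5_le_eps_alpha hK0 hε hℓ hKℓ)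

/-- **Z22:§10.u049 (ii) from the printed Lemma 8.4** (the absolute `Lemma84` implies `Lemma84Rel`).
[cite: Zhang2022LandauSiegel, §10 p. 59] -/
theorem mid1422Eval_of (h101 : Lemma101 c') (h84 : Lemma84 c') : Mid1422Eval c' :=
  mid1422Eval_of_rel c' h101 (lemma84Rel_of_lemma84 h84)

/-- **Z22:§10.u049 (ii) from the relative Lemma 8.4 alone** for `c′ ≥ 0` (Lemma 10.1 is then the
tree's theorem `Skeleton.lemma101_holds`). [cite: Zhang2022LandauSiegel, §10 p. 59] -/
theorem mid1422Eval_of_lemma84Rel (hc' : 0 ≤ c') (h84 : Lemma84Rel c') : Mid1422Eval c' :=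
  mid1422Eval_of_rel c' (lemma101_holds hc') h84

/-- **DAG node Z22:§10.u050 (i) as an edge** [cite: Zhang2022LandauSiegel, §10 p. 60]:
Lemma 10.1 and the relative Lemma 8.4 imply the top-range evaluation `Top1422Eval` of
`S_j(𝐚₁₄,𝐚₂₂)` on `[P^{0.498}, P^{0.5})`. -/
theorem top1422Eval_of_rel (h101 : Lemma101 c') (h84 : Lemma84Rel c') : Top1422Eval c' := by
  intro ε hε
  obtain ⟨c, hc, C₁, H101⟩ := h101
  obtain ⟨C₂, H84⟩ := h84
  obtain ⟨C₃, H3⟩ := XiZeroMajorant.xiZeroTailMean c'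
  set K : ℝ := Real.exp 256 *
          ((28000 * Real.exp (9 / 2) + max C₁ 0 + 2000 * Real.exp (9 / 2) * (4 * π) * 520) * 9 * max C₂ 0 +
            (max C₁ 0 + 2000 * Real.exp (9 / 2) * (4 * π) * 520) * (4 * Real.exp (9 / 2)) * 146 * 9 +
            537 * (max C₁ 0 + 28000 * Real.exp (9 / 2)) * 9 * (584 * Real.exp (9 / 2) + max C₂ 0 + 8 * max C₃ 0) +
            537 * (28000 * Real.exp (9 / 2)) * (4 * Real.exp (9 / 2)) * 146 * 9 +
            28000 * Real.exp (9 / 2) * (4 * Real.exp (9 / 2)) * 100000) with hK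
  have hK0 : 0 ≤ K := by positivity
  set x : ℝ := max 4 (max (5 * |c'| * π) (max ((7 / c) ^ 10) (K ^ 2 / (ε ^ 2 * π ^ 2)))) with hx
  have FL : ForAllLarge fun D _ _ => 4 ≤ ell D ∧ 5 * |c'| * π ≤ ell D ∧ (7 / c) ^ 10 ≤ ell D ∧
      K ^ 2 / (ε ^ 2 * π ^ 2) ≤ ell D := by
    refine ForAllLarge.of_le ⌈Real.exp x⌉₊ fun D _ χ hD _ _ => ?_
    have hxℓ := le_ell_of_ceil_exp_le hD
    refine ⟨?_, ?_, ?_, ?_⟩ <;> refine le_trans ?_ hxℓ <;> simp [hx]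
  refine (((H101.and H84).and H3).and FL).mono ?_
  intro D _ χ hq hp ⟨⟨⟨hA, hB⟩, hC⟩, h4, h5, h7, hKℓ⟩ hAss j hj
  have hℓ : 3 ≤ ell D := by linarith
  have hℓ1 : 1 ≤ ell D := by linarith
  exact (top_at c' χ h4 hq hp (hc5_of_le c' hℓ h5) (hTc := bigT_rpow_neg_le hc hℓ1 h7)
    (hA hAss) (hB hAss) hC hj).trans (K_tau5_le_eps_alpha hK0 hε hℓ hKℓ)

/-- **Z22:§10.u050 (i) from the printed Lemma 8.4** (the absolute `Lemma84` implies `Lemma84Rel`).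
[cite: Zhang2022LandauSiegel, §10 p. 60] -/
theorem top1422Eval_of (h101 : Lemma101 c') (h84 : Lemma84 c') : Top1422Eval c' :=
  top1422Eval_of_rel c' h101 (lemma84Rel_of_lemma84 h84)

/-- **Z22:§10.u050 (i) from the relative Lemma 8.4 alone** for `c′ ≥ 0` (Lemma 10.1 is then the
tree's theorem `Skeleton.lemma101_holds`). [cite: Zhang2022LandauSiegel, §10 p. 60] -/
theorem top1422Eval_of_lemma84Rel (hc' : 0 ≤ c') (h84 : Lemma84Rel c') : Top1422Eval c' :=
  top1422Eval_of_rel c' (lemma101_holds hc') h84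

/-- **Both ranges together** (u049 (ii) ∧ u050 (i)) from Lemma 10.1 and the relative Lemma 8.4.
[cite: Zhang2022LandauSiegel, §10 pp. 59–60] -/
theorem mid_and_top1422Eval_of_rel (h101 : Lemma101 c') (h84 : Lemma84Rel c') :
    Mid1422Eval c' ∧ Top1422Eval c' :=
  ⟨mid1422Eval_of_rel c' h101 h84, top1422Eval_of_rel c' h101 h84⟩

end Edges

end Literature.NumberTheory.LFunctions.Zhang2022.Typed.Sec10C
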